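import Summits.AtomisticToContinuum.FouriersLaw.Theses.LatticeLandauDamping
import Summits.AtomisticToContinuum.FouriersLaw.Theses.EmbeddedDrudeMourre
import Literature.MathematicalPhysics.KineticTheory.LangevinChainKernel
import Literature.MathematicalPhysics.KineticTheory.LangevinChainGibbs
import Literature.MathematicalPhysics.KineticTheory.InfiniteChainSuperstableDynamics
import Literature.MathematicalPhysics.KineticTheory.InfiniteChainInvariantStates
import Literature.MathematicalPhysics.KineticTheory.InfiniteChainSuperstableOrbits
import Summits.AtomisticToContinuum.FouriersLaw.Theorems.StaticAbelianSqueezeKuboAbelIdentity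
import Summits.AtomisticToContinuum.FouriersLaw.Theorems.OddSectorIrreversibilityCorrectorResponseNonneg
import Summits.AtomisticToContinuum.FouriersLaw.Theorems.EmbeddedDrudeMourreGreenKuboContinuationCanonicalSeedOfRegularState
import Summits.AtomisticToContinuum.FouriersLaw.Theorems.LatticeLandauDampingAbelThermodynamicLimitResolventFormPos
import Summits.AtomisticToContinuum.FouriersLaw.Theorems.LatticeLandauDampingAbelThermodynamicLimitDyadicFekete
import Summits.AtomisticToContinuum.FouriersLaw.Theorems.LatticeLandauDampingAbelThermodynamicLimitWitnessRegularisationOfWitnessTightness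
import Summits.AtomisticToContinuum.FouriersLaw.Theorems.LatticeLandauDampingAbelThermodynamicLimitFixedFrequencyMatchingAutocorrBound
import Summits.AtomisticToContinuum.FouriersLaw.Theorems.LatticeLandauDampingAbelThermodynamicLimitFixedFrequencyMatchingOfFixedTime
import Summits.AtomisticToContinuum.FouriersLaw.Theorems.LatticeLandauDampingAbelThermodynamicLimitQuasiSuperadditivityResolventCorrector
import Summits.AtomisticToContinuum.FouriersLaw.Theorems.LatticeLandauDampingAbelThermodynamicLimitFixedFrequencyMatchingPairSums
import Summits.AtomisticToContinuum.FouriersLaw.Theorems.LatticeLandauDampingAbelThermodynamicLimitFixedFrequencyMatchingUniformLeaves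
import Summits.AtomisticToContinuum.FouriersLaw.Theorems.LatticeLandauDampingAbelThermodynamicLimitFixedTimeMatchingSharedLeaves
import Summits.AtomisticToContinuum.FouriersLaw.Theorems.LatticeLandauDampingAbelThermodynamicLimitWitnessTightOfUniformEnergyBound
import Literature.MathematicalPhysics.KineticTheory.InfiniteChainGibbsUniqueness
import Summits.AtomisticToContinuum.FouriersLaw.Theorems.LatticeLandauDampingAbelThermodynamicLimitUniformAnchoredCorrelationTails
import Summits.AtomisticToContinuum.FouriersLaw.Theorems.LatticeLandauDampingAbelThermodynamicLimitBulkWindowEquivalence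
import Summits.AtomisticToContinuum.FouriersLaw.Theorems.LatticeLandauDampingAbelThermodynamicLimitOpenChainSeveredLocality
import Summits.AtomisticToContinuum.FouriersLaw.Theorems.LatticeLandauDampingAbelThermodynamicLimitOffsetMatchingOfEngines
import Literature.MathematicalPhysics.KineticTheory.InfiniteChainStates
import Literature.MathematicalPhysics.KineticTheory.InfiniteChainSevered
import Literature.MathematicalPhysics.KineticTheory.InfiniteChainDynamicsCondB1
import Summits.AtomisticToContinuum.FouriersLaw.Theorems.LatticeLandauDampingAbelThermodynamicLimitOfSignLaws
import Summits.AtomisticToContinuum.FouriersLaw.Theorems.LatticeLandauDampingAbelThermodynamicLimitOfUniformAbelianRegularity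
import Summits.AtomisticToContinuum.FouriersLaw.Theorems.EmbeddedDrudeMourreAbelThermodynamicLimitOfLowerBound
import Summits.AtomisticToContinuum.FouriersLaw.Theorems.LatticeLandauDampingAbelThermodynamicLimitEqualTimeBound
import Summits.AtomisticToContinuum.FouriersLaw.Theorems.LatticeLandauDampingAbelThermodynamicLimitAutocorrIntegrableOn
import Summits.AtomisticToContinuum.FouriersLaw.Theorems.LatticeLandauDampingAbelThermodynamicLimitAbelDeficitOfSignedTail
import Summits.AtomisticToContinuum.FouriersLaw.Theorems.LatticeLandauDampingAbelThermodynamicLimitBirthCut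
import Summits.AtomisticToContinuum.FouriersLaw.Theorems.LatticeLandauDampingAbelThermodynamicLimitSignedTail
import Summits.AtomisticToContinuum.FouriersLaw.Theorems.EmbeddedDrudeMourreAbelOfSpectralDensity
import Summits.AtomisticToContinuum.FouriersLaw.Theorems.LatticeLandauDampingAbelThermodynamicLimitWindowRegularity

/-!
# Line `series-law-at-every-laplace-frequency` (SketchIdeator2) — LEAD'S SKELETON (rev 18) for crux
`LatticeLandauDamping.AbelThermodynamicLimit` (stmt-AtomisticToContinuum-14013)

Leads: `prover-line-stmt-AtomisticToContinuum-14013-0` (cycle 1, revs 1–5, 17 stubs landed) and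
`prover-line-stmt-AtomisticToContinuum-14013-c1-0` (continuation, revs 6–8, 2026-08-16; cycle 2 landed (C′), (E1), (M1sev), the coupling and (B′): the
fixed-frequency matching S3 is now a THEOREM and the skeleton has exactly THREE sorries — QS, QSR, SI) and
`prover-line-stmt-AtomisticToContinuum-14013-c2-0` (continuation, rev 9, cycle 3, 2026-08-16: the COMPOSITION itself is now an importable
Theorems certificate — `Theorems/LatticeLandauDampingAbelThermodynamicLimitOfSignLaws.lean`, p127321: registered `stub_cruxOfSignLaws`
(QS → QSR → SI → crux BY NAME), the strategist's D2 split glue `abelThermodynamicLimit_of_halves` (SI → NoOvershoot → NoDeficit → crux,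
binder form, ready for `route edit --split … --glue-by`), the halves at SHIFT-INVARIANT witnesses from QS / QSR, and the planner-REPAIRED crux
from QS ∧ QSR (`abelThermodynamicLimitRepaired_of_signLaws`); see `## Landed composition (rev 9)` at the end. Rev 10 (same cycle):
the line's open core is DOMINATED BY AN EXISTING ITEM — `Theorems/LatticeLandauDampingAbelThermodynamicLimitOfUniformAbelianRegularity.lean`
(p127738) proves that (R) = `StaticAbelianSqueeze.UniformAbelianRegularity` (stmt-AtomisticToContinuum-13416, open-problem class) ALONE
gives the repaired crux (`stub_repairedCruxOfUniformAbelianRegularity`, registered), that (R) ∧ SI give the crux BY NAME, and conversely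
that `Dn → κ` at a shift-invariant witness gives the (R)-estimate there (`regularityEstimate_of_tendsto`) — so QS ∧ QSR ⟹ (R) and every
line of both twin cruxes closes on (R) + the seam. Rev 10 registers (R) verbatim BY NAME as the fourth stub `stub_uniformAbelianRegularity`
and adds the second composition `AbelThermodynamicLimit_of_uniformAbelianRegularity'`. Rev 11 (end of cycle 3, after strategist s1's
census): the twin's LANDED certificate `LoomisCompactHorizonWitness.stub_cruxOfRegularityOfLowerBound` (p127832: (R) → CLB → crux, the
hypothesis witness DISCARDED — (R) + the landed matching make `T²D_N(N−1)/N` Cauchy and identify its limit with the regular pair's Abel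
limit; CLB = `StaticAbelianSqueeze.ConductanceLowerBound` = item stmt-AtomisticToContinuum-11749 makes it positive) gives a THIRD
composition with NO SEAM; rev 11 registers CLB BY NAME as the fifth stub `stub_conductanceLowerBound` (strategist s1's recommended
2-stub end state {(R), CLB}, `Lines/exchange_and_positivity.lean`, taken into this slot). Sorries: QS, QSR, SI, (R), CLB; the crux's
minimal sorry-cones are {QS, QSR, SI}, {(R), SI} and {(R), CLB} — the last one consists of two EXISTING, refuter-vetted items). 
Rev 12 (lead `prover-line-stmt-AtomisticToContinuum-14013-c3-0`, cycle 4, 2026-08-17): (R) is OPENED ALONG ITS OWN BIRTH CUT — the stubs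
`stub_equalTimeBound` / `stub_uniformL1Tail` of stmt-13416's registered skeleton `Cruxes/UniformAbelianRegularity/Lines/birth.lean` (byte-identical,
also the twin's `Lines/l1_tail_transport.lean`), with `stub_uniformL1Tail` DERIVED from `stub_autocorrIntegrableOn` (fixed-`N`, provable now) and the
residual `stub_uniformAbsTail` (lead-held); (R) by name becomes a theorem modulo {equalTimeBound, autocorrIntegrableOn, uniformAbsTail} via birth's
glue (see `### Rev 12` below). Sorries (7 = stubs_max): QS, QSR, SI, equalTimeBound, autocorrIntegrableOn, uniformAbsTail, CLB. Rev 13 (same cycle, after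
the wave): `stub_equalTimeBound` LANDED p144650, `stub_autocorrIntegrableOn` LANDED p144688 (both restated closed below); sorries (5): QS, QSR, SI, uniformAbsTail, CLB —
(R) by name is a theorem modulo `stub_uniformAbsTail` ALONE. Rev 14 (same cycle): the residual is WEAKENED to the SIGNED uniform tail
`stub_uniformSignedTail` (no `L¹` bet; implied by the absolute tail, `uniformSignedTail_of_uniformAbsTail`) through the abstract lemma
`stub_abelDeficitOfSignedTail` (worker); sorries (6): QS, QSR, SI, abelDeficitOfSignedTail, uniformSignedTail, CLB. Rev 15: the abstract lemma
LANDED (p146330) and the glue files `…BirthCut.lean` (p146397) LANDED and imported; sorries (5): QS, QSR, SI, uniformSignedTail, CLB —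
(R) by name is a theorem modulo the SIGNED residual `stub_uniformSignedTail` ALONE; minimal seam-free sorry-cone of the crux {uniformSignedTail, CLB}.
Rev 16: the signed glue LANDED as `Theorems/LatticeLandauDampingAbelThermodynamicLimitSignedTail.lean` (p148211; imported, inline proofs replaced by references).
Rev 17 (after crux-strategist s2's `Lines/window_regularity.lean`): the ROUTE-FAITHFUL cone — the route's three spectral cruxes WD (stmt-14011), NDW (stmt-14012),
PD (stmt-14014) registered BY NAME, the seam SI DERIVED from them (a theorem on this route), new compositions `AbelThermodynamicLimit_of_uniformSignedTail_window`
(cone {ST, WD, NDW, PD}: no seam, no CLB) and `fouriersLaw_of_uniformSignedTail_window` (the conjunct through `closes`); sorries (7): QS, QSR, WD, NDW, PD, ST, CLB.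
Rev 18: the window glue LANDED as `Theorems/LatticeLandauDampingAbelThermodynamicLimitWindowRegularity.lean` (p166022; imported, inline copies replaced by references) —
EVERY glue / infrastructure decl of this line is now a landed theorem; the 7 sorries are exactly 5 OTHER ITEMS by name (13416's content ST, 11749, 14011, 14012, 14014)
plus the line's two conjectural sign laws QS/QSR (idle: in no minimal cone). Crux decl (FIXED):
`Summit.AtomisticToContinuum.FouriersLaw.Theses.LatticeLandauDamping.AbelThermodynamicLimit`; it is
`Iff.rfl`-identical to the sibling crux `EmbeddedDrudeMourre.AbelThermodynamicLimit` (stmt-12596, whose lines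
`fekete-at-every-laplace-frequency` / `loomis-compact-horizon-witness` share this directory), see
`crux_iff_sibling` below — so every stub shared verbatim with those lines lands ONCE for both cruxes.

For `P = pinnedChain ω₂ lam β γ` (all `> 0`), under weak-NESS uniqueness `Uniq` (now a theorem, `NessUnique_holds`) and
`T > 0`: IF an Abelian Green–Kubo witness `(μT, D, κ)` exists at `T` (DLR Gibbs state, `μT`-preserving infinite-volume
dynamics with absolutely convergent current correlations, `κ > 0`, `T⁻² ∫₀^∞ e^{-νt} C_T(t) dt → κ` as `ν ↓ 0`) THEN
some witness has `Dn → κ` for every steady family and every response sequence `Dn`.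

## Architecture (two sign laws; rev 8/9: THREE open stubs QS, QSR, SI — `sorry` only inside `stub_*`; the halves `noOvershoot_of_QS` /
`noDeficit_of_QSR` are CLOSED theorems taking one sign law each as hypothesis; rev 9: all of it also LANDED, p127001 + p127321)

Objects (OPEN chain, both baths at `T`; verbatim the `c_N`, `F_N` of `StaticAbelianSqueeze` (K)/(R) and of the
fekete line): `c_N(t) = ∫ J·(P_t J) dμ_{N,T}`, `J = Σ_b j_b`; `F_N(ν) = ∫₀^∞ e^{-νt} c_N(t) dt`; the
Laplace-resolved RESISTANCE `R_N(ν) = (N−1)²T²/F_N(ν)` (so `R_N(0⁺) = (N−1)/D_N` by (K)).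

* `stub_quasiSuperadditivity` (QS; DOUBLING de Bruijn–Erdős form): `2F_N − C(2N)^θ ≤ F_{2N}` on `(0, ν₀]`, `θ < 1`.
* `stub_quasiSuperadditiveResistance` (QSR; THIS line's lever, held by the lead): `2R_N − C(2N)^θ ≤ R_{2N}`.
  In the diffusive regime (`F_N = N·a(ν) + e_N`, `e_N = o(N)`) QS and QSR are the two SIDES of one statement,
  `|2e_N − e_{2N}| ≤ C N^θ` uniformly in `ν ∈ (0, ν₀]` (lead c1's note); they separate only in the ballistic
  regime, where both still hold (harmonic corner, exact) while the two-sided bulk law `|F_N − N a(ν)| = O(N^θ)` fails.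
* `stub_fixedFrequencyMatching` (S3, shared with fekete): a THEOREM since rev 8 — its two dynamical leaves are LANDED:
  (C′) `stub_uniformAnchoredCorrelationTails` (open-chain light cone at fixed time, anchor-uniform; p115961) and
  (B′) `stub_uniformFixedTimeOffsetMatching` (per-offset fixed-time open/closed matching; p126508 via the engines (E1) p121150,
  (M1sev) p124064 and the coupling `stub_uniformFixedTimeOffsetMatchingOfEngines` p126508).
* `stub_witnessRegularisation` (the three-crux seam, shared): rev 6 — CLOSED MODULO SI `stub_witnessShiftInvariant`
  ("WLOG the witness state is shift-invariant") by landed Literature (`oneSiteTight_of_isShiftInvariant`,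
  `isShiftInvariant_and_hasSuperstabilityEstimate_of_tight_pinnedChain`); SI is exactly the planner-level repair of the
  crux (add shift-invariance to the witness clause, as the route's other cruxes do) and is not decidable in the tree.
* `stub_resolventFormPos`, `stub_tightDLRUnique`, `stub_regularDLRUnique`, the real analysis and all wave-1
  reductions: LANDED (restated closed below so the registration keeps listing them).

LANDED and used directly (no stub): the fixed-`N` open-chain Kubo–Abel identity (K)
`StaticAbelianSqueeze.kuboAbelIdentity_holds` — the ONLY place where `0 < γ` and `Uniq` act (Disproof §2a) — and
`0 ≤ D_N` (`response_nonneg_of_correctorTheory` ∘ `CorrectorTheory_proof`).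

Composition (`AbelThermodynamicLimit_of`, kernel-checked below): regularise and OUTPUT the witness; (K) +
dominated convergence give `F_N(ν) → (N−1)T²D_N` (`ν ↓ 0`); Fekete at fixed `ν` (QS) + matching + the witness
⇒ `(N−1)T²D_N ≤ N·T²κ + C'N^θ` (upper half); dyadic Fekete at fixed `ν` (QSR) + matching bound `R_N(ν)` on
`(0,ν₀]`; with `F_N(ν) > 0` and `0 ≤ D_N` this FORCES `0 < D_N` and `(N−1)/D_N ≤ N/κ + C''N^θ` (lower half);
the two envelopes squeeze `D_N → κ` (`two_sign_laws_tendsto'`).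

## Disproof used (`Cruxes/AbelThermodynamicLimit/Disproof.lean`, cdisprove v5 + §7 seat 14013, rc 0; re-read 2026-08-16 by lead c1)
§0/§7.0 `crux_iff`: `Iff.rfl` for this decl (`crux_iff_sibling`). §7.1: `Uniq` discharged (`NessUnique_holds`) — the
composition still takes `hU` from the crux's binder and feeds it to (K). §2a γ-blindness honoured (γ enters only through (K)
and the kernels inside `F_N`, `R_N`). §2b: every stub carries `0 < T`. §2c harmonic corner = calibration: QS, QSR HOLD at
`lam = β = 0` (exact jobs j015113/j015116, junction constants → `1/G_∞`); the conclusion fails there only through the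
witness (`K_{0⁺} = ∞`). §3 (`hasBoundedResponse_of_crux'`) paid by the upper envelope. §7.2 kill criteria
(`not_qsrShape_of_rpow_correction`, `twoSided_dc_law`, `not_qsShape_of_excess_from_above`) were written for the rev-1
PLAIN forms; the registered rev-3 de Bruijn–Erdős forms tolerate every power-law finite-size correction and die only at
corrections slower than any power (e.g. `D_N = κ(1 − c/log N)` gives a DC doubling defect `≍ N/log²N`). §7.3 verdict
`resists`; 0 stub-false / 0 misstated. Landed `Negative/LoadBearing.lean`, `Negative/SignLawsKillCriteria.lean` are not
importable shortcuts for any open stub (they concern the crux shape and abstract sequences).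
-/

noncomputable section

namespace Summit.AtomisticToContinuum.FouriersLaw.Cruxes.AbelThermodynamicLimit.SeriesLawAtEveryLaplaceFrequency

open MeasureTheory Filter Set Topology
open Literature.MathematicalPhysics.KineticTheory.HeatConduction

/-- The two cruxes sharing this directory are the same proposition (up to parenthesisation). -/
theorem crux_iff_sibling :
    Summit.AtomisticToContinuum.FouriersLaw.Theses.LatticeLandauDamping.AbelThermodynamicLimit ↔
      Summit.AtomisticToContinuum.FouriersLaw.Theses.EmbeddedDrudeMourre.AbelThermodynamicLimit :=
  Iff.rfl

/-! ## Real analysis of the line — LANDED (p99225, `Theorems/LatticeLandauDampingAbelThermodynamicLimitDyadicFekete.lean`)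

The dyadic Fekete lemma with power allowance, the two-envelope squeeze and their helpers (`fekete_pow`,
`fekete_pow_abel_upper`, `dc_of_resistance_bound`, `two_sign_laws_tendsto'`, `tendsto_laplace_zero`,
`tendsto_resistance_div`, `tendsto_const_mul_rpow_div`, `dyadic_const_pos`) live in the landed file under namespace
`Summit.AtomisticToContinuum.FouriersLaw.Theorems.AbelThermodynamicLimit.SeriesLawAtEveryLaplaceFrequency`; the two registered real-analysis stubs are
restated here (closed) so that the registration keeps listing them. -/

/-- **Registered stub `stub_dyadicFeketePow`** — LANDED (p99225): de Bruijn–Erdős–Fekete at a fixed Laplace frequency,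
doubling form with a power allowance `θ < 1`. -/
theorem stub_dyadicFeketePow : ∀ (G : ℕ → ℝ) (g C θ : ℝ) (N₀ : ℕ), 1 ≤ N₀ → 0 ≤ C → θ < 1 → (∀ N : ℕ, N₀ ≤ N → 2 * G N - C * ((2 * N : ℕ) : ℝ) ^ θ ≤ G (2 * N)) → Filter.Tendsto (fun N : ℕ => G N / N) Filter.atTop (nhds g) → ∀ N : ℕ, N₀ ≤ N → G N ≤ N * g + C * ((2:ℝ) ^ (θ - 1) / (1 - (2:ℝ) ^ (θ - 1))) * (N : ℝ) ^ θ :=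
  Summit.AtomisticToContinuum.FouriersLaw.Theorems.AbelThermodynamicLimit.SeriesLawAtEveryLaplaceFrequency.stub_dyadicFeketePow

/-- **Registered stub `stub_twoSignLawsTendsto`** — LANDED (p99225): the two envelopes with sub-linear allowances
squeeze `D_N → κ`. -/
theorem stub_twoSignLawsTendsto : ∀ (D E E' : ℕ → ℝ) (κ : ℝ) (N₀ : ℕ), 2 ≤ N₀ → 0 < κ → (∀ N, 0 ≤ E N) → Filter.Tendsto (fun N : ℕ => E N / N) Filter.atTop (nhds 0) → Filter.Tendsto (fun N : ℕ => E' N / N) Filter.atTop (nhds 0) → (∀ N : ℕ, N₀ ≤ N → 0 < D N) → (∀ N : ℕ, N₀ ≤ N → ((N : ℝ) - 1) / D N ≤ N * κ⁻¹ + E N) → (∀ N : ℕ, N₀ ≤ N → ((N : ℝ) - 1) * D N ≤ N * κ + E' N) → Filter.Tendsto D Filter.atTop (nhds κ) :=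
  Summit.AtomisticToContinuum.FouriersLaw.Theorems.AbelThermodynamicLimit.SeriesLawAtEveryLaplaceFrequency.stub_twoSignLawsTendsto


/-! ## Proof-side shorthand (never used inside a stub signature: a Lines file is not importable) -/

/-- Total bond current `J = Σ_b j_b` of the `N`-chain. -/
def Jtot (ω₂ lam β γ : ℝ) (N : ℕ) (z : PhaseSpace N) : ℝ :=
  ∑ i : Fin N, (pinnedChain ω₂ lam β γ).bondCurrent N i z

/-- Open-chain equilibrium current autocorrelation `c_N(t) = ∫ J · (P_t J) dμ_{N,T}`. -/
def cN (ω₂ lam β γ T : ℝ) (N : ℕ) (t : ℝ) : ℝ :=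
  ∫ z, Jtot ω₂ lam β γ N z *
      (∫ y, Jtot ω₂ lam β γ N y ∂((pinnedChain ω₂ lam β γ).transitionKernel N T T t.toNNReal z))
    ∂((pinnedChain ω₂ lam β γ).gibbsMeasure N T)

/-- The current resolvent form `F_N(ν) = ∫₀^∞ e^{-νt} c_N(t) dt`. -/
def FN (ω₂ lam β γ T : ℝ) (N : ℕ) (ν : ℝ) : ℝ :=
  ∫ t in Ioi (0 : ℝ), Real.exp (-(ν * t)) * cN ω₂ lam β γ T N t

/-- The Laplace-resolved resistance `R_N(ν) = (N−1)²T²/F_N(ν)`. -/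
def RN (ω₂ lam β γ T : ℝ) (N : ℕ) (ν : ℝ) : ℝ :=
  ((N : ℝ) - 1) ^ 2 * T ^ 2 / FN ω₂ lam β γ T N ν

/-! ## Registered stubs (the lemmas of the line; `sorry` only here; every signature self-contained) -/

/-- **Stub QS — `stub_quasiSuperadditivity`: the conductance-side SIGN LAW, DOUBLING / de Bruijn–Erdős form** (size
XL; rev 3: WEAKER than fekete's verbatim S2 `F_N + F_M − C ≤ F_{N+M}`, which implies it with `θ = 0`; it is exactly
the quantity the exact/MD tests measure). For `P = pinnedChain ω₂ lam β γ` (all `> 0`) and `T > 0` there are `C ≥ 0`,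
`θ < 1`, `ν₀ > 0`, `N₀` with `2F_N(ν) − C(2N)^θ ≤ F_{2N}(ν)` for all `ν ∈ (0, ν₀]`, `N ≥ N₀` — doubling a chain loses at
most a SUB-LINEAR amount of low-frequency current noise. Gives the UPPER envelope `(N−1)T²D_N ≤ NT²κ + C'N^θ` here
(`fekete_pow_abel_upper`). Exact tests: C = 0 in every Gaussian / velocity-flip member (kit j006699–6701,
j012872, j012987, j015113, j015116). Proof idea: junction surgery of the accretive Θ-reversible resolvent
(second resolvent identity along the cut interpolation; junction-supported terms). Why it might fail: an
extensive low-frequency noise deficit from removing two contacts (diffusive MD falsifier), or `C ∝ 1/ν`. -/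
theorem stub_quasiSuperadditivity :
    ∀ ω₂ lam β γ : ℝ, 0 < ω₂ → 0 < lam → 0 < β → 0 < γ → ∀ T : ℝ, 0 < T →
    let F : ℕ → ℝ → ℝ := fun N ν =>
      MeasureTheory.integral (MeasureTheory.volume.restrict (Set.Ioi (0:ℝ))) (fun t : ℝ =>
        Real.exp (-(ν * t)) *
          ∫ z, (∑ i : Fin N, (Literature.MathematicalPhysics.KineticTheory.HeatConduction.pinnedChain ω₂ lam β γ).bondCurrent N i z) *
            (∫ y, (∑ i : Fin N, (Literature.MathematicalPhysics.KineticTheory.HeatConduction.pinnedChain ω₂ lam β γ).bondCurrent N i y) ∂((Literature.MathematicalPhysics.KineticTheory.HeatConduction.pinnedChain ω₂ lam β γ).transitionKernel N T T t.toNNReal z))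
            ∂((Literature.MathematicalPhysics.KineticTheory.HeatConduction.pinnedChain ω₂ lam β γ).gibbsMeasure N T));
    ∃ C θ ν₀ : ℝ, ∃ N₀ : ℕ, 0 ≤ C ∧ θ < 1 ∧ 0 < ν₀ ∧ ∀ ν : ℝ, 0 < ν → ν ≤ ν₀ → ∀ N : ℕ, N₀ ≤ N →
      2 * F N ν - C * ((2 * N : ℕ) : ℝ) ^ θ ≤ F (2 * N) ν := by
  sorry

/-- **Stub QSR — `stub_quasiSuperadditiveResistance`: the resistance-side SIGN LAW, THIS line's lever** (size
XL; HARDEST, held by the lead; card series-law-at-every-laplace-frequency). For `P = pinnedChain ω₂ lam β γ` (all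
`> 0`) and `T > 0` there are `C ≥ 0`, `θ < 1`, `ν₀ > 0`, `N₀` such that for all `ν ∈ (0, ν₀]` and `N ≥ N₀`:
`2R_N(ν) − C(2N)^θ ≤ R_{2N}(ν)`, `R_N(ν) = (N−1)²T²/F_N(ν)` the Laplace-resolved bath-to-bath resistance
(`R_N(0⁺) = (N−1)/D_N` by (K)) — rev 3 DOUBLING / de Bruijn–Erdős form (the card's `R_N + R_M − C ≤ R_{N+M}` implies
it with `θ = 0`): cutting a `2N`-chain into two `N`-chains, each re-terminated by Langevin baths at `T`, never LOWERS
the Laplace-resolved resistance by more than a SUB-LINEAR junction allowance. Its DC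
shadow (`ν ↓ 0` at fixed `N, M`) is the live crux `JunctionLocality.SuperadditiveResistance` (stmt-11748). Gives
the LOWER envelope `(N−1)/D_N ≤ N/κ + C'N^θ` here (dyadic Fekete at fixed `ν`, then `ν ↓ 0` at fixed `N` through
the witness; positivity of `D_N` is forced, not assumed). At the level of linear fluctuating hydrodynamics with Robin
contacts both laws hold with `θ = 0`: `Δ_F → 2D²T²/(D√(ν/D)+G) ≥ 0`, `Δ_R → 2/(G+D√(ν/D)) ≤ 2/G` (lead's note). Exact tests (kit j015113 γ = 1, j015116
γ ∈ {0.2, 5}; harmonic, kinetic↔diffusive crossover λ_flip = 0.05, diffusive λ_flip = 0.5; N + M ≤ 128, 26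
frequencies from 10 down to 1e-8): the defect `R_N + R_M − R_{N+M}` is bounded by `max(1/G_∞, contact constant)`
uniformly in `ν`, maximal at or just above DC, saturating or DECREASING in `N`. Proof idea: resolvent surgery on
`1/F` (`dR/ds = −(N−1)²T²F′(s)/F(s)²` along the cut interpolation), junction-supported terms, accretivity. Why it
might fail: `D_N` approaching `κ` FROM BELOW slower than `1/N` in the genuinely anharmonic diffusive regime (the
de Bruijn–Erdős form with allowance `f(N+M)`, `Σ f(n)/n² < ∞`, would still suffice — not registered yet), or a
`1/ν`-growing junction term below the Thouless frequency. Sources: KunduDharNarayan2009, BruijnErdos1952,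
AokiKusnezov2002, BonettoLebowitzReyBellet2000 §7, card + TRIAGE-r1-1/2/3. -/
theorem stub_quasiSuperadditiveResistance :
    ∀ ω₂ lam β γ : ℝ, 0 < ω₂ → 0 < lam → 0 < β → 0 < γ → ∀ T : ℝ, 0 < T →
    let F : ℕ → ℝ → ℝ := fun N ν =>
      MeasureTheory.integral (MeasureTheory.volume.restrict (Set.Ioi (0:ℝ))) (fun t : ℝ =>
        Real.exp (-(ν * t)) *
          ∫ z, (∑ i : Fin N, (Literature.MathematicalPhysics.KineticTheory.HeatConduction.pinnedChain ω₂ lam β γ).bondCurrent N i z) *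
            (∫ y, (∑ i : Fin N, (Literature.MathematicalPhysics.KineticTheory.HeatConduction.pinnedChain ω₂ lam β γ).bondCurrent N i y) ∂((Literature.MathematicalPhysics.KineticTheory.HeatConduction.pinnedChain ω₂ lam β γ).transitionKernel N T T t.toNNReal z))
            ∂((Literature.MathematicalPhysics.KineticTheory.HeatConduction.pinnedChain ω₂ lam β γ).gibbsMeasure N T));
    let R : ℕ → ℝ → ℝ := fun N ν => ((N : ℝ) - 1) ^ 2 * T ^ 2 / F N ν;
    ∃ C θ ν₀ : ℝ, ∃ N₀ : ℕ, 0 ≤ C ∧ θ < 1 ∧ 0 < ν₀ ∧ ∀ ν : ℝ, 0 < ν → ν ≤ ν₀ → ∀ N : ℕ, N₀ ≤ N →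
      2 * R N ν - C * ((2 * N : ℕ) : ℝ) ^ θ ≤ R (2 * N) ν := by
  sorry

/-! ## Landed reductions and helpers of wave 1 (restated verbatim, closed, so the registration keeps listing them) -/

/-- **Registered stub `stub_perLengthCurrentAutocorrBound`** — LANDED (W-S3, Theorems/…FixedFrequencyMatchingAutocorrBound.lean):
`N`-uniform per-length bound `|c_N(t)| ≤ B·N` (`⟨J, P_tJ⟩ ≤ ‖J‖²` by the `L²(μ_{N,T})`-contraction; `‖J‖² = O(N)` by
Gaussian momenta and uniform second moments). -/
theorem stub_perLengthCurrentAutocorrBound :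
∀ ω₂ lam β γ : ℝ, 0 < ω₂ → 0 < lam → 0 < β → 0 < γ → ∀ T : ℝ, 0 < T →
      ∃ B : ℝ, ∀ (N : ℕ) (t : ℝ), 0 ≤ t →
        |∫ z, (∑ i : Fin N, (Literature.MathematicalPhysics.KineticTheory.HeatConduction.pinnedChain
                ω₂ lam β γ).bondCurrent N i z) *
            (∫ y, (∑ i : Fin N, (Literature.MathematicalPhysics.KineticTheory.HeatConduction.pinnedChain
                ω₂ lam β γ).bondCurrent N i y)
              ∂((Literature.MathematicalPhysics.KineticTheory.HeatConduction.pinnedChain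
                ω₂ lam β γ).transitionKernel N T T t.toNNReal z))
          ∂((Literature.MathematicalPhysics.KineticTheory.HeatConduction.pinnedChain
                ω₂ lam β γ).gibbsMeasure N T)| ≤ B * (N : ℝ) :=
  Summit.AtomisticToContinuum.FouriersLaw.Theorems.AbelThermodynamicLimit.SeriesLawAtEveryLaplaceFrequency.stub_perLengthCurrentAutocorrBound

/-- **Registered stub `stub_fixedFrequencyMatchingOfFixedTime`** — LANDED (W-S3, Theorems/…FixedFrequencyMatchingOfFixedTime.lean):
S3 at a witness from fixed-time matching at that witness (dominated convergence in `t`). -/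
theorem stub_fixedFrequencyMatchingOfFixedTime :
∀ ω₂ lam β γ : ℝ, 0 < ω₂ → 0 < lam → 0 < β → 0 < γ → ∀ T : ℝ, 0 < T →
      (∀ μ₁ μ₂ : MeasureTheory.Measure
            Literature.MathematicalPhysics.KineticTheory.HeatConduction.ChainConfig,
          (Literature.MathematicalPhysics.KineticTheory.HeatConduction.pinnedChain
                ω₂ lam β γ).IsChainGibbsMeasure T μ₁ →
          Literature.MathematicalPhysics.KineticTheory.HeatConduction.IsShiftInvariant μ₁ →
          (Literature.MathematicalPhysics.KineticTheory.HeatConduction.pinnedChain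
                ω₂ lam β γ).HasSuperstabilityEstimate μ₁ →
          (Literature.MathematicalPhysics.KineticTheory.HeatConduction.pinnedChain
                ω₂ lam β γ).IsChainGibbsMeasure T μ₂ →
          Literature.MathematicalPhysics.KineticTheory.HeatConduction.IsShiftInvariant μ₂ →
          (Literature.MathematicalPhysics.KineticTheory.HeatConduction.pinnedChain
                ω₂ lam β γ).HasSuperstabilityEstimate μ₂ → μ₁ = μ₂) →
      ∀ (μT : MeasureTheory.Measure
            Literature.MathematicalPhysics.KineticTheory.HeatConduction.ChainConfig)
        (D : Literature.MathematicalPhysics.KineticTheory.HeatConduction.InfiniteChainDynamics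
          (Literature.MathematicalPhysics.KineticTheory.HeatConduction.pinnedChain ω₂ lam β γ)),
        (Literature.MathematicalPhysics.KineticTheory.HeatConduction.pinnedChain
            ω₂ lam β γ).IsChainGibbsMeasure T μT →
        Literature.MathematicalPhysics.KineticTheory.HeatConduction.IsShiftInvariant μT →
        (Literature.MathematicalPhysics.KineticTheory.HeatConduction.pinnedChain
            ω₂ lam β γ).HasSuperstabilityEstimate μT →
        D.carrier ⊆ (Literature.MathematicalPhysics.KineticTheory.HeatConduction.pinnedChain
            ω₂ lam β γ).bmGood →
        D.PreservesMeasure μT →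
        (∀ t : ℝ, D.HasAbsConvergentCorrelation μT t) →
        (∀ᵐ t ∂(MeasureTheory.volume.restrict (Set.Ioi (0:ℝ))),
          Filter.Tendsto (fun N : ℕ =>
              (∫ z, (∑ i : Fin N, (Literature.MathematicalPhysics.KineticTheory.HeatConduction.pinnedChain
                      ω₂ lam β γ).bondCurrent N i z) *
                  (∫ y, (∑ i : Fin N, (Literature.MathematicalPhysics.KineticTheory.HeatConduction.pinnedChain
                      ω₂ lam β γ).bondCurrent N i y)
                    ∂((Literature.MathematicalPhysics.KineticTheory.HeatConduction.pinnedChain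
                      ω₂ lam β γ).transitionKernel N T T t.toNNReal z))
                ∂((Literature.MathematicalPhysics.KineticTheory.HeatConduction.pinnedChain
                      ω₂ lam β γ).gibbsMeasure N T)) / (N : ℝ))
            Filter.atTop (nhds (D.currentCorrelation μT t))) →
        ∀ ν : ℝ, 0 < ν →
          Filter.Tendsto (fun N : ℕ =>
              MeasureTheory.integral (MeasureTheory.volume.restrict (Set.Ioi (0:ℝ))) (fun t : ℝ =>
                Real.exp (-(ν * t)) *
                  ∫ z, (∑ i : Fin N, (Literature.MathematicalPhysics.KineticTheory.HeatConduction.pinnedChain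
                          ω₂ lam β γ).bondCurrent N i z) *
                    (∫ y, (∑ i : Fin N, (Literature.MathematicalPhysics.KineticTheory.HeatConduction.pinnedChain
                          ω₂ lam β γ).bondCurrent N i y)
                      ∂((Literature.MathematicalPhysics.KineticTheory.HeatConduction.pinnedChain
                          ω₂ lam β γ).transitionKernel N T T t.toNNReal z))
                    ∂((Literature.MathematicalPhysics.KineticTheory.HeatConduction.pinnedChain
                          ω₂ lam β γ).gibbsMeasure N T)) / (N : ℝ))
            Filter.atTop
            (nhds (MeasureTheory.integral (MeasureTheory.volume.restrict (Set.Ioi (0:ℝ)))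
              (fun t : ℝ => Real.exp (-(ν * t)) * D.currentCorrelation μT t))) :=
  Summit.AtomisticToContinuum.FouriersLaw.Theorems.AbelThermodynamicLimit.SeriesLawAtEveryLaplaceFrequency.stub_fixedFrequencyMatchingOfFixedTime

/-- **Registered stub `stub_resolventCorrectorPackage`** — LANDED (W-QS, p98298, Theorems/…QuasiSuperadditivityResolventCorrector.lean):
the fixed-`N` resolvent corrector at `ν > 0` (smooth, `L²`, `νu − L_N u = J` pointwise, `u = R_ν J` a.e.) with
`F_N(ν) = ∫ J u dμ = ν‖u‖² + γT(‖∂_{p_0}u‖² + ‖∂_{p_{N−1}}u‖²)` — the `ν > 0` storage + dissipation identity (first rung of any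
junction-surgery attempt on QS/QSR; survey work/stubs/quasiSuperadditivity.SURVEY.md). -/
theorem stub_resolventCorrectorPackage :
∀ ω₂ lam β γ : ℝ, 0 < ω₂ → 0 < lam → 0 < β → 0 < γ → ∀ T : ℝ, 0 < T → ∀ N : ℕ, 2 ≤ N → ∀ ν : ℝ, 0 < ν →
    ∃ u : Literature.MathematicalPhysics.KineticTheory.HeatConduction.PhaseSpace N → ℝ,
      ContDiff ℝ ((⊤ : ℕ∞) : WithTop ℕ∞) u ∧
      MeasureTheory.MemLp u 2 ((Literature.MathematicalPhysics.KineticTheory.HeatConduction.pinnedChain ω₂ lam β γ).gibbsMeasure N T) ∧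
      (∀ x, ν * u x - (Literature.MathematicalPhysics.KineticTheory.HeatConduction.pinnedChain ω₂ lam β γ).generator N T T u x =
        ∑ i : Fin N, (Literature.MathematicalPhysics.KineticTheory.HeatConduction.pinnedChain ω₂ lam β γ).bondCurrent N i x) ∧
      (u =ᵐ[(Literature.MathematicalPhysics.KineticTheory.HeatConduction.pinnedChain ω₂ lam β γ).gibbsMeasure N T] fun z =>
        ∫ t in Set.Ioi (0:ℝ), Real.exp (-(ν * t)) *
          ∫ y, (∑ i : Fin N, (Literature.MathematicalPhysics.KineticTheory.HeatConduction.pinnedChain ω₂ lam β γ).bondCurrent N i y)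
            ∂((Literature.MathematicalPhysics.KineticTheory.HeatConduction.pinnedChain ω₂ lam β γ).transitionKernel N T T t.toNNReal z)) ∧
      MeasureTheory.integral (MeasureTheory.volume.restrict (Set.Ioi (0:ℝ))) (fun t : ℝ =>
        Real.exp (-(ν * t)) *
          ∫ z, (∑ i : Fin N, (Literature.MathematicalPhysics.KineticTheory.HeatConduction.pinnedChain ω₂ lam β γ).bondCurrent N i z) *
            (∫ y, (∑ i : Fin N, (Literature.MathematicalPhysics.KineticTheory.HeatConduction.pinnedChain ω₂ lam β γ).bondCurrent N i y) ∂((Literature.MathematicalPhysics.KineticTheory.HeatConduction.pinnedChain ω₂ lam β γ).transitionKernel N T T t.toNNReal z))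
            ∂((Literature.MathematicalPhysics.KineticTheory.HeatConduction.pinnedChain ω₂ lam β γ).gibbsMeasure N T)) =
        ∫ z, (∑ i : Fin N, (Literature.MathematicalPhysics.KineticTheory.HeatConduction.pinnedChain ω₂ lam β γ).bondCurrent N i z) * u z
          ∂((Literature.MathematicalPhysics.KineticTheory.HeatConduction.pinnedChain ω₂ lam β γ).gibbsMeasure N T) ∧
      ∀ b₀ b₁ : Fin N, b₀.val = 0 → b₁.val = N - 1 →
        ∫ z, (∑ i : Fin N, (Literature.MathematicalPhysics.KineticTheory.HeatConduction.pinnedChain ω₂ lam β γ).bondCurrent N i z) * u z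
            ∂((Literature.MathematicalPhysics.KineticTheory.HeatConduction.pinnedChain ω₂ lam β γ).gibbsMeasure N T) =
          ν * ∫ z, u z ^ 2 ∂((Literature.MathematicalPhysics.KineticTheory.HeatConduction.pinnedChain ω₂ lam β γ).gibbsMeasure N T) +
            γ * T * ((∫ z, (Literature.MathematicalPhysics.KineticTheory.HeatConduction.partialP b₀ u z) ^ 2
                ∂((Literature.MathematicalPhysics.KineticTheory.HeatConduction.pinnedChain ω₂ lam β γ).gibbsMeasure N T)) +
              ∫ z, (Literature.MathematicalPhysics.KineticTheory.HeatConduction.partialP b₁ u z) ^ 2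
                ∂((Literature.MathematicalPhysics.KineticTheory.HeatConduction.pinnedChain ω₂ lam β γ).gibbsMeasure N T)) :=
  Summit.AtomisticToContinuum.FouriersLaw.Theorems.AbelThermodynamicLimit.SeriesLawAtEveryLaplaceFrequency.stub_resolventCorrectorPackage

/-- **Registered stub `stub_witnessRegularisationOfWitnessTightness`** — LANDED (W-SEAM, p97986/p99264,
Theorems/…WitnessRegularisationOfWitnessTightness.lean): the seam from (WT) witness tightness and (TR) tight ⇒ regular. -/
theorem stub_witnessRegularisationOfWitnessTightness :
    ∀ ω₂ lam β γ : ℝ, 0 < ω₂ → 0 < lam → 0 < β → 0 < γ →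
      ∀ T : ℝ, 0 < T →
        (∀ (μ : MeasureTheory.Measure
                Literature.MathematicalPhysics.KineticTheory.HeatConduction.ChainConfig)
            (D : Literature.MathematicalPhysics.KineticTheory.HeatConduction.InfiniteChainDynamics
              (Literature.MathematicalPhysics.KineticTheory.HeatConduction.pinnedChain ω₂ lam β γ))
            (κ : ℝ),
            (Literature.MathematicalPhysics.KineticTheory.HeatConduction.pinnedChain
                ω₂ lam β γ).IsChainGibbsMeasure T μ → D.PreservesMeasure μ →
            (∀ t : ℝ, D.HasAbsConvergentCorrelation μ t) → 0 < κ →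
            Filter.Tendsto (fun ν : ℝ => (T ^ 2)⁻¹ *
              MeasureTheory.integral (MeasureTheory.volume.restrict (Set.Ioi (0:ℝ)))
                (fun t : ℝ => Real.exp (-(ν * t)) * D.currentCorrelation μ t))
              (nhdsWithin (0:ℝ) (Set.Ioi 0)) (nhds κ) →
            ∀ ε : ℝ, 0 < ε → ∃ R : ℝ, ∀ x : ℤ,
              μ {σ : Literature.MathematicalPhysics.KineticTheory.HeatConduction.ChainConfig |
                  R < |(σ x).1|} ≤ ENNReal.ofReal ε) →
        (∀ μ : MeasureTheory.Measure
                Literature.MathematicalPhysics.KineticTheory.HeatConduction.ChainConfig,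
            (Literature.MathematicalPhysics.KineticTheory.HeatConduction.pinnedChain
                ω₂ lam β γ).IsChainGibbsMeasure T μ →
            (∀ ε : ℝ, 0 < ε → ∃ R : ℝ, ∀ x : ℤ,
              μ {σ : Literature.MathematicalPhysics.KineticTheory.HeatConduction.ChainConfig |
                  R < |(σ x).1|} ≤ ENNReal.ofReal ε) →
            Literature.MathematicalPhysics.KineticTheory.HeatConduction.IsShiftInvariant μ ∧
            (Literature.MathematicalPhysics.KineticTheory.HeatConduction.pinnedChain
                ω₂ lam β γ).HasSuperstabilityEstimate μ) →
        (∃ (μT : MeasureTheory.Measure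
                Literature.MathematicalPhysics.KineticTheory.HeatConduction.ChainConfig)
            (D' : Literature.MathematicalPhysics.KineticTheory.HeatConduction.InfiniteChainDynamics
              (Literature.MathematicalPhysics.KineticTheory.HeatConduction.pinnedChain ω₂ lam β γ))
            (κ : ℝ),
            (Literature.MathematicalPhysics.KineticTheory.HeatConduction.pinnedChain
                ω₂ lam β γ).IsChainGibbsMeasure T μT ∧ D'.PreservesMeasure μT ∧
            (∀ t : ℝ, D'.HasAbsConvergentCorrelation μT t) ∧ 0 < κ ∧
            Filter.Tendsto (fun ν : ℝ => (T ^ 2)⁻¹ *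
              MeasureTheory.integral (MeasureTheory.volume.restrict (Set.Ioi (0:ℝ)))
                (fun t : ℝ => Real.exp (-(ν * t)) * D'.currentCorrelation μT t))
              (nhdsWithin (0:ℝ) (Set.Ioi 0)) (nhds κ)) →
        ∃ (μT : MeasureTheory.Measure
                Literature.MathematicalPhysics.KineticTheory.HeatConduction.ChainConfig)
            (D' : Literature.MathematicalPhysics.KineticTheory.HeatConduction.InfiniteChainDynamics
              (Literature.MathematicalPhysics.KineticTheory.HeatConduction.pinnedChain ω₂ lam β γ))
            (κ : ℝ),
            (Literature.MathematicalPhysics.KineticTheory.HeatConduction.pinnedChain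
                ω₂ lam β γ).IsChainGibbsMeasure T μT ∧
            Literature.MathematicalPhysics.KineticTheory.HeatConduction.IsShiftInvariant μT ∧
            (Literature.MathematicalPhysics.KineticTheory.HeatConduction.pinnedChain
                ω₂ lam β γ).HasSuperstabilityEstimate μT ∧
            D'.PreservesMeasure μT ∧
            (∀ t : ℝ, D'.HasAbsConvergentCorrelation μT t) ∧ 0 < κ ∧
            Filter.Tendsto (fun ν : ℝ => (T ^ 2)⁻¹ *
              MeasureTheory.integral (MeasureTheory.volume.restrict (Set.Ioi (0:ℝ)))
                (fun t : ℝ => Real.exp (-(ν * t)) * D'.currentCorrelation μT t))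
              (nhdsWithin (0:ℝ) (Set.Ioi 0)) (nhds κ) :=
  Summit.AtomisticToContinuum.FouriersLaw.Theorems.AbelThermodynamicLimit.SeriesLawAtEveryLaplaceFrequency.stub_witnessRegularisationOfWitnessTightness

/-- **Registered stub `stub_totalCurrentAutocorrEqSumPairCorr`** — LANDED (W-S3, p100428, Theorems/…FixedFrequencyMatchingPairSums.lean):
`c_N(t) = Σ_i Σ_k ⟨j_i(0) j_k(t)⟩_{N,T}` (finite sums out of honest Bochner integrals). -/
theorem stub_totalCurrentAutocorrEqSumPairCorr :
    ∀ ω₂ lam β γ : ℝ, 0 < ω₂ → 0 < lam → 0 < β → 0 < γ → ∀ T : ℝ, 0 < T → ∀ N : ℕ, 0 < N → ∀ t : ℝ,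
      (∫ z, (∑ i : Fin N, (Literature.MathematicalPhysics.KineticTheory.HeatConduction.pinnedChain
              ω₂ lam β γ).bondCurrent N i z) *
          (∫ y, (∑ i : Fin N, (Literature.MathematicalPhysics.KineticTheory.HeatConduction.pinnedChain
              ω₂ lam β γ).bondCurrent N i y)
            ∂((Literature.MathematicalPhysics.KineticTheory.HeatConduction.pinnedChain
              ω₂ lam β γ).transitionKernel N T T t.toNNReal z))
        ∂((Literature.MathematicalPhysics.KineticTheory.HeatConduction.pinnedChain
              ω₂ lam β γ).gibbsMeasure N T)) =
      ∑ i : Fin N, ∑ k : Fin N,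
        ∫ z, (Literature.MathematicalPhysics.KineticTheory.HeatConduction.pinnedChain
                ω₂ lam β γ).bondCurrent N i z *
          (∫ y, (Literature.MathematicalPhysics.KineticTheory.HeatConduction.pinnedChain
                ω₂ lam β γ).bondCurrent N k y
            ∂((Literature.MathematicalPhysics.KineticTheory.HeatConduction.pinnedChain
                ω₂ lam β γ).transitionKernel N T T t.toNNReal z))
          ∂((Literature.MathematicalPhysics.KineticTheory.HeatConduction.pinnedChain
                ω₂ lam β γ).gibbsMeasure N T) :=
  Summit.AtomisticToContinuum.FouriersLaw.Theorems.AbelThermodynamicLimit.SeriesLawAtEveryLaplaceFrequency.stub_totalCurrentAutocorrEqSumPairCorr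

/-- **Registered stub `stub_fixedTimeMatchingOfUniformLeaves`** — LANDED (W-S3, p101967, Theorems/…FixedFrequencyMatchingUniformLeaves.lean):
the bond average — fixed-time matching at a witness from the anchor-uniform leaves (B′), (C′) taken as LOCAL hypotheses at that witness/time. -/
theorem stub_fixedTimeMatchingOfUniformLeaves :
∀ ω₂ lam β γ : ℝ, 0 < ω₂ → 0 < lam → 0 < β → 0 < γ → ∀ T : ℝ, 0 < T →
 ∀ (μT : MeasureTheory.Measure Literature.MathematicalPhysics.KineticTheory.HeatConduction.ChainConfig)
  (D : Literature.MathematicalPhysics.KineticTheory.HeatConduction.InfiniteChainDynamics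
   (Literature.MathematicalPhysics.KineticTheory.HeatConduction.pinnedChain ω₂ lam β γ)),
 (∀ t : ℝ, D.HasAbsConvergentCorrelation μT t) →
 (∀ (x : ℤ) (t : ℝ), 0 < t → ∀ ε : ℝ, 0 < ε → ∃ L N₀ : ℕ, ∀ N : ℕ, N₀ ≤ N → ∀ i k : Fin N,
  L ≤ i.val → i.val + L < N → (k.val : ℤ) = i.val + x →
  |(∫ z, (Literature.MathematicalPhysics.KineticTheory.HeatConduction.pinnedChain ω₂ lam β γ).bondCurrent N i z *
     (∫ y, (Literature.MathematicalPhysics.KineticTheory.HeatConduction.pinnedChain ω₂ lam β γ).bondCurrent N k y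
      ∂((Literature.MathematicalPhysics.KineticTheory.HeatConduction.pinnedChain
       ω₂ lam β γ).transitionKernel N T T t.toNNReal z))
     ∂((Literature.MathematicalPhysics.KineticTheory.HeatConduction.pinnedChain ω₂ lam β γ).gibbsMeasure N T)) -
    ∫ σ, (Literature.MathematicalPhysics.KineticTheory.HeatConduction.pinnedChain ω₂ lam β γ).bondCurrentZ σ 0 *
     (Literature.MathematicalPhysics.KineticTheory.HeatConduction.pinnedChain
      ω₂ lam β γ).bondCurrentZ (D.flow t σ) x ∂μT| ≤ ε) →
 (∀ t : ℝ, 0 < t → ∀ ε : ℝ, 0 < ε → ∃ R N₀ : ℕ, ∀ N : ℕ, N₀ ≤ N → ∀ i : Fin N,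
  R ≤ i.val → i.val + R < N →
  (∑ k : Fin N, if i.val ≤ k.val + R ∧ k.val ≤ i.val + R then (0 : ℝ) else
   |∫ z, (Literature.MathematicalPhysics.KineticTheory.HeatConduction.pinnedChain ω₂ lam β γ).bondCurrent N i z *
     (∫ y, (Literature.MathematicalPhysics.KineticTheory.HeatConduction.pinnedChain ω₂ lam β γ).bondCurrent N k y
      ∂((Literature.MathematicalPhysics.KineticTheory.HeatConduction.pinnedChain
       ω₂ lam β γ).transitionKernel N T T t.toNNReal z))
    ∂((Literature.MathematicalPhysics.KineticTheory.HeatConduction.pinnedChain ω₂ lam β γ).gibbsMeasure N T)|)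
   ≤ ε) →
 ∀ t : ℝ, 0 < t →
  Filter.Tendsto (fun N : ℕ =>
   (∫ z, (∑ i : Fin N, (Literature.MathematicalPhysics.KineticTheory.HeatConduction.pinnedChain
       ω₂ lam β γ).bondCurrent N i z) *
     (∫ y, (∑ i : Fin N, (Literature.MathematicalPhysics.KineticTheory.HeatConduction.pinnedChain
       ω₂ lam β γ).bondCurrent N i y)
      ∂((Literature.MathematicalPhysics.KineticTheory.HeatConduction.pinnedChain
       ω₂ lam β γ).transitionKernel N T T t.toNNReal z))
     ∂((Literature.MathematicalPhysics.KineticTheory.HeatConduction.pinnedChain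
       ω₂ lam β γ).gibbsMeasure N T)) / (N : ℝ))
   Filter.atTop (nhds (D.currentCorrelation μT t)) :=
  Summit.AtomisticToContinuum.FouriersLaw.Theorems.AbelThermodynamicLimit.SeriesLawAtEveryLaplaceFrequency.stub_fixedTimeMatchingOfUniformLeaves

/-- **Registered stub `stub_anchoredCorrelationTailsOfUniform`** — LANDED (W-HTIME, p102310, Theorems/…FixedTimeMatchingSharedLeaves.lean):
(C′) ⇒ the sibling crux stmt-12596's registered leaf `stub_anchoredCorrelationTails` VERBATIM (sharing made a checked fact). -/
theorem stub_anchoredCorrelationTailsOfUniform :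
    (∀ ω₂ lam β γ : ℝ, 0 < ω₂ → 0 < lam → 0 < β → 0 < γ → ∀ T : ℝ, 0 < T →
      ∀ τ : ℝ, 0 < τ → ∀ ε : ℝ, 0 < ε → ∃ R N₀ : ℕ, ∀ N : ℕ, N₀ ≤ N → ∀ i : Fin N,
        R ≤ i.val → i.val + R < N → ∀ t ∈ Set.Icc (0 : ℝ) τ,
          (∑ k : Fin N, if i.val ≤ k.val + R ∧ k.val ≤ i.val + R then (0 : ℝ) else
            |∫ z, (Literature.MathematicalPhysics.KineticTheory.HeatConduction.pinnedChain
                    ω₂ lam β γ).bondCurrent N i z *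
                (∫ y, (Literature.MathematicalPhysics.KineticTheory.HeatConduction.pinnedChain
                    ω₂ lam β γ).bondCurrent N k y
                  ∂((Literature.MathematicalPhysics.KineticTheory.HeatConduction.pinnedChain
                    ω₂ lam β γ).transitionKernel N T T t.toNNReal z))
              ∂((Literature.MathematicalPhysics.KineticTheory.HeatConduction.pinnedChain
                    ω₂ lam β γ).gibbsMeasure N T)|) ≤ ε) →
    ∀ ω₂ lam β γ : ℝ, 0 < ω₂ → 0 < lam → 0 < β → 0 < γ → ∀ T : ℝ, 0 < T → ∀ τ : ℝ, 0 < τ →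
      ∀ ε : ℝ, 0 < ε → ∃ R : ℕ, ∃ N₀ : ℕ, ∀ N : ℕ, N₀ ≤ N → ∀ hN : 2 ≤ N,
        ∀ t ∈ Set.Icc (0 : ℝ) τ,
          (∑ k : Fin N, if (N - 1) / 2 ≤ k.val + R ∧ k.val ≤ (N - 1) / 2 + R then (0 : ℝ) else
            |∫ z, (Literature.MathematicalPhysics.KineticTheory.HeatConduction.pinnedChain
                      ω₂ lam β γ).bondCurrent N ⟨(N - 1) / 2, by omega⟩ z *
                (∫ y, (Literature.MathematicalPhysics.KineticTheory.HeatConduction.pinnedChain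
                      ω₂ lam β γ).bondCurrent N k y
                  ∂((Literature.MathematicalPhysics.KineticTheory.HeatConduction.pinnedChain
                      ω₂ lam β γ).transitionKernel N T T t.toNNReal z))
              ∂((Literature.MathematicalPhysics.KineticTheory.HeatConduction.pinnedChain
                      ω₂ lam β γ).gibbsMeasure N T)|) ≤ ε :=
  Summit.AtomisticToContinuum.FouriersLaw.Theorems.AbelThermodynamicLimit.SeriesLawAtEveryLaplaceFrequency.stub_anchoredCorrelationTailsOfUniform

/-- **Registered stub `stub_witnessTightOfUniformEnergyBound`** — LANDED (W-WT, p102198, Theorems/…WitnessTightOfUniformEnergyBound.lean):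
WT at a witness from an `x`-uniform bound on `∫ U(q_x) dμ` (tightness ⇔ uniform coercive moment, his §1). -/
theorem stub_witnessTightOfUniformEnergyBound :
    ∀ ω₂ lam β γ : ℝ, 0 < ω₂ → 0 < lam → 0 < β → 0 < γ →
      ∀ T : ℝ, 0 < T →
        ∀ (μ : MeasureTheory.Measure
                Literature.MathematicalPhysics.KineticTheory.HeatConduction.ChainConfig)
            (D : Literature.MathematicalPhysics.KineticTheory.HeatConduction.InfiniteChainDynamics
              (Literature.MathematicalPhysics.KineticTheory.HeatConduction.pinnedChain ω₂ lam β γ))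
            (κ : ℝ),
            (Literature.MathematicalPhysics.KineticTheory.HeatConduction.pinnedChain
                ω₂ lam β γ).IsChainGibbsMeasure T μ → D.PreservesMeasure μ →
            (∀ t : ℝ, D.HasAbsConvergentCorrelation μ t) → 0 < κ →
            Filter.Tendsto (fun ν : ℝ => (T ^ 2)⁻¹ *
              MeasureTheory.integral (MeasureTheory.volume.restrict (Set.Ioi (0:ℝ)))
                (fun t : ℝ => Real.exp (-(ν * t)) * D.currentCorrelation μ t))
              (nhdsWithin (0:ℝ) (Set.Ioi 0)) (nhds κ) →
            (∃ M : ℝ, ∀ x : ℤ,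
              MeasureTheory.lintegral μ (fun σ => ENNReal.ofReal
                ((Literature.MathematicalPhysics.KineticTheory.HeatConduction.pinnedChain
                    ω₂ lam β γ).U (σ x).1)) ≤ ENNReal.ofReal M) →
            ∀ ε : ℝ, 0 < ε → ∃ R : ℝ, ∀ x : ℤ,
              μ {σ : Literature.MathematicalPhysics.KineticTheory.HeatConduction.ChainConfig |
                  R < |(σ x).1|} ≤ ENNReal.ofReal ε :=
  Summit.AtomisticToContinuum.FouriersLaw.Theorems.AbelThermodynamicLimit.SeriesLawAtEveryLaplaceFrequency.stub_witnessTightOfUniformEnergyBound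

/-- **Stub (C′) — `stub_uniformAnchoredCorrelationTails`: the LIGHT CONE of the OPEN chain at fixed time, anchor-uniform form** —
LANDED in cycle 2 (worker W-C′ of lead c1, p115961, `Theorems/LatticeLandauDampingAbelThermodynamicLimitUniformAnchoredCorrelationTails.lean`
+ 6 registered helper files p108116 p108425 p108653 p115742 p115752 p115757, ≈ 2100 lines). Mechanism (NOT the severed-flow (M1) plan):
synchronous coupling — the partial momentum flip `Θ_iΘ_{i+1}` preserves `μ_{N,T}` and negates `j_i`, so
`⟨j_i(0)j_k(t)⟩² ≤ ¼⟨j_i²⟩(2B_{i+1,k} + 2B_{i,k})` with the N-UNIFORM single-flip light cone `B_{i₀,k} ≤ (a(15/16)^D + b/D²)²`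
(`pinnedChain_singleFlipLocality`) from a weighted Dobrushin–Fritz box `q_j² ≤ ρ²√(1+|j−i₀|)` whose exceptional set has
N-uniformly summable site tails (16th-power Markov + one-site Gibbs domination). It implies the sibling crux stmt-12596's
central-anchor leaf `stub_anchoredCorrelationTails` VERBATIM through the landed bridge `stub_anchoredCorrelationTailsOfUniform` (p102310). -/
theorem stub_uniformAnchoredCorrelationTails :
∀ ω₂ lam β γ : ℝ, 0 < ω₂ → 0 < lam → 0 < β → 0 < γ → ∀ T : ℝ, 0 < T →
      ∀ τ : ℝ, 0 < τ → ∀ ε : ℝ, 0 < ε → ∃ R N₀ : ℕ, ∀ N : ℕ, N₀ ≤ N → ∀ i : Fin N,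
        R ≤ i.val → i.val + R < N → ∀ t ∈ Set.Icc (0 : ℝ) τ,
          (∑ k : Fin N, if i.val ≤ k.val + R ∧ k.val ≤ i.val + R then (0 : ℝ) else
            |∫ z, (Literature.MathematicalPhysics.KineticTheory.HeatConduction.pinnedChain
                    ω₂ lam β γ).bondCurrent N i z *
                (∫ y, (Literature.MathematicalPhysics.KineticTheory.HeatConduction.pinnedChain
                    ω₂ lam β γ).bondCurrent N k y
                  ∂((Literature.MathematicalPhysics.KineticTheory.HeatConduction.pinnedChain
                    ω₂ lam β γ).transitionKernel N T T t.toNNReal z))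
              ∂((Literature.MathematicalPhysics.KineticTheory.HeatConduction.pinnedChain
                    ω₂ lam β γ).gibbsMeasure N T)|) ≤ ε :=
  Summit.AtomisticToContinuum.FouriersLaw.Theorems.AbelThermodynamicLimit.SeriesLawAtEveryLaplaceFrequency.stub_uniformAnchoredCorrelationTails

/-- **Stub (E1) — `stub_bulkWindowEquivalence`: BULK EQUIVALENCE OF ENSEMBLES, anchor-uniform** — LANDED cycle 2 (W-E1, p121150 +
finite-chain DLR identity p120362) (STATIC engine of (B′), size L; registered rev 7 by lead c1). For `P` (all `> 0`), `T > 0` and every REGULAR DLR state `μT` (DLR + shift-invariant + BM-superstable;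
by the landed tight-uniqueness it is THE transfer-operator Markov state): for every window length `m+1`, every bounded measurable
`f` on `PhaseSpace (m+1)` and `ε > 0` there are a depth `L` and `N₀` such that for all `N ≥ N₀` and all windows `[i, i+m]` that are
`L`-deep in `[0, N−1]`: `|E_{gibbsMeasure N T}[f(q,p on [i,i+m])] − E_{μT}[f ∘ boxPhaseAt 0 m]| ≤ ε`. Route: the free-boundary finite
chain is Markov/DLR for interior intervals w.r.t. the SAME specification kernel `chainSpecification P T` (nearest-neighbour
potential; free ends only affect sites `0`, `N−1`), so both expectations are mixtures of `γ_{[i−M', i+m+M']}(f | η)` over boundary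
conditions; `chainSpecification_Icc_tendsto_uniformly` (InfiniteChainGibbsUniqueness.lean: window probabilities forget far boundary
conditions UNIFORMLY on `|q| ≤ R` at the two boundary sites, transfer operator + Jentzsch gap) + N-uniform one-site tails of
`gibbsMeasure N T` (`pinnedChain_stationary_site_tails`, p108425) + tightness of `μT` (regular) + simple-function approximation of `f`. -/
theorem stub_bulkWindowEquivalence :
    ∀ ω₂ lam β γ : ℝ, 0 < ω₂ → 0 < lam → 0 < β → 0 < γ → ∀ T : ℝ, 0 < T →
      ∀ μT : MeasureTheory.Measure Literature.MathematicalPhysics.KineticTheory.HeatConduction.ChainConfig,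
        (Literature.MathematicalPhysics.KineticTheory.HeatConduction.pinnedChain ω₂ lam β γ).IsChainGibbsMeasure T μT →
        Literature.MathematicalPhysics.KineticTheory.HeatConduction.IsShiftInvariant μT →
        (Literature.MathematicalPhysics.KineticTheory.HeatConduction.pinnedChain ω₂ lam β γ).HasSuperstabilityEstimate μT →
        ∀ (m : ℕ) (f : Literature.MathematicalPhysics.KineticTheory.HeatConduction.PhaseSpace (m + 1) → ℝ),
          Measurable f → (∀ w, |f w| ≤ 1) →
          ∀ ε : ℝ, 0 < ε → ∃ L N₀ : ℕ, ∀ N : ℕ, N₀ ≤ N → ∀ (i : Fin N) (hL : L ≤ i.val) (hi : i.val + m + L < N),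
            |(∫ z, f (fun j : Fin (m + 1) => z.1 ⟨i.val + j.val, by omega⟩,
                      fun j : Fin (m + 1) => z.2 ⟨i.val + j.val, by omega⟩)
                ∂((Literature.MathematicalPhysics.KineticTheory.HeatConduction.pinnedChain ω₂ lam β γ).gibbsMeasure N T)) -
              ∫ σ, f (Literature.MathematicalPhysics.KineticTheory.HeatConduction.boxPhaseAt 0 m σ) ∂μT| ≤ ε :=
  Summit.AtomisticToContinuum.FouriersLaw.Theorems.AbelThermodynamicLimit.SeriesLawAtEveryLaplaceFrequency.stub_bulkWindowEquivalence

/-- **Stub (M1sev) — `stub_openChainSeveredLocality`: N-UNIFORM SEVERED-FLOW `L²` LOCALITY OF THE OPEN CHAIN at fixed time** —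
LANDED cycle 2 (W-M1sev, p124064 + helpers p121812 p122054 p123189 p123690: second-order Dobrushin–Fritz pathwise comparison open chain vs
severed window, severed-window invariance of the embedded free Gibbs state, exceptional-set and moment estimates) (DYNAMICAL engine of (B′), size L–XL; registered rev 7 by lead c1). For `P` (all `> 0`), `T > 0`, every horizon `τ` and `ε > 0`:
for all large window margins `M` there is `N₀` such that for all `N ≥ N₀`, all bonds `k` that are `(M+2)`-deep (so the box
`Λ = [k−M, k+1+M]` and its outer neighbours avoid the bath sites `0`, `N−1`) and all `t ∈ [0, τ]`, the semigroup image
`P_t j_k (z) = ∫ j_k dP_t(z, ·)` is within `ε` in `L²(gibbsMeasure N T)` (integrability asserted, no Bochner junk) of the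
DETERMINISTIC local functional `j_k ∘ T^Λ_t` — LLL's severed flow `severedFlow (condB1_pinnedChain …) Λ t` (particles outside `Λ`
frozen) applied to the finite configuration embedded in `ℤ → ℝ × ℝ` (zero outside `[0, N−1]`, immaterial: only `Λ` and its two
outer neighbours are read, `severedFlow_cbox_dependsOn`), current read by `bondCurrentZ … k`. Route: Jensen over the bath noise
(`transitionKernel = map solMap`, LangevinChainKernel.lean), then the Buttà–Marchioro light cone PATHWISE inside `Λ` (the open
chain's path solves the same Hamiltonian equations on `Λ`; discrepancy enters only through the two moving boundary sites —
template `OscillatorChain.dist_limit_le` / `InfiniteChainDynamics.exists_flow_sub_severedFlow_le`, or W-C′'s weighted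
propagation `WeightedPropagation.propagation_weighted`, p108116) on a weighted Dobrushin–Fritz box event, whose complement has
N-uniformly small probability (`pinnedChain_weightedBox_exceptionalSet` p115742, `pinnedChain_stationary_site_tails` p108425), plus
fourth moments off the good event (Gibbs invariance `pinnedChain_gibbsMeasure_bind_transitionKernel`; energy conservation of `T^Λ`). -/
theorem stub_openChainSeveredLocality :
    ∀ ω₂ lam β γ : ℝ, ∀ (hω : 0 < ω₂) (hl : 0 < lam) (hβ : 0 < β), 0 < γ → ∀ T : ℝ, 0 < T →
      ∀ τ : ℝ, 0 < τ → ∀ ε : ℝ, 0 < ε → ∃ M₀ : ℕ, ∀ M : ℕ, M₀ ≤ M → ∃ N₀ : ℕ, ∀ N : ℕ, N₀ ≤ N →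
        ∀ (k : Fin N) (hk : M + 2 ≤ k.val) (hkN : k.val + M + 3 < N), ∀ t ∈ Set.Icc (0 : ℝ) τ,
          MeasureTheory.Integrable (fun z : Literature.MathematicalPhysics.KineticTheory.HeatConduction.PhaseSpace N =>
              ((∫ y, (Literature.MathematicalPhysics.KineticTheory.HeatConduction.pinnedChain ω₂ lam β γ).bondCurrent N k y
                  ∂((Literature.MathematicalPhysics.KineticTheory.HeatConduction.pinnedChain ω₂ lam β γ).transitionKernel N T T t.toNNReal z)) -
                (Literature.MathematicalPhysics.KineticTheory.HeatConduction.pinnedChain ω₂ lam β γ).bondCurrentZ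
                  (Literature.MathematicalPhysics.KineticTheory.HeatConduction.OscillatorChain.severedFlow
                    (Literature.MathematicalPhysics.KineticTheory.HeatConduction.OscillatorChain.condB1_pinnedChain hω.le hl.le hβ.le γ)
                    (Finset.Icc ((k.val : ℤ) - M) ((k.val : ℤ) + 1 + M)) t
                    (fun x : ℤ => if h : 0 ≤ x ∧ x < N then (z.1 ⟨x.toNat, by omega⟩, z.2 ⟨x.toNat, by omega⟩) else (0, 0)))
                  (k.val : ℤ)) ^ 2)
            ((Literature.MathematicalPhysics.KineticTheory.HeatConduction.pinnedChain ω₂ lam β γ).gibbsMeasure N T) ∧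
          ∫ z : Literature.MathematicalPhysics.KineticTheory.HeatConduction.PhaseSpace N,
              ((∫ y, (Literature.MathematicalPhysics.KineticTheory.HeatConduction.pinnedChain ω₂ lam β γ).bondCurrent N k y
                  ∂((Literature.MathematicalPhysics.KineticTheory.HeatConduction.pinnedChain ω₂ lam β γ).transitionKernel N T T t.toNNReal z)) -
                (Literature.MathematicalPhysics.KineticTheory.HeatConduction.pinnedChain ω₂ lam β γ).bondCurrentZ
                  (Literature.MathematicalPhysics.KineticTheory.HeatConduction.OscillatorChain.severedFlow
                    (Literature.MathematicalPhysics.KineticTheory.HeatConduction.OscillatorChain.condB1_pinnedChain hω.le hl.le hβ.le γ)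
                    (Finset.Icc ((k.val : ℤ) - M) ((k.val : ℤ) + 1 + M)) t
                    (fun x : ℤ => if h : 0 ≤ x ∧ x < N then (z.1 ⟨x.toNat, by omega⟩, z.2 ⟨x.toNat, by omega⟩) else (0, 0)))
                  (k.val : ℤ)) ^ 2
            ∂((Literature.MathematicalPhysics.KineticTheory.HeatConduction.pinnedChain ω₂ lam β γ).gibbsMeasure N T) ≤ ε :=
  Summit.AtomisticToContinuum.FouriersLaw.Theorems.AbelThermodynamicLimit.SeriesLawAtEveryLaplaceFrequency.stub_openChainSeveredLocality

/-- **Stub (B′|E1,M1sev) — `stub_uniformFixedTimeOffsetMatchingOfEngines`: the TWO-DYNAMICS COUPLING, i.e. (B′) from the static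
engine (E1) and the dynamical engine (M1sev)** — LANDED cycle 2 (W-coupling, p126508 + helpers p125632 p125643 p125655; route actually used:
(M1sev) + Cauchy–Schwarz, two-level truncation, (E1) on one window observable + shift invariance, severed bond windows → `D.flow` by a new
Dobrushin–Fritz comparison with BM's centred boxes `OffsetMatching.tendsto_severedFlow_bondWindow`; the same module lands (B′) verbatim;
NB the gate truncates registered signatures at 4000 chars, so this 5555-char stub could only land under (B′)'s name) (size L; registered rev 7 by lead c1; the infinite-chain side uses LANDED Literature:
BM's `InfiniteChainDynamics.exists_summable_l2_locality` / `exists_abs_sub_comp_severedFlow_le` for the regular witness — its flow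
agrees with the canonical BM flow on `D.carrier ⊆ bmGood` (`tendsto_severedFlow_flow`), commutes with the shift there
(InfiniteChainGoodSetSymmetries) and preserves the shift-invariant `μT`, so `j_x ∘ φ_t ≈ (j_0 ∘ T^{[−n,n]}_t) ∘ shift^x` in
`L²(μT)`). Proof shape: for offset `x`, time `t`, `ε`: (M1sev) replaces `P_t j_k` (`k = i + x`) by `j_k ∘ T^Λ_t ∘ embed` in
`L²(μ_{N,T})` against `‖j_i‖₂ = O(1)` (landed second moments); BM locality does the same on the infinite side; both expectations
are then STATIC expectations of ONE local functional `F = j_0 · (j_x ∘ T^Λ_t)` read on the window `[−M−1, x+M+2]` (finite side: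
the same `F` transported by the embedding/`boxPhaseAt`, using `severedFlow_cbox_dependsOn`), truncated at a level `K` with tails
controlled by N-uniform fourth moments (energy conservation of `T^Λ` + exponential local-energy moments), and (E1) applied to the
bounded truncation. -/
theorem stub_uniformFixedTimeOffsetMatchingOfEngines :
    (∀ ω₂ lam β γ : ℝ, 0 < ω₂ → 0 < lam → 0 < β → 0 < γ → ∀ T : ℝ, 0 < T →
      ∀ μT : MeasureTheory.Measure Literature.MathematicalPhysics.KineticTheory.HeatConduction.ChainConfig,
        (Literature.MathematicalPhysics.KineticTheory.HeatConduction.pinnedChain ω₂ lam β γ).IsChainGibbsMeasure T μT →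
        Literature.MathematicalPhysics.KineticTheory.HeatConduction.IsShiftInvariant μT →
        (Literature.MathematicalPhysics.KineticTheory.HeatConduction.pinnedChain ω₂ lam β γ).HasSuperstabilityEstimate μT →
        ∀ (m : ℕ) (f : Literature.MathematicalPhysics.KineticTheory.HeatConduction.PhaseSpace (m + 1) → ℝ),
          Measurable f → (∀ w, |f w| ≤ 1) →
          ∀ ε : ℝ, 0 < ε → ∃ L N₀ : ℕ, ∀ N : ℕ, N₀ ≤ N → ∀ (i : Fin N) (hL : L ≤ i.val) (hi : i.val + m + L < N),
            |(∫ z, f (fun j : Fin (m + 1) => z.1 ⟨i.val + j.val, by omega⟩,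
                      fun j : Fin (m + 1) => z.2 ⟨i.val + j.val, by omega⟩)
                ∂((Literature.MathematicalPhysics.KineticTheory.HeatConduction.pinnedChain ω₂ lam β γ).gibbsMeasure N T)) -
              ∫ σ, f (Literature.MathematicalPhysics.KineticTheory.HeatConduction.boxPhaseAt 0 m σ) ∂μT| ≤ ε) →
    (∀ ω₂ lam β γ : ℝ, ∀ (hω : 0 < ω₂) (hl : 0 < lam) (hβ : 0 < β), 0 < γ → ∀ T : ℝ, 0 < T →
      ∀ τ : ℝ, 0 < τ → ∀ ε : ℝ, 0 < ε → ∃ M₀ : ℕ, ∀ M : ℕ, M₀ ≤ M → ∃ N₀ : ℕ, ∀ N : ℕ, N₀ ≤ N →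
        ∀ (k : Fin N) (hk : M + 2 ≤ k.val) (hkN : k.val + M + 3 < N), ∀ t ∈ Set.Icc (0 : ℝ) τ,
          MeasureTheory.Integrable (fun z : Literature.MathematicalPhysics.KineticTheory.HeatConduction.PhaseSpace N =>
              ((∫ y, (Literature.MathematicalPhysics.KineticTheory.HeatConduction.pinnedChain ω₂ lam β γ).bondCurrent N k y
                  ∂((Literature.MathematicalPhysics.KineticTheory.HeatConduction.pinnedChain ω₂ lam β γ).transitionKernel N T T t.toNNReal z)) -
                (Literature.MathematicalPhysics.KineticTheory.HeatConduction.pinnedChain ω₂ lam β γ).bondCurrentZ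
                  (Literature.MathematicalPhysics.KineticTheory.HeatConduction.OscillatorChain.severedFlow
                    (Literature.MathematicalPhysics.KineticTheory.HeatConduction.OscillatorChain.condB1_pinnedChain hω.le hl.le hβ.le γ)
                    (Finset.Icc ((k.val : ℤ) - M) ((k.val : ℤ) + 1 + M)) t
                    (fun x : ℤ => if h : 0 ≤ x ∧ x < N then (z.1 ⟨x.toNat, by omega⟩, z.2 ⟨x.toNat, by omega⟩) else (0, 0)))
                  (k.val : ℤ)) ^ 2)
            ((Literature.MathematicalPhysics.KineticTheory.HeatConduction.pinnedChain ω₂ lam β γ).gibbsMeasure N T) ∧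
          ∫ z : Literature.MathematicalPhysics.KineticTheory.HeatConduction.PhaseSpace N,
              ((∫ y, (Literature.MathematicalPhysics.KineticTheory.HeatConduction.pinnedChain ω₂ lam β γ).bondCurrent N k y
                  ∂((Literature.MathematicalPhysics.KineticTheory.HeatConduction.pinnedChain ω₂ lam β γ).transitionKernel N T T t.toNNReal z)) -
                (Literature.MathematicalPhysics.KineticTheory.HeatConduction.pinnedChain ω₂ lam β γ).bondCurrentZ
                  (Literature.MathematicalPhysics.KineticTheory.HeatConduction.OscillatorChain.severedFlow
                    (Literature.MathematicalPhysics.KineticTheory.HeatConduction.OscillatorChain.condB1_pinnedChain hω.le hl.le hβ.le γ)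
                    (Finset.Icc ((k.val : ℤ) - M) ((k.val : ℤ) + 1 + M)) t
                    (fun x : ℤ => if h : 0 ≤ x ∧ x < N then (z.1 ⟨x.toNat, by omega⟩, z.2 ⟨x.toNat, by omega⟩) else (0, 0)))
                  (k.val : ℤ)) ^ 2
            ∂((Literature.MathematicalPhysics.KineticTheory.HeatConduction.pinnedChain ω₂ lam β γ).gibbsMeasure N T) ≤ ε) →
∀ ω₂ lam β γ : ℝ, 0 < ω₂ → 0 < lam → 0 < β → 0 < γ → ∀ T : ℝ, 0 < T →
      (∀ μ₁ μ₂ : MeasureTheory.Measure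
            Literature.MathematicalPhysics.KineticTheory.HeatConduction.ChainConfig,
          (Literature.MathematicalPhysics.KineticTheory.HeatConduction.pinnedChain
                ω₂ lam β γ).IsChainGibbsMeasure T μ₁ →
          Literature.MathematicalPhysics.KineticTheory.HeatConduction.IsShiftInvariant μ₁ →
          (Literature.MathematicalPhysics.KineticTheory.HeatConduction.pinnedChain
                ω₂ lam β γ).HasSuperstabilityEstimate μ₁ →
          (Literature.MathematicalPhysics.KineticTheory.HeatConduction.pinnedChain
                ω₂ lam β γ).IsChainGibbsMeasure T μ₂ →
          Literature.MathematicalPhysics.KineticTheory.HeatConduction.IsShiftInvariant μ₂ →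
          (Literature.MathematicalPhysics.KineticTheory.HeatConduction.pinnedChain
                ω₂ lam β γ).HasSuperstabilityEstimate μ₂ → μ₁ = μ₂) →
      ∀ (μT : MeasureTheory.Measure
            Literature.MathematicalPhysics.KineticTheory.HeatConduction.ChainConfig)
        (D : Literature.MathematicalPhysics.KineticTheory.HeatConduction.InfiniteChainDynamics
          (Literature.MathematicalPhysics.KineticTheory.HeatConduction.pinnedChain ω₂ lam β γ)),
        (Literature.MathematicalPhysics.KineticTheory.HeatConduction.pinnedChain
            ω₂ lam β γ).IsChainGibbsMeasure T μT →
        Literature.MathematicalPhysics.KineticTheory.HeatConduction.IsShiftInvariant μT →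
        (Literature.MathematicalPhysics.KineticTheory.HeatConduction.pinnedChain
            ω₂ lam β γ).HasSuperstabilityEstimate μT →
        D.carrier ⊆ (Literature.MathematicalPhysics.KineticTheory.HeatConduction.pinnedChain
            ω₂ lam β γ).bmGood →
        D.PreservesMeasure μT →
        (∀ t : ℝ, D.HasAbsConvergentCorrelation μT t) →
        ∀ (x : ℤ) (t : ℝ), 0 < t → ∀ ε : ℝ, 0 < ε → ∃ L N₀ : ℕ, ∀ N : ℕ, N₀ ≤ N → ∀ i k : Fin N,
          L ≤ i.val → i.val + L < N → (k.val : ℤ) = i.val + x →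
          |(∫ z, (Literature.MathematicalPhysics.KineticTheory.HeatConduction.pinnedChain
                    ω₂ lam β γ).bondCurrent N i z *
              (∫ y, (Literature.MathematicalPhysics.KineticTheory.HeatConduction.pinnedChain
                    ω₂ lam β γ).bondCurrent N k y
                ∂((Literature.MathematicalPhysics.KineticTheory.HeatConduction.pinnedChain
                    ω₂ lam β γ).transitionKernel N T T t.toNNReal z))
              ∂((Literature.MathematicalPhysics.KineticTheory.HeatConduction.pinnedChain
                    ω₂ lam β γ).gibbsMeasure N T)) -
            ∫ σ, (Literature.MathematicalPhysics.KineticTheory.HeatConduction.pinnedChain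
                    ω₂ lam β γ).bondCurrentZ σ 0 *
              (Literature.MathematicalPhysics.KineticTheory.HeatConduction.pinnedChain
                    ω₂ lam β γ).bondCurrentZ (D.flow t σ) x ∂μT| ≤ ε :=
  Summit.AtomisticToContinuum.FouriersLaw.Theorems.AbelThermodynamicLimit.SeriesLawAtEveryLaplaceFrequency.stub_uniformFixedTimeOffsetMatchingOfEngines

/-- **Stub (B′) — `stub_uniformFixedTimeOffsetMatching`: per-offset fixed-time open/closed matching, anchor-uniform form** —
rev 7: DERIVED from the three registered engines (E1) `stub_bulkWindowEquivalence`, (M1sev) `stub_openChainSeveredLocality` and the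
coupling (B′|E1,M1sev) `stub_uniformFixedTimeOffsetMatchingOfEngines` (DYNAMICAL LEAF, size L–XL, registered rev 4 by W-HTIME; it implies the sibling's `stub_fixedTimeOffsetMatching` VERBATIM — landed
`fixedTimeOffsetMatching_of_uniformFixedTimeOffsetMatching`, p102310). For `P` (all `> 0`), `T > 0` with regular-DLR uniqueness and
every regular witness `(μT, D)`: for every offset `x`, time `t > 0` and `ε > 0` there are a depth `L` and `N₀` with
`|⟨j_i(0) j_{i+x}(t)⟩_{N,T} − ∫ j_0 · (j_x ∘ φ_t) dμT| ≤ ε` for all `N ≥ N₀` and all `L`-deep anchors `i`. Content: (M1) + bulk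
equivalence of ensembles `gibbsMeasure N T → μT` on `L`-deep windows (transfer-operator machinery landing in tree:
`chainSpecification_Icc_tendsto_uniformly`, `eq_of_isChainGibbsMeasure_of_tight_pinnedChain`, `N`-uniform one-site moments) + the
two-dynamics coupling (open OU-ended chain vs BM flow) on the light cone + RegUniq. The ONLY leaf using the witness. -/
theorem stub_uniformFixedTimeOffsetMatching :
∀ ω₂ lam β γ : ℝ, 0 < ω₂ → 0 < lam → 0 < β → 0 < γ → ∀ T : ℝ, 0 < T →
      (∀ μ₁ μ₂ : MeasureTheory.Measure
            Literature.MathematicalPhysics.KineticTheory.HeatConduction.ChainConfig,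
          (Literature.MathematicalPhysics.KineticTheory.HeatConduction.pinnedChain
                ω₂ lam β γ).IsChainGibbsMeasure T μ₁ →
          Literature.MathematicalPhysics.KineticTheory.HeatConduction.IsShiftInvariant μ₁ →
          (Literature.MathematicalPhysics.KineticTheory.HeatConduction.pinnedChain
                ω₂ lam β γ).HasSuperstabilityEstimate μ₁ →
          (Literature.MathematicalPhysics.KineticTheory.HeatConduction.pinnedChain
                ω₂ lam β γ).IsChainGibbsMeasure T μ₂ →
          Literature.MathematicalPhysics.KineticTheory.HeatConduction.IsShiftInvariant μ₂ →
          (Literature.MathematicalPhysics.KineticTheory.HeatConduction.pinnedChain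
                ω₂ lam β γ).HasSuperstabilityEstimate μ₂ → μ₁ = μ₂) →
      ∀ (μT : MeasureTheory.Measure
            Literature.MathematicalPhysics.KineticTheory.HeatConduction.ChainConfig)
        (D : Literature.MathematicalPhysics.KineticTheory.HeatConduction.InfiniteChainDynamics
          (Literature.MathematicalPhysics.KineticTheory.HeatConduction.pinnedChain ω₂ lam β γ)),
        (Literature.MathematicalPhysics.KineticTheory.HeatConduction.pinnedChain
            ω₂ lam β γ).IsChainGibbsMeasure T μT →
        Literature.MathematicalPhysics.KineticTheory.HeatConduction.IsShiftInvariant μT →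
        (Literature.MathematicalPhysics.KineticTheory.HeatConduction.pinnedChain
            ω₂ lam β γ).HasSuperstabilityEstimate μT →
        D.carrier ⊆ (Literature.MathematicalPhysics.KineticTheory.HeatConduction.pinnedChain
            ω₂ lam β γ).bmGood →
        D.PreservesMeasure μT →
        (∀ t : ℝ, D.HasAbsConvergentCorrelation μT t) →
        ∀ (x : ℤ) (t : ℝ), 0 < t → ∀ ε : ℝ, 0 < ε → ∃ L N₀ : ℕ, ∀ N : ℕ, N₀ ≤ N → ∀ i k : Fin N,
          L ≤ i.val → i.val + L < N → (k.val : ℤ) = i.val + x →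
          |(∫ z, (Literature.MathematicalPhysics.KineticTheory.HeatConduction.pinnedChain
                    ω₂ lam β γ).bondCurrent N i z *
              (∫ y, (Literature.MathematicalPhysics.KineticTheory.HeatConduction.pinnedChain
                    ω₂ lam β γ).bondCurrent N k y
                ∂((Literature.MathematicalPhysics.KineticTheory.HeatConduction.pinnedChain
                    ω₂ lam β γ).transitionKernel N T T t.toNNReal z))
              ∂((Literature.MathematicalPhysics.KineticTheory.HeatConduction.pinnedChain
                    ω₂ lam β γ).gibbsMeasure N T)) -
            ∫ σ, (Literature.MathematicalPhysics.KineticTheory.HeatConduction.pinnedChain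
                    ω₂ lam β γ).bondCurrentZ σ 0 *
              (Literature.MathematicalPhysics.KineticTheory.HeatConduction.pinnedChain
                    ω₂ lam β γ).bondCurrentZ (D.flow t σ) x ∂μT| ≤ ε :=
  Summit.AtomisticToContinuum.FouriersLaw.Theorems.AbelThermodynamicLimit.SeriesLawAtEveryLaplaceFrequency.stub_uniformFixedTimeOffsetMatching

/-- **Stub H_time — `stub_fixedTimeMatching`: FIXED-TIME bond-averaged open/closed matching, the residual of S3** —
rev 4: CLOSED MODULO the two DYNAMICAL LEAVES (C′) `stub_uniformAnchoredCorrelationTails` + (B′) `stub_uniformFixedTimeOffsetMatching`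
by W-S3's landed `stub_fixedTimeMatchingOfUniformLeaves` (p101967; the ten-line global→local glue inlined here is W-HTIME's
`fixedTimeMatching_of_registeredLeaves`, p103934) (size XL; registered rev 3; W-S3's reduction `stub_fixedFrequencyMatchingOfFixedTime` — LANDED — makes S3 follow from it by
dominated convergence against `B e^{-νt}`, `|c_N(t)| ≤ B·N` being the LANDED `stub_perLengthCurrentAutocorrBound`). For `P`
(all `> 0`), `T > 0` with regular-DLR uniqueness, every regular witness `(μT, D)` (`carrier ⊆ bmGood`): for a.e. `t > 0`,
`c_N(t)/N → C_T(t)`. Content: light cone at FIXED time for the open chain with OU ends and for the BM infinite dynamics,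
1-D equivalence of ensembles on bulk windows (free-boundary `gibbsMeasure N T` vs the unique regular DLR state), uniformly over
bulk anchors — the anchor-uniform twin of the sibling's dynamical leaves `stub_anchoredCorrelationTails` (C) and
`stub_fixedTimeOffsetMatching` (B₀) registered on stmt-12596. Disproof §4 step (2). -/
theorem stub_fixedTimeMatching :
∀ ω₂ lam β γ : ℝ, 0 < ω₂ → 0 < lam → 0 < β → 0 < γ → ∀ T : ℝ, 0 < T →
      (∀ μ₁ μ₂ : MeasureTheory.Measure
            Literature.MathematicalPhysics.KineticTheory.HeatConduction.ChainConfig,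
          (Literature.MathematicalPhysics.KineticTheory.HeatConduction.pinnedChain
                ω₂ lam β γ).IsChainGibbsMeasure T μ₁ →
          Literature.MathematicalPhysics.KineticTheory.HeatConduction.IsShiftInvariant μ₁ →
          (Literature.MathematicalPhysics.KineticTheory.HeatConduction.pinnedChain
                ω₂ lam β γ).HasSuperstabilityEstimate μ₁ →
          (Literature.MathematicalPhysics.KineticTheory.HeatConduction.pinnedChain
                ω₂ lam β γ).IsChainGibbsMeasure T μ₂ →
          Literature.MathematicalPhysics.KineticTheory.HeatConduction.IsShiftInvariant μ₂ →
          (Literature.MathematicalPhysics.KineticTheory.HeatConduction.pinnedChain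
                ω₂ lam β γ).HasSuperstabilityEstimate μ₂ → μ₁ = μ₂) →
      ∀ (μT : MeasureTheory.Measure
            Literature.MathematicalPhysics.KineticTheory.HeatConduction.ChainConfig)
        (D : Literature.MathematicalPhysics.KineticTheory.HeatConduction.InfiniteChainDynamics
          (Literature.MathematicalPhysics.KineticTheory.HeatConduction.pinnedChain ω₂ lam β γ)),
        (Literature.MathematicalPhysics.KineticTheory.HeatConduction.pinnedChain
            ω₂ lam β γ).IsChainGibbsMeasure T μT →
        Literature.MathematicalPhysics.KineticTheory.HeatConduction.IsShiftInvariant μT →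
        (Literature.MathematicalPhysics.KineticTheory.HeatConduction.pinnedChain
            ω₂ lam β γ).HasSuperstabilityEstimate μT →
        D.carrier ⊆ (Literature.MathematicalPhysics.KineticTheory.HeatConduction.pinnedChain
            ω₂ lam β γ).bmGood →
        D.PreservesMeasure μT →
        (∀ t : ℝ, D.HasAbsConvergentCorrelation μT t) →
        ∀ᵐ t ∂(MeasureTheory.volume.restrict (Set.Ioi (0:ℝ))),
          Filter.Tendsto (fun N : ℕ =>
              (∫ z, (∑ i : Fin N, (Literature.MathematicalPhysics.KineticTheory.HeatConduction.pinnedChain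
                      ω₂ lam β γ).bondCurrent N i z) *
                  (∫ y, (∑ i : Fin N, (Literature.MathematicalPhysics.KineticTheory.HeatConduction.pinnedChain
                      ω₂ lam β γ).bondCurrent N i y)
                    ∂((Literature.MathematicalPhysics.KineticTheory.HeatConduction.pinnedChain
                      ω₂ lam β γ).transitionKernel N T T t.toNNReal z))
                ∂((Literature.MathematicalPhysics.KineticTheory.HeatConduction.pinnedChain
                      ω₂ lam β γ).gibbsMeasure N T)) / (N : ℝ))
            Filter.atTop (nhds (D.currentCorrelation μT t)) := by
  intro ω₂ lam β γ hω hl hβ hγ T hT hU μT D hG hS hss hcar hPres hAC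
  have hB := stub_uniformFixedTimeOffsetMatching ω₂ lam β γ hω hl hβ hγ T hT hU μT D hG hS hss hcar hPres hAC
  refine (MeasureTheory.ae_restrict_iff' measurableSet_Ioi).2 (MeasureTheory.ae_of_all _ fun t ht => ?_)
  refine stub_fixedTimeMatchingOfUniformLeaves ω₂ lam β γ hω hl hβ hγ T hT μT D hAC hB ?_ t ht
  intro s hs ε hε
  obtain ⟨R, N₀, h⟩ := stub_uniformAnchoredCorrelationTails ω₂ lam β γ hω hl hβ hγ T hT s hs ε hε
  exact ⟨R, N₀, fun N hN i h1 h2 => h N hN i h1 h2 s ⟨hs.le, le_rfl⟩⟩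

/-- **Stub S3 — `stub_fixedFrequencyMatching`: fixed-frequency identification for REGULAR witnesses** (size
L–XL; Disproof §4 step (2); reshaped rev 1 from fekete's S3: the witness class is the REGULAR WITNESS class of the
sibling lead's loomis skeleton — DLR + shift-invariant + BM-superstable state, `D.carrier ⊆ bmGood` — DLR
uniqueness in the regular class is an INLINE hypothesis (verbatim loomis S4's, discharged by the shared
`stub_regularDLRUnique`), the Abel data `κ` are dropped (irrelevant at `ν > 0`), and the conclusion is asked at
EVERY `ν > 0`). For `P` (all `> 0`), `T > 0` with regular DLR uniqueness, every regular witness `(μT, D)` and every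
`ν > 0`: `F_N(ν)/N → Â(ν) := ∫₀^∞ e^{-νt} C_T(t) dt`, `C_T = D.currentCorrelation μT`. Lead's reduction plan (to
ride as registered reduction stubs / `--supports` lemmas): (a) uniform per-length bound `|c_N(t)| ≤ B·N` for all
`t ≥ 0`, `N ≥ 1` (`⟨J, P_t J⟩ ≤ ½(‖J‖² + ‖P_tJ‖²) ≤ ‖J‖²` by the landed `L²(μ_{N,T})`-contraction
`pinnedChain_integral_sq_act_le`; `⟨j_i j_k⟩_{N,T} = 0` for `|i−k| ≥ 2` (Gaussian momenta, landed
`integral_bondCurrent_mul_eq_zero`) and the landed uniform second moments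
`pinnedChain_integral_sq_bondCurrent_gibbsMeasure_le`, so `‖J‖² ≤ 3MN`); (b) `C_T` bounded measurable (LANDED:
`stub_witnessPositiveType` for exactly this witness class); (c) FIXED-TIME bond-averaged matching
`c_N(t)/N → C_T(t)` for a.e. `t > 0` (light cone at fixed time + 1-D ensemble equivalence + regular DLR
uniqueness — the twin of loomis's `stub_fixedHorizonMatchingOfFixedTime` inputs); then dominated convergence in
`t` against `B e^{-νt}`. Why it might fail: only through (c) for the quartic coupling; false for exotic
non-regular witnesses, which is why they are excluded (seam = `stub_witnessRegularisation` + landed seam lemmas).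
Sources: ButtaMarchioro2016, BonettoLebowitzReyBellet2000 §7, KunduDharNarayan2009, COPP1978. -/
theorem stub_fixedFrequencyMatching :
    ∀ ω₂ lam β γ : ℝ, 0 < ω₂ → 0 < lam → 0 < β → 0 < γ → ∀ T : ℝ, 0 < T →
      (∀ μ₁ μ₂ : MeasureTheory.Measure
            Literature.MathematicalPhysics.KineticTheory.HeatConduction.ChainConfig,
          (Literature.MathematicalPhysics.KineticTheory.HeatConduction.pinnedChain
                ω₂ lam β γ).IsChainGibbsMeasure T μ₁ →
          Literature.MathematicalPhysics.KineticTheory.HeatConduction.IsShiftInvariant μ₁ →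
          (Literature.MathematicalPhysics.KineticTheory.HeatConduction.pinnedChain
                ω₂ lam β γ).HasSuperstabilityEstimate μ₁ →
          (Literature.MathematicalPhysics.KineticTheory.HeatConduction.pinnedChain
                ω₂ lam β γ).IsChainGibbsMeasure T μ₂ →
          Literature.MathematicalPhysics.KineticTheory.HeatConduction.IsShiftInvariant μ₂ →
          (Literature.MathematicalPhysics.KineticTheory.HeatConduction.pinnedChain
                ω₂ lam β γ).HasSuperstabilityEstimate μ₂ → μ₁ = μ₂) →

      ∀ (μT : MeasureTheory.Measure
            Literature.MathematicalPhysics.KineticTheory.HeatConduction.ChainConfig)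
        (D : Literature.MathematicalPhysics.KineticTheory.HeatConduction.InfiniteChainDynamics
          (Literature.MathematicalPhysics.KineticTheory.HeatConduction.pinnedChain ω₂ lam β γ)),
        (Literature.MathematicalPhysics.KineticTheory.HeatConduction.pinnedChain
            ω₂ lam β γ).IsChainGibbsMeasure T μT →
        Literature.MathematicalPhysics.KineticTheory.HeatConduction.IsShiftInvariant μT →
        (Literature.MathematicalPhysics.KineticTheory.HeatConduction.pinnedChain
            ω₂ lam β γ).HasSuperstabilityEstimate μT →
        D.carrier ⊆ (Literature.MathematicalPhysics.KineticTheory.HeatConduction.pinnedChain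
            ω₂ lam β γ).bmGood →
        D.PreservesMeasure μT →
        (∀ t : ℝ, D.HasAbsConvergentCorrelation μT t) →
        ∀ ν : ℝ, 0 < ν →
          Filter.Tendsto (fun N : ℕ =>
              MeasureTheory.integral (MeasureTheory.volume.restrict (Set.Ioi (0:ℝ))) (fun t : ℝ =>
                Real.exp (-(ν * t)) *
                  ∫ z, (∑ i : Fin N, (Literature.MathematicalPhysics.KineticTheory.HeatConduction.pinnedChain
                          ω₂ lam β γ).bondCurrent N i z) *
                    (∫ y, (∑ i : Fin N, (Literature.MathematicalPhysics.KineticTheory.HeatConduction.pinnedChain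
                          ω₂ lam β γ).bondCurrent N i y)
                      ∂((Literature.MathematicalPhysics.KineticTheory.HeatConduction.pinnedChain
                          ω₂ lam β γ).transitionKernel N T T t.toNNReal z))
                    ∂((Literature.MathematicalPhysics.KineticTheory.HeatConduction.pinnedChain
                          ω₂ lam β γ).gibbsMeasure N T)) / (N : ℝ))
            Filter.atTop
            (nhds (MeasureTheory.integral (MeasureTheory.volume.restrict (Set.Ioi (0:ℝ)))
              (fun t : ℝ => Real.exp (-(ν * t)) * D.currentCorrelation μT t))) := by
  intro ω₂ lam β γ hω hl hβ hγ T hT hU μT D hG hS hss hcar hP hAC ν hν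
  exact stub_fixedFrequencyMatchingOfFixedTime ω₂ lam β γ hω hl hβ hγ T hT hU μT D hG hS hss hcar hP hAC
    (stub_fixedTimeMatching ω₂ lam β γ hω hl hβ hγ T hT hU μT D hG hS hss hcar hP hAC) ν hν

/-! ### Rev 17 (lead c3, after crux-strategist s2's `Lines/window_regularity.lean`, 2026-08-17): the ROUTE-FAITHFUL cone — the seam SI is a
THEOREM on route `LatticeLandauDamping`, and CLB is not needed there.
`LatticeLandauDamping.closes` feeds this crux the witness it builds from the route's three SPECTRAL cruxes `WindowDecomposition` (stmt-14011) /
`NoDrudeWeight` (stmt-14012) / `PositiveDensity` (stmt-14014) and the PROVED Poisson lemma `AbelOfSpectralDensity` (stmt-12598) — a witness whose DLR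
state IS shift-invariant.  So: the three spectral cruxes are registered BY NAME as stubs (this route's own engine; open, in the cone of `closes` anyway),
the honest shift-invariant Abelian Green–Kubo witness follows (`abelGreenKuboSI_of_window`, strategist s2's proof verbatim; landed as the registered glue
stub `stub_abelGreenKuboSIOfWindow` in `Theorems/LatticeLandauDampingAbelThermodynamicLimitWindowRegularity.lean`, proposed this cycle), the seam SI
`stub_witnessShiftInvariant` becomes a THEOREM (below), and the crux gets the seam-free, CLB-free cone {uniformSignedTail, WD, NDW, PD}
(`AbelThermodynamicLimit_of_uniformSignedTail_window` at the end of the file).  Sorries after rev 17 (7 = stubs_max): QS, QSR, WD, NDW, PD,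
uniformSignedTail, CLB; minimal cones of the crux: {ST, WD, NDW, PD} (route-faithful), {ST, CLB} (route-external), {QS, QSR, WD, NDW, PD}. -/

/-- **Stub — `stub_windowDecomposition`: this route's spectral crux `WindowDecomposition` BY NAME** (item stmt-AtomisticToContinuum-14011, open; in the
cone of `closes` anyway): a shift-invariant DLR state with measure-preserving dynamics whose current spectral measure decomposes into an atom at 0 plus a
density continuous on a window. Not worked in this line. -/
theorem stub_windowDecomposition :
    Summit.AtomisticToContinuum.FouriersLaw.Theses.LatticeLandauDamping.WindowDecomposition := by
  sorry

/-- **Stub — `stub_noDrudeWeight`: this route's spectral crux `NoDrudeWeight` BY NAME** (item stmt-AtomisticToContinuum-14012, open): the atom at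
frequency 0 (Drude weight) vanishes for every such spectral witness. Not worked in this line. -/
theorem stub_noDrudeWeight :
    Summit.AtomisticToContinuum.FouriersLaw.Theses.LatticeLandauDamping.NoDrudeWeight := by
  sorry

/-- **Stub — `stub_positiveDensity`: this route's spectral crux `PositiveDensity` BY NAME** (item stmt-AtomisticToContinuum-14014, open): the
spectral density at frequency 0 is positive. Not worked in this line. -/
theorem stub_positiveDensity :
    Summit.AtomisticToContinuum.FouriersLaw.Theses.LatticeLandauDamping.PositiveDensity := by
  sorry

/-- **The HONEST Abelian Green–Kubo witness from the three spectral stubs** (= strategist s2's `abelGreenKuboSI_of_window`, proof verbatim; = the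
registered glue stub `stub_abelGreenKuboSIOfWindow` of `Theorems/LatticeLandauDampingAbelThermodynamicLimitWindowRegularity.lean`): shift-invariant DLR
state, measure-preserving dynamics, absolutely convergent correlations, `κ = T⁻²·π·g(0) > 0`, Abel limit `κ`. [folklore] -/
theorem abelGreenKuboSI_of_window
    (hW : Summit.AtomisticToContinuum.FouriersLaw.Theses.LatticeLandauDamping.WindowDecomposition)
    (hND : Summit.AtomisticToContinuum.FouriersLaw.Theses.LatticeLandauDamping.NoDrudeWeight)
    (hPD : Summit.AtomisticToContinuum.FouriersLaw.Theses.LatticeLandauDamping.PositiveDensity) :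
    ∀ ω₂ lam β γ : ℝ, 0 < ω₂ → 0 < lam → 0 < β → 0 < γ → ∀ T : ℝ, 0 < T →
      ∃ (μT : MeasureTheory.Measure Literature.MathematicalPhysics.KineticTheory.HeatConduction.ChainConfig)
        (D : Literature.MathematicalPhysics.KineticTheory.HeatConduction.InfiniteChainDynamics
          (Literature.MathematicalPhysics.KineticTheory.HeatConduction.pinnedChain ω₂ lam β γ)) (κ : ℝ),
        (Literature.MathematicalPhysics.KineticTheory.HeatConduction.pinnedChain ω₂ lam β γ).IsChainGibbsMeasure T μT ∧
        Literature.MathematicalPhysics.KineticTheory.HeatConduction.IsShiftInvariant μT ∧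
        D.PreservesMeasure μT ∧
        (∀ t : ℝ, D.HasAbsConvergentCorrelation μT t) ∧ 0 < κ ∧
        Filter.Tendsto (fun ν : ℝ => (T ^ 2)⁻¹ *
          MeasureTheory.integral (MeasureTheory.volume.restrict (Set.Ioi (0:ℝ)))
            (fun t : ℝ => Real.exp (-(ν * t)) * (D.currentCorrelation μT) t))
          (nhdsWithin (0:ℝ) (Set.Ioi 0)) (nhds κ) :=
  Summit.AtomisticToContinuum.FouriersLaw.Theorems.AbelThermodynamicLimit.WindowRegularity.stub_abelGreenKuboSIOfWindow hW hND hPD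

/-- The live line's seam SI (`stub_witnessShiftInvariant` of `Lines/SketchIdeator2.lean`, verbatim statement) is a COROLLARY of
stub X (ignore SI's hypothesis). [folklore] -/
theorem witnessShiftInvariant_of_abelGreenKuboSI
    (hX : ∀ ω₂ lam β γ : ℝ, 0 < ω₂ → 0 < lam → 0 < β → 0 < γ → ∀ T : ℝ, 0 < T →
      ∃ (μT : MeasureTheory.Measure Literature.MathematicalPhysics.KineticTheory.HeatConduction.ChainConfig)
        (D : Literature.MathematicalPhysics.KineticTheory.HeatConduction.InfiniteChainDynamics
          (Literature.MathematicalPhysics.KineticTheory.HeatConduction.pinnedChain ω₂ lam β γ)) (κ : ℝ),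
        (Literature.MathematicalPhysics.KineticTheory.HeatConduction.pinnedChain ω₂ lam β γ).IsChainGibbsMeasure T μT ∧
        Literature.MathematicalPhysics.KineticTheory.HeatConduction.IsShiftInvariant μT ∧
        D.PreservesMeasure μT ∧
        (∀ t : ℝ, D.HasAbsConvergentCorrelation μT t) ∧ 0 < κ ∧
        Filter.Tendsto (fun ν : ℝ => (T ^ 2)⁻¹ *
          MeasureTheory.integral (MeasureTheory.volume.restrict (Set.Ioi (0:ℝ)))
            (fun t : ℝ => Real.exp (-(ν * t)) * (D.currentCorrelation μT) t))
          (nhdsWithin (0:ℝ) (Set.Ioi 0)) (nhds κ)) :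
    ∀ ω₂ lam β γ : ℝ, 0 < ω₂ → 0 < lam → 0 < β → 0 < γ → ∀ T : ℝ, 0 < T →
      (∃ (μT : MeasureTheory.Measure Literature.MathematicalPhysics.KineticTheory.HeatConduction.ChainConfig)
          (D' : Literature.MathematicalPhysics.KineticTheory.HeatConduction.InfiniteChainDynamics
            (Literature.MathematicalPhysics.KineticTheory.HeatConduction.pinnedChain ω₂ lam β γ)) (κ : ℝ),
          (Literature.MathematicalPhysics.KineticTheory.HeatConduction.pinnedChain ω₂ lam β γ).IsChainGibbsMeasure T μT ∧
          D'.PreservesMeasure μT ∧ (∀ t : ℝ, D'.HasAbsConvergentCorrelation μT t) ∧ 0 < κ ∧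
          Filter.Tendsto (fun ν : ℝ => (T ^ 2)⁻¹ *
            MeasureTheory.integral (MeasureTheory.volume.restrict (Set.Ioi (0:ℝ)))
              (fun t : ℝ => Real.exp (-(ν * t)) * D'.currentCorrelation μT t))
            (nhdsWithin (0:ℝ) (Set.Ioi 0)) (nhds κ)) →
      ∃ (μT : MeasureTheory.Measure Literature.MathematicalPhysics.KineticTheory.HeatConduction.ChainConfig)
        (D' : Literature.MathematicalPhysics.KineticTheory.HeatConduction.InfiniteChainDynamics
          (Literature.MathematicalPhysics.KineticTheory.HeatConduction.pinnedChain ω₂ lam β γ)) (κ : ℝ),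
        (Literature.MathematicalPhysics.KineticTheory.HeatConduction.pinnedChain ω₂ lam β γ).IsChainGibbsMeasure T μT ∧
        Literature.MathematicalPhysics.KineticTheory.HeatConduction.IsShiftInvariant μT ∧ D'.PreservesMeasure μT ∧
        (∀ t : ℝ, D'.HasAbsConvergentCorrelation μT t) ∧ 0 < κ ∧
        Filter.Tendsto (fun ν : ℝ => (T ^ 2)⁻¹ *
          MeasureTheory.integral (MeasureTheory.volume.restrict (Set.Ioi (0:ℝ)))
            (fun t : ℝ => Real.exp (-(ν * t)) * D'.currentCorrelation μT t))
          (nhdsWithin (0:ℝ) (Set.Ioi 0)) (nhds κ) :=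
  Summit.AtomisticToContinuum.FouriersLaw.Theorems.AbelThermodynamicLimit.WindowRegularity.witnessShiftInvariant_of_abelGreenKuboSI hX

/-- **Stub SI — `stub_witnessShiftInvariant` — rev 17: a THEOREM on this route** (`witnessShiftInvariant_of_abelGreenKuboSI ∘ abelGreenKuboSI_of_window` applied to
the three spectral stubs; statement unchanged). HISTORY: WLOG THE WITNESS STATE IS SHIFT-INVARIANT (the seam's honest
residual, rev 6, lead c1; replaces rev 4/5's EB `stub_witnessEnergyBound` + WT `stub_witnessTight`, whose landed reductions
p102198 / p97986 stay in `Theorems/` as history). For `P = pinnedChain ω₂ lam β γ` (all `> 0`) and `T > 0`: IF an Abelian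
Green–Kubo witness `(μ, D, κ)` exists at `T` THEN one exists whose DLR state is invariant under the lattice shift
(`IsShiftInvariant`, i.e. `μ.map shift = μ`). Given SI the whole seam is LANDED Literature: a shift-invariant probability
measure is one-site tight (`oneSiteTight_of_isShiftInvariant`) and a tight DLR state of the pinned chain IS the transfer-operator
Markov state, hence shift-invariant AND Buttà–Marchioro superstable
(`OscillatorChain.isShiftInvariant_and_hasSuperstabilityEstimate_of_tight_pinnedChain`, InfiniteChainTightRegular.lean) — see the
sorry-free `stub_witnessRegularisation` below. STATUS: not decidable in the tree and not expected to be: bare DLR admits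
non-tight ("stretched") Gibbs states at paper level (W-WT, cycle 1: exact transfer integration around the exponentially growing
static equilibria `q_x ≈ 3ρ^{|x|}`, `lam = β(ρ−1)³(1−ρ⁻³)`), and nothing in `PreservesMeasure` / absolutely convergent
correlations / the Abel clause is linked by any tree fact to the spatial profile of `μ`; conversely no exotic witness is
constructible (LLL Thm 3 is a named fact only, and gives no uniqueness-in-carrier). SI is EXACTLY the planner-level repair of
the crux: add `IsShiftInvariant μT` (or `∀ x, MeasurePreserving (σ ↦ σ (· + x)) μT μT`, as the route's own
`WindowDecomposition` / `NoDrudeWeight` / `PositiveDensity` already quantify) to the witness clause of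
`AbelThermodynamicLimit` (and of the target `AbelGreenKubo`, whose intended proof produces a shift-invariant state anyway);
then SI is `fun h => h` and the seam disappears from every line of both cruxes sharing this directory. -/
theorem stub_witnessShiftInvariant :
    ∀ ω₂ lam β γ : ℝ, 0 < ω₂ → 0 < lam → 0 < β → 0 < γ →
      ∀ T : ℝ, 0 < T →
        (∃ (μT : MeasureTheory.Measure
                Literature.MathematicalPhysics.KineticTheory.HeatConduction.ChainConfig)
            (D' : Literature.MathematicalPhysics.KineticTheory.HeatConduction.InfiniteChainDynamics
              (Literature.MathematicalPhysics.KineticTheory.HeatConduction.pinnedChain ω₂ lam β γ))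
            (κ : ℝ),
            (Literature.MathematicalPhysics.KineticTheory.HeatConduction.pinnedChain
                ω₂ lam β γ).IsChainGibbsMeasure T μT ∧ D'.PreservesMeasure μT ∧
            (∀ t : ℝ, D'.HasAbsConvergentCorrelation μT t) ∧ 0 < κ ∧
            Filter.Tendsto (fun ν : ℝ => (T ^ 2)⁻¹ *
              MeasureTheory.integral (MeasureTheory.volume.restrict (Set.Ioi (0:ℝ)))
                (fun t : ℝ => Real.exp (-(ν * t)) * D'.currentCorrelation μT t))
              (nhdsWithin (0:ℝ) (Set.Ioi 0)) (nhds κ)) →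
        ∃ (μT : MeasureTheory.Measure
                Literature.MathematicalPhysics.KineticTheory.HeatConduction.ChainConfig)
            (D' : Literature.MathematicalPhysics.KineticTheory.HeatConduction.InfiniteChainDynamics
              (Literature.MathematicalPhysics.KineticTheory.HeatConduction.pinnedChain ω₂ lam β γ))
            (κ : ℝ),
            (Literature.MathematicalPhysics.KineticTheory.HeatConduction.pinnedChain
                ω₂ lam β γ).IsChainGibbsMeasure T μT ∧
            Literature.MathematicalPhysics.KineticTheory.HeatConduction.IsShiftInvariant μT ∧
            D'.PreservesMeasure μT ∧
            (∀ t : ℝ, D'.HasAbsConvergentCorrelation μT t) ∧ 0 < κ ∧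
            Filter.Tendsto (fun ν : ℝ => (T ^ 2)⁻¹ *
              MeasureTheory.integral (MeasureTheory.volume.restrict (Set.Ioi (0:ℝ)))
                (fun t : ℝ => Real.exp (-(ν * t)) * D'.currentCorrelation μT t))
              (nhdsWithin (0:ℝ) (Set.Ioi 0)) (nhds κ) :=
  witnessShiftInvariant_of_abelGreenKuboSI
    (abelGreenKuboSI_of_window stub_windowDecomposition stub_noDrudeWeight stub_positiveDensity)

/-- **Stub TU — `stub_tightDLRUnique`: DLR UNIQUENESS IN THE ONE-SITE-TIGHT CLASS** — rev 5: CLOSED, a one-liner from the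
Literature theorem `OscillatorChain.eq_of_isChainGibbsMeasure_of_tight_pinnedChain` (InfiniteChainGibbsUniqueness.lean, transfer-operator
proof landed 2026-08-16 by the sibling crux's seats: Hilbert–Schmidt strictly positive transfer operator, Jentzsch gap, boundary-uniform
convergence of the interval kernels, abstract DLR step `measure_eq_of_dlr_of_boundaryUniform`; Georgii 2011 Thm 10.25 / §11.1, COPP 1978 §2).
It discharges BOTH the seam's (TR) hypothesis (`tightRegular_of_tightUnique`) and S7 `stub_regularDLRUnique` (regular ⇒ tight). W-DLRU lands the
registered stub as a `--supports` file (work/stubs/regularDLRUnique_TightStub.lean). -/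
theorem stub_tightDLRUnique :
    ∀ ω₂ lam β γ : ℝ, 0 < ω₂ → 0 < lam → 0 < β → 0 < γ →
      ∀ T : ℝ, 0 < T →
        ∀ μ₁ μ₂ : MeasureTheory.Measure
            Literature.MathematicalPhysics.KineticTheory.HeatConduction.ChainConfig,
          (Literature.MathematicalPhysics.KineticTheory.HeatConduction.pinnedChain
              ω₂ lam β γ).IsChainGibbsMeasure T μ₁ →
          (∀ ε : ℝ, 0 < ε → ∃ R : ℝ, ∀ x : ℤ,
            μ₁ {σ : Literature.MathematicalPhysics.KineticTheory.HeatConduction.ChainConfig |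
                R < |(σ x).1|} ≤ ENNReal.ofReal ε) →
          (Literature.MathematicalPhysics.KineticTheory.HeatConduction.pinnedChain
              ω₂ lam β γ).IsChainGibbsMeasure T μ₂ →
          (∀ ε : ℝ, 0 < ε → ∃ R : ℝ, ∀ x : ℤ,
            μ₂ {σ : Literature.MathematicalPhysics.KineticTheory.HeatConduction.ChainConfig |
                R < |(σ x).1|} ≤ ENNReal.ofReal ε) →
          μ₁ = μ₂ :=
  fun _ω₂ _lam _β γ hω hl hβ _hγ _T hT _μ₁ _μ₂ h₁ ht₁ h₂ ht₂ =>
    OscillatorChain.eq_of_isChainGibbsMeasure_of_tight_pinnedChain γ hω hl.le hβ.le hT h₁ h₂ ht₁ ht₂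

/-- **SEAM — `stub_witnessRegularisation`** (registered; the three-crux seam, verbatim): rev 6 — CLOSED MODULO SI
(`stub_witnessShiftInvariant`) by LANDED lemmas only: shift-invariant ⇒ one-site tight (`oneSiteTight_of_isShiftInvariant`,
W-SEAM p99264; also Literature `InfiniteChainTightRegular`) ⇒ regular (`tightRegular_of_tightUnique` + TU `stub_tightDLRUnique`;
equivalently Literature `OscillatorChain.isShiftInvariant_and_hasSuperstabilityEstimate_of_tight_pinnedChain`). -/
theorem stub_witnessRegularisation :
    ∀ ω₂ lam β γ : ℝ, 0 < ω₂ → 0 < lam → 0 < β → 0 < γ → ∀ T : ℝ, 0 < T → (∃ (μT : MeasureTheory.Measure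
      Literature.MathematicalPhysics.KineticTheory.HeatConduction.ChainConfig) (D' :
      Literature.MathematicalPhysics.KineticTheory.HeatConduction.InfiniteChainDynamics
      (Literature.MathematicalPhysics.KineticTheory.HeatConduction.pinnedChain ω₂ lam β γ)) (κ : ℝ),
      (Literature.MathematicalPhysics.KineticTheory.HeatConduction.pinnedChain ω₂ lam β
      γ).IsChainGibbsMeasure T μT ∧ D'.PreservesMeasure μT ∧ (∀ t : ℝ, D'.HasAbsConvergentCorrelation μT
      t) ∧ 0 < κ ∧ Filter.Tendsto (fun ν : ℝ => (T ^ 2)⁻¹ * MeasureTheory.integral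
      (MeasureTheory.volume.restrict (Set.Ioi (0:ℝ))) (fun t : ℝ => Real.exp (-(ν * t)) *
      D'.currentCorrelation μT t)) (nhdsWithin (0:ℝ) (Set.Ioi 0)) (nhds κ)) → ∃ (μT :
      MeasureTheory.Measure Literature.MathematicalPhysics.KineticTheory.HeatConduction.ChainConfig) (D'
      : Literature.MathematicalPhysics.KineticTheory.HeatConduction.InfiniteChainDynamics
      (Literature.MathematicalPhysics.KineticTheory.HeatConduction.pinnedChain ω₂ lam β γ)) (κ : ℝ),
      (Literature.MathematicalPhysics.KineticTheory.HeatConduction.pinnedChain ω₂ lam β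
      γ).IsChainGibbsMeasure T μT ∧
      Literature.MathematicalPhysics.KineticTheory.HeatConduction.IsShiftInvariant μT ∧
      (Literature.MathematicalPhysics.KineticTheory.HeatConduction.pinnedChain ω₂ lam β
      γ).HasSuperstabilityEstimate μT ∧ D'.PreservesMeasure μT ∧ (∀ t : ℝ,
      D'.HasAbsConvergentCorrelation μT t) ∧ 0 < κ ∧ Filter.Tendsto (fun ν : ℝ => (T ^ 2)⁻¹ *
      MeasureTheory.integral (MeasureTheory.volume.restrict (Set.Ioi (0:ℝ))) (fun t : ℝ => Real.exp (-(ν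
      * t)) * D'.currentCorrelation μT t)) (nhdsWithin (0:ℝ) (Set.Ioi 0)) (nhds κ)
 := by
  intro ω₂ lam β γ hω hl hβ hγ T hT hex
  obtain ⟨μT, D', κ, hG, hSI, hP, hAC, hκ, hlim⟩ :=
    stub_witnessShiftInvariant ω₂ lam β γ hω hl hβ hγ T hT hex
  haveI : IsProbabilityMeasure μT := hG.1
  have htight :=
    Summit.AtomisticToContinuum.FouriersLaw.Theorems.AbelThermodynamicLimit.SeriesLawAtEveryLaplaceFrequency.oneSiteTight_of_isShiftInvariant
      (μ := μT) hSI
  obtain ⟨_, hss⟩ :=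
    Summit.AtomisticToContinuum.FouriersLaw.Theorems.AbelThermodynamicLimit.SeriesLawAtEveryLaplaceFrequency.tightRegular_of_tightUnique
      γ hω hl.le hβ.le hT (stub_tightDLRUnique ω₂ lam β γ hω hl hβ hγ T hT) μT hG htight
  exact ⟨μT, D', κ, hG, hSI, hss, hP, hAC, hκ, hlim⟩

/-- **Stub POS — `stub_resolventFormPos`: the current resolvent form is positive** (size M, NEW, provable now).
For `P` (all `> 0`), `T > 0`, `N ≥ 2` and `ν > 0`: `0 < F_N(ν) = ∫₀^∞ e^{-νt} c_N(t) dt`. Route: `J = Σ_b j_b` is a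
nice observable (continuous, `|J| ≤ C e^{ϑH}` for any small `ϑ > 0`), centred (`∫ J dμ_{N,T} = 0`, momentum
reversal) and non-constant (`Var_{μ_{N,T}}(J) > 0` for `N ≥ 2`), so
`HonestZwanzig.pinnedChain_lap_self_pos` (`lap_s(u,u) > 0` whenever `Var(u) > 0`: the resolvent inequality
`⟨ũ, R_s ũ⟩ ≥ s‖R_s ũ‖² > 0`) applies with `u = J`, `s = ν`, and `lap_ν(J,J) = F_N(ν) − 0`. This is what makes
`R_N(ν)` a resistance and what forces `0 < D_N` in the composition. -/
theorem stub_resolventFormPos :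
    ∀ ω₂ lam β γ : ℝ, 0 < ω₂ → 0 < lam → 0 < β → 0 < γ → ∀ T : ℝ, 0 < T → ∀ N : ℕ, 2 ≤ N → ∀ ν : ℝ, 0 < ν →
    0 < MeasureTheory.integral (MeasureTheory.volume.restrict (Set.Ioi (0:ℝ))) (fun t : ℝ =>
        Real.exp (-(ν * t)) *
          ∫ z, (∑ i : Fin N, (Literature.MathematicalPhysics.KineticTheory.HeatConduction.pinnedChain ω₂ lam β γ).bondCurrent N i z) *
            (∫ y, (∑ i : Fin N, (Literature.MathematicalPhysics.KineticTheory.HeatConduction.pinnedChain ω₂ lam β γ).bondCurrent N i y) ∂((Literature.MathematicalPhysics.KineticTheory.HeatConduction.pinnedChain ω₂ lam β γ).transitionKernel N T T t.toNNReal z))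
            ∂((Literature.MathematicalPhysics.KineticTheory.HeatConduction.pinnedChain ω₂ lam β γ).gibbsMeasure N T)) := by
  intro ω₂ lam β γ hω hl hβ hγ T hT N hN ν hν
  exact Summit.AtomisticToContinuum.FouriersLaw.Theorems.AbelThermodynamicLimit.SeriesLawAtEveryLaplaceFrequency.stub_resolventFormPos
    ω₂ lam β γ hω hl hβ hγ T hT N hN ν hν

/-- **Stub S7 — `stub_regularDLRUnique`: DLR UNIQUENESS IN THE REGULAR CLASS** (size L; printed, NOT in tree;
VERBATIM the registered stub of the sibling cruxes `GreenKuboContinuation` / `EmbeddedDrudeMourre.AbelThermodynamicLimit`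
(loomis S7) — shared, lands once for all). For `P` (all `> 0`) and every `T > 0`, any two DLR Gibbs states of `P` at
`T` that are shift-invariant and satisfy BM's superstability estimate coincide. Route: momenta are i.i.d. `N(0,T)`
under any DLR state, so this is uniqueness of the shift-invariant state of the 1-D nearest-neighbour unbounded-spin
position chain with the strictly positive Hilbert–Schmidt transfer kernel `e^{-U(a)/2T}e^{-V(b-a)/T}e^{-U(b)/2T}`
(simple Perron–Frobenius eigenvalue); alternatively uniform convexity `U'' ≥ ω₂`, `V'' ≥ 1`. Sources: Dobrushin
1974, Cassandro–Olivieri–Pellegrinotti–Presutti 1978. Feeds the inline uniqueness hypothesis of S3. -/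
theorem stub_regularDLRUnique :
    ∀ ω₂ lam β γ : ℝ, 0 < ω₂ → 0 < lam → 0 < β → 0 < γ →
      ∀ T : ℝ, 0 < T →
        ∀ μ₁ μ₂ : MeasureTheory.Measure
            Literature.MathematicalPhysics.KineticTheory.HeatConduction.ChainConfig,
          (Literature.MathematicalPhysics.KineticTheory.HeatConduction.pinnedChain
                ω₂ lam β γ).IsChainGibbsMeasure T μ₁ →
          Literature.MathematicalPhysics.KineticTheory.HeatConduction.IsShiftInvariant μ₁ →
          (Literature.MathematicalPhysics.KineticTheory.HeatConduction.pinnedChain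
                ω₂ lam β γ).HasSuperstabilityEstimate μ₁ →
          (Literature.MathematicalPhysics.KineticTheory.HeatConduction.pinnedChain
                ω₂ lam β γ).IsChainGibbsMeasure T μ₂ →
          Literature.MathematicalPhysics.KineticTheory.HeatConduction.IsShiftInvariant μ₂ →
          (Literature.MathematicalPhysics.KineticTheory.HeatConduction.pinnedChain
                ω₂ lam β γ).HasSuperstabilityEstimate μ₂ → μ₁ = μ₂ := by
  intro ω₂ lam β γ hω hl hβ hγ T hT μ₁ μ₂ hG₁ _hS₁ hss₁ hG₂ _hS₂ hss₂
  exact stub_tightDLRUnique ω₂ lam β γ hω hl hβ hγ T hT μ₁ μ₂ hG₁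
    (Summit.AtomisticToContinuum.FouriersLaw.Theorems.AbelThermodynamicLimit.LoomisCompactHorizonWitness.oneSiteTight_of_hasSuperstabilityEstimate
      γ hω hl.le hβ.le hss₁)
    hG₂
    (Summit.AtomisticToContinuum.FouriersLaw.Theorems.AbelThermodynamicLimit.LoomisCompactHorizonWitness.oneSiteTight_of_hasSuperstabilityEstimate
      γ hω hl.le hβ.le hss₂)


/-! ## The composition (kernel-checked, no `sorry` outside the stubs) -/

/-- **UPPER HALF (`NoOvershoot`) from the conductance-side sign law QS ALONE** (rev 8b, lead c1; the kernel-checked reduction behind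
the strategist's D2 child `NoOvershoot`). At a REGULAR witness `(μT, D, κ)`, for every steady family and response sequence: IF QS holds at
this parameter point (hypothesis `hQS`, the conclusion of `stub_quasiSuperadditivity`) THEN `∀ ε > 0, ∃ N₃, ∀ N ≥ N₃, Dn N ≤ κ + ε`. Uses only
LANDED facts besides `hQS`: (K), S3 (now a theorem), the witness's Abel limit, dyadic Fekete (`fekete_pow_abel_upper`) and
`tendsto_upper_envelope'`. Neither positivity of `Dn` nor `0 < κ` is needed. -/
theorem noOvershoot_of_QS {ω₂ lam β γ : ℝ} (hω : 0 < ω₂) (hl : 0 < lam) (hβ : 0 < β) (hγ : 0 < γ)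
    (hU : ∀ (N : ℕ) (T_L T_R : ℝ), 0 < T_L → 0 < T_R → ∀ μ ν : Measure (PhaseSpace N),
      (pinnedChain ω₂ lam β γ).IsSteadyState N T_L T_R μ → (pinnedChain ω₂ lam β γ).IsSteadyState N T_L T_R ν → μ = ν)
    {T : ℝ} (hT : 0 < T) {μT : Measure ChainConfig} {D : InfiniteChainDynamics (pinnedChain ω₂ lam β γ)} {κ : ℝ}
    (hG : (pinnedChain ω₂ lam β γ).IsChainGibbsMeasure T μT) (hS : IsShiftInvariant μT)
    (hss : (pinnedChain ω₂ lam β γ).HasSuperstabilityEstimate μT) (hcar : D.carrier ⊆ (pinnedChain ω₂ lam β γ).bmGood)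
    (hP : D.PreservesMeasure μT) (hAC : ∀ t : ℝ, D.HasAbsConvergentCorrelation μT t)
    (hAbel : Tendsto (fun ν : ℝ => (T ^ 2)⁻¹ *
      ∫ t in Ioi (0 : ℝ), Real.exp (-(ν * t)) * D.currentCorrelation μT t) (𝓝[>] 0) (𝓝 κ))
    (hQS : ∃ C θ ν₀ : ℝ, ∃ N₀ : ℕ, 0 ≤ C ∧ θ < 1 ∧ 0 < ν₀ ∧ ∀ ν : ℝ, 0 < ν → ν ≤ ν₀ → ∀ N : ℕ, N₀ ≤ N →
      2 * FN ω₂ lam β γ T N ν - C * ((2 * N : ℕ) : ℝ) ^ θ ≤ FN ω₂ lam β γ T (2 * N) ν)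
    (μ : (N : ℕ) → ℝ → ℝ → Measure (PhaseSpace N))
    (hμ : ∀ (N : ℕ) (T_L T_R : ℝ), 0 < T_L → 0 < T_R → (pinnedChain ω₂ lam β γ).IsSteadyState N T_L T_R (μ N T_L T_R))
    (Dn : ℕ → ℝ)
    (hD : ∀ N : ℕ, Tendsto (fun δ : ℝ => (pinnedChain ω₂ lam β γ).totalCurrent (μ N (T + δ / 2) (T - δ / 2)) / δ)
      (𝓝[≠] 0) (𝓝 (Dn N))) :
    ∀ ε : ℝ, 0 < ε → ∃ N₃ : ℕ, ∀ N : ℕ, N₃ ≤ N → Dn N ≤ κ + ε := by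
  obtain ⟨C₁, θ₁, ν₁, N₁, hC₁, hθ₁, hν₁, hqs⟩ := hQS
  set N₀ : ℕ := max N₁ 2 with hN₀def
  have hN₀2 : 2 ≤ N₀ := le_max_right _ _
  have hN₀1 : 1 ≤ N₀ := le_trans one_le_two hN₀2
  have hN₁le : N₁ ≤ N₀ := le_max_left _ _
  have hmatch := stub_fixedFrequencyMatching ω₂ lam β γ hω hl hβ hγ T hT
    (stub_regularDLRUnique ω₂ lam β γ hω hl hβ hγ T hT) μT D hG hS hss hcar hP hAC
  -- (K), LANDED
  have hK' : ∀ N : ℕ, IntegrableOn (cN ω₂ lam β γ T N) (Ioi 0) ∧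
      ((N : ℝ) - 1) * T ^ 2 * Dn N = ∫ t in Ioi (0 : ℝ), cN ω₂ lam β γ T N t :=
    fun N => Summit.AtomisticToContinuum.FouriersLaw.Theorems.StaticAbelianSqueeze.kuboAbelIdentity_holds
      ω₂ lam β γ hω hl hβ hγ hU μ hμ T hT N (Dn N) (hD N)
  have hDC : ∀ N : ℕ, Tendsto (FN ω₂ lam β γ T N) (𝓝[>] 0) (𝓝 (((N : ℝ) - 1) * T ^ 2 * Dn N)) := by
    intro N
    rw [(hK' N).2]
    exact Summit.AtomisticToContinuum.FouriersLaw.Theorems.AbelThermodynamicLimit.SeriesLawAtEveryLaplaceFrequency.tendsto_laplace_zero (hK' N).1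
  set Ahat : ℝ → ℝ := fun ν => ∫ t in Ioi (0 : ℝ), Real.exp (-(ν * t)) * D.currentCorrelation μT t
    with hAhat
  have hT2 : (T ^ 2) ≠ 0 := by positivity
  have hT2pos : (0 : ℝ) < T ^ 2 := by positivity
  have hA : Tendsto Ahat (𝓝[>] 0) (𝓝 (T ^ 2 * κ)) := by
    have h := hAbel.const_mul (T ^ 2)
    refine h.congr' (Eventually.of_forall fun ν => ?_)
    simp only [hAhat]
    rw [← mul_assoc, mul_inv_cancel₀ hT2, one_mul]
  set K₁ : ℝ := C₁ * ((2:ℝ) ^ (θ₁ - 1) / (1 - (2:ℝ) ^ (θ₁ - 1))) with hK₁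
  -- UPPER envelope: dyadic Fekete at every Laplace frequency on the conductance form (QS)
  have hup : ∀ N : ℕ, N₀ ≤ N → ((N : ℝ) - 1) * T ^ 2 * Dn N ≤ N * (T ^ 2 * κ) + K₁ * (N : ℝ) ^ θ₁ :=
    Summit.AtomisticToContinuum.FouriersLaw.Theorems.AbelThermodynamicLimit.SeriesLawAtEveryLaplaceFrequency.fekete_pow_abel_upper (FN ω₂ lam β γ T) (fun N => ((N : ℝ) - 1) * T ^ 2 * Dn N)
      Ahat C₁ θ₁ (T ^ 2 * κ) ν₁ N₀ hN₀1 hC₁ hθ₁ hν₁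
      (fun ν hν N hN => hqs ν hν.1 hν.2 N (le_trans hN₁le hN))
      (fun ν hν => hmatch ν hν.1)
      hA (fun N _ => hDC N)
  -- divide by `T²` and by `N − 1`: `Dn N ≤ (Nκ + (K₁/T²)N^θ₁)/(N−1) → κ`
  have henv := Summit.AtomisticToContinuum.FouriersLaw.Theorems.AbelThermodynamicLimit.SeriesLawAtEveryLaplaceFrequency.tendsto_upper_envelope' κ
    (fun N => K₁ / T ^ 2 * (N : ℝ) ^ θ₁)
    (Summit.AtomisticToContinuum.FouriersLaw.Theorems.AbelThermodynamicLimit.SeriesLawAtEveryLaplaceFrequency.tendsto_const_mul_rpow_div (K₁ / T ^ 2) θ₁ hθ₁)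
  intro ε hε
  have hev : ∀ᶠ N : ℕ in atTop, ((N : ℝ) * κ + K₁ / T ^ 2 * (N : ℝ) ^ θ₁) / ((N : ℝ) - 1) < κ + ε :=
    henv (Iio_mem_nhds (by linarith))
  obtain ⟨N₄, hN₄⟩ := (hev.and (eventually_ge_atTop N₀)).exists_forall_of_atTop
  refine ⟨N₄, fun N hN => ?_⟩
  obtain ⟨hlt, hN0⟩ := hN₄ N hN
  have h := hup N hN0
  have hN2 : (2 : ℝ) ≤ N := by exact_mod_cast (le_trans hN₀2 hN0)
  have hN1 : (0 : ℝ) < (N : ℝ) - 1 := by linarith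
  have e1 : ((N : ℝ) - 1) * T ^ 2 * Dn N = T ^ 2 * (((N : ℝ) - 1) * Dn N) := by ring
  have e2 : (N : ℝ) * (T ^ 2 * κ) + K₁ * (N : ℝ) ^ θ₁ = T ^ 2 * ((N : ℝ) * κ + K₁ / T ^ 2 * (N : ℝ) ^ θ₁) := by
    field_simp
  rw [e1, e2] at h
  have h' : ((N : ℝ) - 1) * Dn N ≤ (N : ℝ) * κ + K₁ / T ^ 2 * (N : ℝ) ^ θ₁ := le_of_mul_le_mul_left h hT2pos
  have h'' : Dn N ≤ ((N : ℝ) * κ + K₁ / T ^ 2 * (N : ℝ) ^ θ₁) / ((N : ℝ) - 1) := by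
    rw [le_div_iff₀ hN1, mul_comm]
    exact h'
  exact h''.trans hlt.le

/-- **LOWER HALF (`NoDeficit`) from the resistance-side sign law QSR ALONE** (rev 8b, lead c1; the kernel-checked reduction behind the
strategist's D2 child `NoDeficit`). At a REGULAR witness, for every steady family and response sequence: IF QSR holds at this parameter
point (hypothesis `hQSR`, the conclusion of `stub_quasiSuperadditiveResistance`) THEN `∀ ε > 0, ∃ N₃, ∀ N ≥ N₃, κ − ε ≤ Dn N` (and
`0 < Dn N`). Uses only LANDED facts besides `hQSR`: (K), S3, POS `stub_resolventFormPos`, `0 ≤ D_N` (`response_nonneg_of_correctorTheory`),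
dyadic Fekete, `dc_of_resistance_bound`, `conductance_lower_of_resistance'`, `tendsto_lower_envelope'`. -/
theorem noDeficit_of_QSR {ω₂ lam β γ : ℝ} (hω : 0 < ω₂) (hl : 0 < lam) (hβ : 0 < β) (hγ : 0 < γ)
    (hU : ∀ (N : ℕ) (T_L T_R : ℝ), 0 < T_L → 0 < T_R → ∀ μ ν : Measure (PhaseSpace N),
      (pinnedChain ω₂ lam β γ).IsSteadyState N T_L T_R μ → (pinnedChain ω₂ lam β γ).IsSteadyState N T_L T_R ν → μ = ν)
    {T : ℝ} (hT : 0 < T) {μT : Measure ChainConfig} {D : InfiniteChainDynamics (pinnedChain ω₂ lam β γ)} {κ : ℝ}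
    (hG : (pinnedChain ω₂ lam β γ).IsChainGibbsMeasure T μT) (hS : IsShiftInvariant μT)
    (hss : (pinnedChain ω₂ lam β γ).HasSuperstabilityEstimate μT) (hcar : D.carrier ⊆ (pinnedChain ω₂ lam β γ).bmGood)
    (hP : D.PreservesMeasure μT) (hAC : ∀ t : ℝ, D.HasAbsConvergentCorrelation μT t) (hκ : 0 < κ)
    (hAbel : Tendsto (fun ν : ℝ => (T ^ 2)⁻¹ *
      ∫ t in Ioi (0 : ℝ), Real.exp (-(ν * t)) * D.currentCorrelation μT t) (𝓝[>] 0) (𝓝 κ))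
    (hQSR : ∃ C θ ν₀ : ℝ, ∃ N₀ : ℕ, 0 ≤ C ∧ θ < 1 ∧ 0 < ν₀ ∧ ∀ ν : ℝ, 0 < ν → ν ≤ ν₀ → ∀ N : ℕ, N₀ ≤ N →
      2 * RN ω₂ lam β γ T N ν - C * ((2 * N : ℕ) : ℝ) ^ θ ≤ RN ω₂ lam β γ T (2 * N) ν)
    (μ : (N : ℕ) → ℝ → ℝ → Measure (PhaseSpace N))
    (hμ : ∀ (N : ℕ) (T_L T_R : ℝ), 0 < T_L → 0 < T_R → (pinnedChain ω₂ lam β γ).IsSteadyState N T_L T_R (μ N T_L T_R))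
    (Dn : ℕ → ℝ)
    (hD : ∀ N : ℕ, Tendsto (fun δ : ℝ => (pinnedChain ω₂ lam β γ).totalCurrent (μ N (T + δ / 2) (T - δ / 2)) / δ)
      (𝓝[≠] 0) (𝓝 (Dn N))) :
    ∀ ε : ℝ, 0 < ε → ∃ N₃ : ℕ, ∀ N : ℕ, N₃ ≤ N → 0 < Dn N ∧ κ - ε ≤ Dn N := by
  obtain ⟨C₂, θ₂, ν₂, N₂, hC₂, hθ₂, hν₂, hqsr⟩ := hQSR
  set N₀ : ℕ := max N₂ 2 with hN₀def
  have hN₀2 : 2 ≤ N₀ := le_max_right _ _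
  have hN₀1 : 1 ≤ N₀ := le_trans one_le_two hN₀2
  have hN₂le : N₂ ≤ N₀ := le_max_left _ _
  have hmatch := stub_fixedFrequencyMatching ω₂ lam β γ hω hl hβ hγ T hT
    (stub_regularDLRUnique ω₂ lam β γ hω hl hβ hγ T hT) μT D hG hS hss hcar hP hAC
  have hFpos : ∀ N : ℕ, 2 ≤ N → ∀ ν : ℝ, 0 < ν → 0 < FN ω₂ lam β γ T N ν :=
    fun N hN ν hν => stub_resolventFormPos ω₂ lam β γ hω hl hβ hγ T hT N hN ν hν
  have hK' : ∀ N : ℕ, IntegrableOn (cN ω₂ lam β γ T N) (Ioi 0) ∧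
      ((N : ℝ) - 1) * T ^ 2 * Dn N = ∫ t in Ioi (0 : ℝ), cN ω₂ lam β γ T N t :=
    fun N => Summit.AtomisticToContinuum.FouriersLaw.Theorems.StaticAbelianSqueeze.kuboAbelIdentity_holds
      ω₂ lam β γ hω hl hβ hγ hU μ hμ T hT N (Dn N) (hD N)
  have hDC : ∀ N : ℕ, Tendsto (FN ω₂ lam β γ T N) (𝓝[>] 0) (𝓝 (((N : ℝ) - 1) * T ^ 2 * Dn N)) := by
    intro N
    rw [(hK' N).2]
    exact Summit.AtomisticToContinuum.FouriersLaw.Theorems.AbelThermodynamicLimit.SeriesLawAtEveryLaplaceFrequency.tendsto_laplace_zero (hK' N).1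
  have hDnonneg : ∀ N : ℕ, 0 ≤ Dn N := fun N =>
    Summit.AtomisticToContinuum.FouriersLaw.Theorems.response_nonneg_of_correctorTheory
      Summit.AtomisticToContinuum.FouriersLaw.Theorems.OddSectorIrreversibility.Corrector.CorrectorTheory_proof
      hω hl hβ hγ hU μ hμ hT N (hD N)
  set Ahat : ℝ → ℝ := fun ν => ∫ t in Ioi (0 : ℝ), Real.exp (-(ν * t)) * D.currentCorrelation μT t
    with hAhat
  have hT2 : (T ^ 2) ≠ 0 := by positivity
  have hL : 0 < T ^ 2 * κ := by positivity
  have hA : Tendsto Ahat (𝓝[>] 0) (𝓝 (T ^ 2 * κ)) := by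
    have h := hAbel.const_mul (T ^ 2)
    refine h.congr' (Eventually.of_forall fun ν => ?_)
    simp only [hAhat]
    rw [← mul_assoc, mul_inv_cancel₀ hT2, one_mul]
  set K₂ : ℝ := C₂ * ((2:ℝ) ^ (θ₂ - 1) / (1 - (2:ℝ) ^ (θ₂ - 1))) with hK₂
  have hK₂0 : 0 ≤ K₂ := mul_nonneg hC₂ (Summit.AtomisticToContinuum.FouriersLaw.Theorems.AbelThermodynamicLimit.SeriesLawAtEveryLaplaceFrequency.dyadic_const_pos hθ₂).le
  -- a frequency window on which `Â(ν) > T²κ/2 > 0`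
  obtain ⟨ν₄, hν₄, hAwin⟩ : ∃ ν₄ : ℝ, 0 < ν₄ ∧ ∀ ν ∈ Ioc (0:ℝ) ν₄, T ^ 2 * κ / 2 < Ahat ν := by
    have hev : ∀ᶠ ν in 𝓝[>] (0 : ℝ), T ^ 2 * κ / 2 < Ahat ν :=
      hA.eventually (lt_mem_nhds (by linarith))
    obtain ⟨u, hu, hsub⟩ := mem_nhdsGT_iff_exists_Ioc_subset.1 hev
    exact ⟨u, hu, fun ν hν => hsub hν⟩
  -- dyadic Fekete at fixed `ν` on the RESISTANCE form (QSR)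
  set ν₀ : ℝ := min ν₂ ν₄ with hν₀def
  have hν₀ : 0 < ν₀ := lt_min hν₂ hν₄
  have hρlim : ∀ ν ∈ Ioc (0 : ℝ) ν₀,
      Tendsto (fun N : ℕ => RN ω₂ lam β γ T N ν / N) atTop (𝓝 (T ^ 2 / Ahat ν)) := by
    intro ν hν
    have hν4 : ν ∈ Ioc (0:ℝ) ν₄ := ⟨hν.1, le_trans hν.2 (min_le_right _ _)⟩
    have hApos : 0 < Ahat ν := lt_trans (by positivity) (hAwin ν hν4)
    exact Summit.AtomisticToContinuum.FouriersLaw.Theorems.AbelThermodynamicLimit.SeriesLawAtEveryLaplaceFrequency.tendsto_resistance_div (fun N => FN ω₂ lam β γ T N ν) T (Ahat ν) hApos.ne'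
      (hmatch ν hν.1)
  have hkey : ∀ ν ∈ Ioc (0 : ℝ) ν₀, ∀ N : ℕ, N₀ ≤ N →
      RN ω₂ lam β γ T N ν ≤ N * (T ^ 2 / Ahat ν) + K₂ * (N : ℝ) ^ θ₂ :=
    fun ν hν N hN => stub_dyadicFeketePow (fun M => RN ω₂ lam β γ T M ν) (T ^ 2 / Ahat ν) C₂ θ₂ N₀ hN₀1
      hC₂ hθ₂ (fun M hM => hqsr ν hν.1 (le_trans hν.2 (min_le_left _ _)) M (le_trans hN₂le hM))
      (hρlim ν hν) N hN
  -- `ν ↓ 0` at fixed `N`; positivity of `D_N` is forced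
  have hρ0 : Tendsto (fun ν => T ^ 2 / Ahat ν) (𝓝[>] 0) (𝓝 (T ^ 2 / (T ^ 2 * κ))) :=
    tendsto_const_nhds.div hA hL.ne'
  have hTκ : T ^ 2 / (T ^ 2 * κ) = κ⁻¹ := by
    field_simp
  have hlowpos : ∀ N : ℕ, N₀ ≤ N → 0 < Dn N ∧ ((N : ℝ) - 1) / Dn N ≤ N * κ⁻¹ + K₂ * (N : ℝ) ^ θ₂ := by
    intro N hN
    have hN2' : 2 ≤ N := le_trans hN₀2 hN
    have hN2 : (2 : ℝ) ≤ N := by exact_mod_cast hN2'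
    have hN1 : (0 : ℝ) < (N : ℝ) - 1 := by linarith
    have ha : 0 < ((N : ℝ) - 1) ^ 2 * T ^ 2 := by positivity
    have hb : Tendsto (fun ν => (N : ℝ) * (T ^ 2 / Ahat ν) + K₂ * (N : ℝ) ^ θ₂) (𝓝[>] 0)
        (𝓝 ((N : ℝ) * κ⁻¹ + K₂ * (N : ℝ) ^ θ₂)) := by
      have := (hρ0.const_mul (N : ℝ)).add_const (K₂ * (N : ℝ) ^ θ₂)
      rwa [hTκ] at this
    have hF0 : 0 ≤ ((N : ℝ) - 1) * T ^ 2 * Dn N := by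
      have := hDnonneg N
      positivity
    obtain ⟨hF0pos, hle⟩ := Summit.AtomisticToContinuum.FouriersLaw.Theorems.AbelThermodynamicLimit.SeriesLawAtEveryLaplaceFrequency.dc_of_resistance_bound (FN ω₂ lam β γ T N)
      (fun ν => (N : ℝ) * (T ^ 2 / Ahat ν) + K₂ * (N : ℝ) ^ θ₂) (((N : ℝ) - 1) ^ 2 * T ^ 2)
      (((N : ℝ) - 1) * T ^ 2 * Dn N) ((N : ℝ) * κ⁻¹ + K₂ * (N : ℝ) ^ θ₂) ν₀ ha hν₀
      (fun ν hν => hFpos N hN2' ν hν.1) (hDC N) hF0 (fun ν hν => hkey ν hν N hN) hb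
    have hDpos : 0 < Dn N := by
      refine lt_of_not_ge fun hcon => ?_
      have h1 : ((N : ℝ) - 1) * T ^ 2 * Dn N ≤ 0 :=
        mul_nonpos_of_nonneg_of_nonpos (by positivity) hcon
      linarith
    refine ⟨hDpos, ?_⟩
    have e : ((N : ℝ) - 1) ^ 2 * T ^ 2 / (((N : ℝ) - 1) * T ^ 2 * Dn N) = ((N : ℝ) - 1) / Dn N := by
      field_simp
    rwa [e] at hle
  -- the lower envelope `κ(N−1)/(N + κK₂N^θ₂) ≤ Dn N`, and it tends to `κ`
  have hlo := Summit.AtomisticToContinuum.FouriersLaw.Theorems.AbelThermodynamicLimit.SeriesLawAtEveryLaplaceFrequency.conductance_lower_of_resistance' Dn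
    (fun N => K₂ * (N : ℝ) ^ θ₂) κ N₀ hN₀2 hκ (fun N => mul_nonneg hK₂0 (Real.rpow_nonneg (Nat.cast_nonneg N) θ₂))
    (fun N hN => (hlowpos N hN).1) (fun N hN => (hlowpos N hN).2)
  have henv := Summit.AtomisticToContinuum.FouriersLaw.Theorems.AbelThermodynamicLimit.SeriesLawAtEveryLaplaceFrequency.tendsto_lower_envelope' κ
    (fun N => K₂ * (N : ℝ) ^ θ₂)
    (Summit.AtomisticToContinuum.FouriersLaw.Theorems.AbelThermodynamicLimit.SeriesLawAtEveryLaplaceFrequency.tendsto_const_mul_rpow_div K₂ θ₂ hθ₂)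
  intro ε hε
  have hev : ∀ᶠ N : ℕ in atTop, κ - ε < κ * (((N : ℝ) - 1) / ((N : ℝ) + κ * (K₂ * (N : ℝ) ^ θ₂))) :=
    henv (Ioi_mem_nhds (by linarith))
  obtain ⟨N₄, hN₄⟩ := (hev.and (eventually_ge_atTop N₀)).exists_forall_of_atTop
  refine ⟨N₄, fun N hN => ?_⟩
  obtain ⟨hlt, hN0⟩ := hN₄ N hN
  exact ⟨(hlowpos N hN0).1, (hlt.le.trans (hlo N hN0))⟩

/-- **Core of the composition (no seam): at a REGULAR witness the two sign laws give `Dn → κ`** — rev 8b: the `ε/2`-squeeze of the two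
halves `noOvershoot_of_QS` (QS only) and `noDeficit_of_QSR` (QSR only). For `P` (all `> 0`),
weak-NESS uniqueness `hU`, `T > 0`, a regular witness `(μT, D, κ)` (DLR + shift-invariant + BM-superstable state,
`D.carrier ⊆ bmGood`, `μT`-preserving, absolutely convergent correlations, Abel limit `κ > 0`), every steady family `μ` and
every response sequence `Dn`: `Dn → κ`. Proof: (K) gives `c_N ∈ L¹` and `∫₀^∞ c_N = (N−1)T²Dn N`, hence
`F_N(ν) → (N−1)T²Dn N` (`ν ↓ 0`); QS + S3 + the witness's Abel limit give the upper envelope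
`(N−1)T²Dn N ≤ N·T²κ + K₁N^θ₁` (`fekete_pow_abel_upper`); QSR + S3 bound `R_N(ν) ≤ N·T²/Â(ν) + K₂N^θ₂` on a window
`(0, ν₀]` where `Â > T²κ/2`; with POS and `0 ≤ Dn N` this forces `0 < Dn N` and `(N−1)/Dn N ≤ N/κ + K₂N^θ₂`
(`dc_of_resistance_bound`); the envelopes squeeze (`stub_twoSignLawsTendsto`). -/
theorem tlconv_of_regularWitness {ω₂ lam β γ : ℝ} (hω : 0 < ω₂) (hl : 0 < lam) (hβ : 0 < β) (hγ : 0 < γ)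
    (hU : ∀ (N : ℕ) (T_L T_R : ℝ), 0 < T_L → 0 < T_R → ∀ μ ν : Measure (PhaseSpace N),
      (pinnedChain ω₂ lam β γ).IsSteadyState N T_L T_R μ → (pinnedChain ω₂ lam β γ).IsSteadyState N T_L T_R ν → μ = ν)
    {T : ℝ} (hT : 0 < T) {μT : Measure ChainConfig} {D : InfiniteChainDynamics (pinnedChain ω₂ lam β γ)} {κ : ℝ}
    (hG : (pinnedChain ω₂ lam β γ).IsChainGibbsMeasure T μT) (hS : IsShiftInvariant μT)
    (hss : (pinnedChain ω₂ lam β γ).HasSuperstabilityEstimate μT) (hcar : D.carrier ⊆ (pinnedChain ω₂ lam β γ).bmGood)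
    (hP : D.PreservesMeasure μT) (hAC : ∀ t : ℝ, D.HasAbsConvergentCorrelation μT t) (hκ : 0 < κ)
    (hAbel : Tendsto (fun ν : ℝ => (T ^ 2)⁻¹ *
      ∫ t in Ioi (0 : ℝ), Real.exp (-(ν * t)) * D.currentCorrelation μT t) (𝓝[>] 0) (𝓝 κ))
    (μ : (N : ℕ) → ℝ → ℝ → Measure (PhaseSpace N))
    (hμ : ∀ (N : ℕ) (T_L T_R : ℝ), 0 < T_L → 0 < T_R → (pinnedChain ω₂ lam β γ).IsSteadyState N T_L T_R (μ N T_L T_R))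
    (Dn : ℕ → ℝ)
    (hD : ∀ N : ℕ, Tendsto (fun δ : ℝ => (pinnedChain ω₂ lam β γ).totalCurrent (μ N (T + δ / 2) (T - δ / 2)) / δ)
      (𝓝[≠] 0) (𝓝 (Dn N))) :
    Tendsto Dn atTop (𝓝 κ) := by
  have hup := noOvershoot_of_QS hω hl hβ hγ hU hT hG hS hss hcar hP hAC hAbel
    (stub_quasiSuperadditivity ω₂ lam β γ hω hl hβ hγ T hT) μ hμ Dn hD
  have hlo := noDeficit_of_QSR hω hl hβ hγ hU hT hG hS hss hcar hP hAC hκ hAbel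
    (stub_quasiSuperadditiveResistance ω₂ lam β γ hω hl hβ hγ T hT) μ hμ Dn hD
  rw [Metric.tendsto_atTop]
  intro ε hε
  obtain ⟨N₅, h5⟩ := hup (ε / 2) (by positivity)
  obtain ⟨N₆, h6⟩ := hlo (ε / 2) (by positivity)
  refine ⟨max N₅ N₆, fun N hN => ?_⟩
  have a := h5 N (le_trans (le_max_left _ _) hN)
  have b := (h6 N (le_trans (le_max_right _ _) hN)).2
  rw [Real.dist_eq, abs_lt]
  constructor <;> linarith

/-- **Skeleton theorem: the five stubs (+ the landed (K) and `0 ≤ D_N`) prove the crux BY NAME.** Proof: regularise the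
witness through the seam (SI + landed lemmas), OUTPUT the regular witness, and apply `tlconv_of_regularWitness`. Formerly inlined:
regularise the witness (SEAM) and OUTPUT it; (K) gives `c_N ∈ L¹` and `∫₀^∞ c_N = (N−1)T²Dn N`, hence
`F_N(ν) → (N−1)T²Dn N` (`ν ↓ 0`, dominated convergence); QS + S3 + the witness's Abel limit give the upper
envelope `(N−1)T²Dn N ≤ N·T²κ + C₁` (`fekete_abel_upper`); QSR + S3 give `R_N(ν) ≤ N·T²/Â(ν) + C₂` on a window
`(0, ν₀]` where `Â > T²κ/2` (`fekete_fixed_nu`); with POS and `0 ≤ Dn N` this forces `0 < Dn N` and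
`(N−1)/Dn N ≤ N/κ + C₂` (`dc_of_resistance_bound`); the envelopes squeeze (`two_sign_laws_tendsto`). -/
theorem AbelThermodynamicLimit_of :
    Summit.AtomisticToContinuum.FouriersLaw.Theses.LatticeLandauDamping.AbelThermodynamicLimit := by
  intro ω₂ lam β γ hω hl hβ hγ hU T hT hex
  -- SEAM: WLOG shift-invariant (stub SI); the LANDED seam lemmas then give a regular witness with
  -- `D.carrier ⊆ bmGood`, which is the witness we OUTPUT
  obtain ⟨μ₁, D₁, κ₁, hG₁, hS₁, hss₁, hP₁, hAC₁, hκ₁, hlim₁⟩ :=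
    stub_witnessRegularisation ω₂ lam β γ hω hl hβ hγ T hT hex
  have horb : ∀ᵐ σ ∂μ₁, ∀ t : ℝ, D₁.flow t σ ∈ (pinnedChain ω₂ lam β γ).bmGood :=
    OscillatorChain.ae_forall_flow_mem_bmGood_pinnedChain γ hω.le hl hβ hss₁ D₁ hP₁
  obtain ⟨μT, D, κ, hG, hS, hss, hcar, hP, hAC, hκ, hAbel⟩ :=
    Summit.AtomisticToContinuum.FouriersLaw.Theorems.GreenKuboContinuation.TemperatureBlindVitaliHurwitz.regularWitness_of_regularState_of_aeOrbits
      D₁ hG₁ hP₁ hAC₁ hκ₁ hlim₁ hS₁ hss₁ horb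
  refine ⟨μT, D, κ, ⟨hG, hP, hAC, hκ, hAbel⟩, ?_⟩
  intro μ hμ Dn hD
  exact tlconv_of_regularWitness hω hl hβ hγ hU hT hG hS hss hcar hP hAC hκ hAbel μ hμ Dn hD

/-- **The PLANNER-REPAIRED crux is closed modulo the four genuine stubs QS, QSR, (C′), (B′) — no seam.** The repair every
seat has recommended: the witness clause of the HYPOTHESIS carries shift-invariance of the state (`IsShiftInvariant μT`,
as the route's `WindowDecomposition` / `NoDrudeWeight` / `PositiveDensity` already quantify); the conclusion is the crux's,
verbatim. Proof: shift-invariant ⇒ one-site tight ⇒ regular (landed), then `regularWitness_of_regularState_of_aeOrbits`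
and `tlconv_of_regularWitness`; the stub SI is NOT used (check: this theorem's sorry-cone is exactly {QS, QSR, C′, B′}). -/
theorem AbelThermodynamicLimit_of_shiftInvariantWitness :
    ∀ ω₂ lam β γ : ℝ, 0 < ω₂ → 0 < lam → 0 < β → 0 < γ →
      (∀ (N : ℕ) (T_L T_R : ℝ), 0 < T_L → 0 < T_R → ∀ μ ν : Measure (PhaseSpace N),
        (pinnedChain ω₂ lam β γ).IsSteadyState N T_L T_R μ →
        (pinnedChain ω₂ lam β γ).IsSteadyState N T_L T_R ν → μ = ν) →
      ∀ T : ℝ, 0 < T →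
        (∃ (μT : Measure ChainConfig) (D : InfiniteChainDynamics (pinnedChain ω₂ lam β γ)) (κ : ℝ),
          (pinnedChain ω₂ lam β γ).IsChainGibbsMeasure T μT ∧ IsShiftInvariant μT ∧ D.PreservesMeasure μT ∧
          (∀ t : ℝ, D.HasAbsConvergentCorrelation μT t) ∧ 0 < κ ∧
          Tendsto (fun ν : ℝ => (T ^ 2)⁻¹ *
            ∫ t in Ioi (0 : ℝ), Real.exp (-(ν * t)) * D.currentCorrelation μT t) (𝓝[>] 0) (𝓝 κ)) →
        ∃ (μT : Measure ChainConfig) (D : InfiniteChainDynamics (pinnedChain ω₂ lam β γ)) (κ : ℝ),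
          ((pinnedChain ω₂ lam β γ).IsChainGibbsMeasure T μT ∧ D.PreservesMeasure μT ∧
            (∀ t : ℝ, D.HasAbsConvergentCorrelation μT t) ∧ 0 < κ ∧
            Tendsto (fun ν : ℝ => (T ^ 2)⁻¹ *
              ∫ t in Ioi (0 : ℝ), Real.exp (-(ν * t)) * D.currentCorrelation μT t) (𝓝[>] 0) (𝓝 κ)) ∧
          ∀ μ : (N : ℕ) → ℝ → ℝ → Measure (PhaseSpace N),
            (∀ (N : ℕ) (T_L T_R : ℝ), 0 < T_L → 0 < T_R →
              (pinnedChain ω₂ lam β γ).IsSteadyState N T_L T_R (μ N T_L T_R)) →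
            ∀ Dn : ℕ → ℝ,
              (∀ N : ℕ, Tendsto (fun δ : ℝ =>
                (pinnedChain ω₂ lam β γ).totalCurrent (μ N (T + δ / 2) (T - δ / 2)) / δ) (𝓝[≠] 0) (𝓝 (Dn N))) →
              Tendsto Dn atTop (𝓝 κ) := by
  intro ω₂ lam β γ hω hl hβ hγ hU T hT hex
  obtain ⟨μ₁, D₁, κ₁, hG₁, hSI₁, hP₁, hAC₁, hκ₁, hlim₁⟩ := hex
  haveI : IsProbabilityMeasure μ₁ := hG₁.1
  have htight :=
    Summit.AtomisticToContinuum.FouriersLaw.Theorems.AbelThermodynamicLimit.SeriesLawAtEveryLaplaceFrequency.oneSiteTight_of_isShiftInvariant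
      (μ := μ₁) hSI₁
  obtain ⟨hS₁, hss₁⟩ :=
    Summit.AtomisticToContinuum.FouriersLaw.Theorems.AbelThermodynamicLimit.SeriesLawAtEveryLaplaceFrequency.tightRegular_of_tightUnique
      γ hω hl.le hβ.le hT (stub_tightDLRUnique ω₂ lam β γ hω hl hβ hγ T hT) μ₁ hG₁ htight
  have horb : ∀ᵐ σ ∂μ₁, ∀ t : ℝ, D₁.flow t σ ∈ (pinnedChain ω₂ lam β γ).bmGood :=
    OscillatorChain.ae_forall_flow_mem_bmGood_pinnedChain γ hω.le hl hβ hss₁ D₁ hP₁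
  obtain ⟨μT, D, κ, hG, hS, hss, hcar, hP, hAC, hκ, hAbel⟩ :=
    Summit.AtomisticToContinuum.FouriersLaw.Theorems.GreenKuboContinuation.TemperatureBlindVitaliHurwitz.regularWitness_of_regularState_of_aeOrbits
      D₁ hG₁ hP₁ hAC₁ hκ₁ hlim₁ hS₁ hss₁ horb
  refine ⟨μT, D, κ, ⟨hG, hP, hAC, hκ, hAbel⟩, ?_⟩
  intro μ hμ Dn hD
  exact tlconv_of_regularWitness hω hl hβ hγ hU hT hG hS hss hcar hP hAC hκ hAbel μ hμ Dn hD

/-! ## Landed composition (rev 9, lead c2) — the same reduction through the importable certificate p127321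

`Theorems/LatticeLandauDampingAbelThermodynamicLimitOfSignLaws.lean` proves the registered stub `stub_cruxOfSignLaws`
(QS → QSR → SI → crux) by factoring through the strategist's split: `abelThermodynamicLimit_of_halves`
(SI → NoOvershoot → NoDeficit → crux) after `noOvershoot_of_quasiSuperadditivity_shiftInvariant` (QS ⇒ NoOvershoot) and
`noDeficit_of_quasiSuperadditiveResistance_shiftInvariant` (QSR ⇒ NoDeficit). The two theorems below re-derive the skeleton's
conclusions from it, so the sorry-cone of the crux is visibly {QS, QSR, SI} and that of the REPAIRED crux {QS, QSR}. -/

/-- The crux BY NAME from the three open stubs through the LANDED composition `stub_cruxOfSignLaws` (p127321). -/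
theorem AbelThermodynamicLimit_of_landedComposition :
    Summit.AtomisticToContinuum.FouriersLaw.Theses.LatticeLandauDamping.AbelThermodynamicLimit :=
  Summit.AtomisticToContinuum.FouriersLaw.Theorems.AbelThermodynamicLimit.SeriesLawAtEveryLaplaceFrequency.stub_cruxOfSignLaws
    stub_quasiSuperadditivity stub_quasiSuperadditiveResistance stub_witnessShiftInvariant

/-- The planner-REPAIRED crux (shift-invariant witness clause in the hypothesis; conclusion verbatim) from QS ∧ QSR ALONE through
the LANDED `abelThermodynamicLimitRepaired_of_signLaws` (p127321) — no seam; sorry-cone exactly {QS, QSR}. -/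
theorem AbelThermodynamicLimitRepaired_of_landedComposition :
    ∀ ω₂ lam β γ : ℝ, 0 < ω₂ → 0 < lam → 0 < β → 0 < γ →
      (∀ (N : ℕ) (T_L T_R : ℝ), 0 < T_L → 0 < T_R → ∀ μ ν : Measure (PhaseSpace N),
        (pinnedChain ω₂ lam β γ).IsSteadyState N T_L T_R μ →
        (pinnedChain ω₂ lam β γ).IsSteadyState N T_L T_R ν → μ = ν) →
      ∀ T : ℝ, 0 < T →
        (∃ (μT : Measure ChainConfig) (D : InfiniteChainDynamics (pinnedChain ω₂ lam β γ)) (κ : ℝ),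
          (pinnedChain ω₂ lam β γ).IsChainGibbsMeasure T μT ∧ IsShiftInvariant μT ∧ D.PreservesMeasure μT ∧
          (∀ t : ℝ, D.HasAbsConvergentCorrelation μT t) ∧ 0 < κ ∧
          Tendsto (fun ν : ℝ => (T ^ 2)⁻¹ *
            ∫ t in Ioi (0 : ℝ), Real.exp (-(ν * t)) * D.currentCorrelation μT t) (𝓝[>] 0) (𝓝 κ)) →
        ∃ (μT : Measure ChainConfig) (D : InfiniteChainDynamics (pinnedChain ω₂ lam β γ)) (κ : ℝ),
          ((pinnedChain ω₂ lam β γ).IsChainGibbsMeasure T μT ∧ D.PreservesMeasure μT ∧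
            (∀ t : ℝ, D.HasAbsConvergentCorrelation μT t) ∧ 0 < κ ∧
            Tendsto (fun ν : ℝ => (T ^ 2)⁻¹ *
              ∫ t in Ioi (0 : ℝ), Real.exp (-(ν * t)) * D.currentCorrelation μT t) (𝓝[>] 0) (𝓝 κ)) ∧
          ∀ μ : (N : ℕ) → ℝ → ℝ → Measure (PhaseSpace N),
            (∀ (N : ℕ) (T_L T_R : ℝ), 0 < T_L → 0 < T_R →
              (pinnedChain ω₂ lam β γ).IsSteadyState N T_L T_R (μ N T_L T_R)) →
            ∀ Dn : ℕ → ℝ,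
              (∀ N : ℕ, Tendsto (fun δ : ℝ =>
                (pinnedChain ω₂ lam β γ).totalCurrent (μ N (T + δ / 2) (T - δ / 2)) / δ) (𝓝[≠] 0) (𝓝 (Dn N))) →
              Tendsto Dn atTop (𝓝 κ) :=
  Summit.AtomisticToContinuum.FouriersLaw.Theorems.AbelThermodynamicLimit.SeriesLawAtEveryLaplaceFrequency.abelThermodynamicLimitRepaired_of_signLaws
    stub_quasiSuperadditivity stub_quasiSuperadditiveResistance

/-! ## Second composition (rev 10, lead c2): through the EXISTING item (R) = stmt-AtomisticToContinuum-13416 -/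

/-! ### Rev 12 (lead c3, cycle 4, 2026-08-17): (R) OPENED ALONG ITS OWN BIRTH CUT — stubs byte-identical with
`Cruxes/UniformAbelianRegularity/Lines/birth.lean` (planner-skel-stmt-AtomisticToContinuum-13416-0, the registered skeleton of item
stmt-13416) and with the twin's `Lines/l1_tail_transport.lean` (stmt-12596), so that ONE landing serves the three chains.

The early/late split at an `N`-independent horizon `τ`: `|∫₀^∞(1−e^{−νt})c_N| ≤ ντ²·sup_t|c_N(t)| + ∫_τ^∞|c_N|` (`abel_deficit_le`).
* `stub_equalTimeBound` (EARLY, size M, WORKER): `|c_N(t)| ≤ C·N` — engine LANDED by this line in cycle 1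
  (`pinnedChain_abs_totalCurrentAutocorr_le_linear`, file `…FixedFrequencyMatchingAutocorrBound.lean`: `⟨J,P_tJ⟩ ≤ ‖J‖² ≤ 3MN`).
* `stub_uniformL1Tail` (LATE, birth's load-bearing stub 2, verbatim) is DERIVED here from its two conjuncts:
  `stub_autocorrIntegrableOn` (fixed-`N` integrability of `c_N` on `(0,∞)` for EVERY `N`, size S–M, WORKER: `pinnedChain_integrableOn_crossCorr`
  with `f = g = J`, `μ_T(J) = 0` by `integral_totalBondCurrent_gibbsMeasure`; `N = 0` trivial) and
  `stub_uniformAbsTail` (the TRUE RESIDUAL, XL, LEAD-HELD: `∀ ε ∃ τ ∃ N₀ ∀ N ≥ N₀, ∫_{(τ,∞)}|c_N| ≤ εN` — `N`-uniform absolute tail mass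
  of the open chain's total-current autocorrelation per unit length; sharp HasBoundedResponse in time-domain form (Disproof §3 NOT evaded);
  bets on bulk `C_T ∈ L¹` (STRATEGY-CENSUS N4/N7); false at the harmonic corner (`tlconv_harmonic_false`), so `lam, β > 0` act here).
* `stub_uniformAbelianRegularity` — (R) BY NAME — became a theorem modulo those stubs (`UniformAbelianRegularity_of`, birth's sorry-free glue).
Sorry-cones after rev 12: crux ⊇ {equalTimeBound, autocorrIntegrableOn, uniformAbsTail, CLB} (seam-free) or {…, SI}.
HISTORY NOTE (rev 14/15): the rev-12/13 theorems `stub_uniformAbsTail` (sorry) and `stub_uniformL1Tail` (derived) are SUPERSEDED by the signed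
route of `#### Rev 14` below and no longer appear in this file; their statements survive in hypothesis form in the LANDED
`Theorems/LatticeLandauDampingAbelThermodynamicLimitBirthCut.lean` (p146397: `uniformL1Tail_of_uniformAbsTail`,
`stub_uniformAbelianRegularityOfUniformAbsTail` — the absolute tail still closes (R) by name for whoever proves it). -/

/-- **Stub — `stub_equalTimeBound` — LANDED (p144650, rev 13; `Theorems/LatticeLandauDampingAbelThermodynamicLimitEqualTimeBound.lean`)** (EARLY: `N`-linear norm bound on the
equilibrium current autocorrelation; verbatim birth stub 1 of stmt-13416 and stub 1 of the twin's `l1_tail_transport`). For `pinnedChain ω₂ lam β γ` (all `> 0`) and `T > 0` there are `C` and `N₀`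
such that for all `N ≥ N₀` and `t > 0`, `|c_N(t)| = |∫ J·(P_t J) dμ_N| ≤ C·N`. Size M; worker; engine landed
(`pinnedChain_abs_totalCurrentAutocorr_le_linear`, even for all `N` and all `t`). -/
theorem stub_equalTimeBound :
    ∀ ω₂ lam β γ : ℝ, 0 < ω₂ → 0 < lam → 0 < β → 0 < γ → ∀ T : ℝ, 0 < T → ∃ C : ℝ, ∃ N₀ : ℕ, ∀ N : ℕ, N₀ ≤ N → ∀ t : ℝ, 0 < t → let J : Literature.MathematicalPhysics.KineticTheory.HeatConduction.PhaseSpace N → ℝ := fun z => ∑ i : Fin N, (Literature.MathematicalPhysics.KineticTheory.HeatConduction.pinnedChain ω₂ lam β γ).bondCurrent N i z; |∫ z, J z * (∫ y, J y ∂((Literature.MathematicalPhysics.KineticTheory.HeatConduction.pinnedChain ω₂ lam β γ).transitionKernel N T T t.toNNReal z)) ∂((Literature.MathematicalPhysics.KineticTheory.HeatConduction.pinnedChain ω₂ lam β γ).gibbsMeasure N T)| ≤ C * N :=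
  Summit.AtomisticToContinuum.FouriersLaw.Theorems.AbelThermodynamicLimit.SeriesLawAtEveryLaplaceFrequency.stub_equalTimeBound

/-- **Stub — `stub_autocorrIntegrableOn` — LANDED (p144688, rev 13; `Theorems/LatticeLandauDampingAbelThermodynamicLimitAutocorrIntegrableOn.lean`)** (fixed-`N` conjunct of
birth's stub 2): for EVERY `N`, `t ↦ c_N(t)` is integrable on `(0, ∞)`.
Size S–M; worker; engine landed: `pinnedChain_integrableOn_crossCorr` (CEHR exponential convergence at equilibrium, `N`-dependent rate —
harmless here) applied to `f = g = J` (continuous, exponential class: `continuous_totalBondCurrent`, `abs_totalBondCurrent_le_exp`,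
`quarter_inv_temp_admissible`; centred: `integral_totalBondCurrent_gibbsMeasure`); `N = 0`: the integrand is `0`. -/
theorem stub_autocorrIntegrableOn :
    ∀ ω₂ lam β γ : ℝ, 0 < ω₂ → 0 < lam → 0 < β → 0 < γ → ∀ T : ℝ, 0 < T → ∀ N : ℕ, let J : Literature.MathematicalPhysics.KineticTheory.HeatConduction.PhaseSpace N → ℝ := fun z => ∑ i : Fin N, (Literature.MathematicalPhysics.KineticTheory.HeatConduction.pinnedChain ω₂ lam β γ).bondCurrent N i z; MeasureTheory.IntegrableOn (fun t : ℝ => ∫ z, J z * (∫ y, J y ∂((Literature.MathematicalPhysics.KineticTheory.HeatConduction.pinnedChain ω₂ lam β γ).transitionKernel N T T t.toNNReal z)) ∂((Literature.MathematicalPhysics.KineticTheory.HeatConduction.pinnedChain ω₂ lam β γ).gibbsMeasure N T)) (Set.Ioi 0) :=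
  Summit.AtomisticToContinuum.FouriersLaw.Theorems.AbelThermodynamicLimit.SeriesLawAtEveryLaplaceFrequency.stub_autocorrIntegrableOn

/-! #### Rev 14 (lead c3, same cycle): the residual WEAKENED from the absolute to the SIGNED uniform tail — no `L¹` bet.
`∫_τ^∞ (1−e^{−νt}) c = (1−e^{−ντ})·G(τ) + ∫_τ^∞ νe^{−νs} G(s) ds` with `G(t) = ∫_t^∞ c` (Fubini on `τ < s < t`), so the late piece of
the Abel deficit is bounded by `sup_{t ≥ τ} |G(t)|` — the SIGNED tails — instead of `∫_τ^∞|c|` (`stub_abelDeficitOfSignedTail`, abstract real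
analysis, worker).  The residual becomes `stub_uniformSignedTail` (ST): `∀ ε ∃ τ ∃ N₀ ∀ N ≥ N₀ ∀ t ≥ τ, |∫_t^∞ c_N| ≤ εN` — implied by the
absolute tail (`uniformSignedTail_of_uniformAbsTail`, proved), sign-sensitive, and NOT betting on bulk `C_T ∈ L¹` (STRATEGY-CENSUS N4/N7 answered: it
asks only that the improper Green–Kubo integrals `(1/N)∫_0^t c_N` stabilise uniformly — convergence of `T²D_N` plus conditional convergence of
`∫_0^∞ C_T` plus no signed slow-mode mass, cf. p132484's two-limit form).  (R) by name := `uniformAbelianRegularity_of_signedTail` (glue, proved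
below) applied to the landed `stub_equalTimeBound`, `stub_autocorrIntegrableOn`, the worker's `stub_abelDeficitOfSignedTail` and ST. -/

/-- **Stub — `stub_abelDeficitOfSignedTail` — LANDED (p146330, `Theorems/LatticeLandauDampingAbelThermodynamicLimitAbelDeficitOfSignedTail.lean`)** (abstract real analysis). If `c ∈ L¹(0,∞)`, `|c| ≤ C` on `(0,∞)` and the SIGNED
tails satisfy `|∫_{(t,∞)} c| ≤ B` for all `t ≥ τ`, then for `ν, τ > 0`: `|∫_{(0,∞)} (1 − e^{−νt}) c(t) dt| ≤ ν τ² C + 2B` (early piece as in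
`abel_deficit_le`; late piece `= (1−e^{−ντ})G(τ) + ∫_τ^∞ νe^{−νs}G(s) ds` by Fubini/integration by parts, `G(t) = ∫_t^∞ c`, each term `≤ B`).
[folklore] -/
theorem stub_abelDeficitOfSignedTail :
    ∀ (c : ℝ → ℝ) (ν τ C B : ℝ), 0 < ν → 0 < τ → 0 ≤ C → 0 ≤ B → MeasureTheory.IntegrableOn c (Set.Ioi 0) → (∀ t : ℝ, 0 < t → |c t| ≤ C) → (∀ t : ℝ, τ ≤ t → |∫ s in Set.Ioi t, c s| ≤ B) → |∫ t in Set.Ioi (0:ℝ), (1 - Real.exp (-(ν * t))) * c t| ≤ ν * τ ^ 2 * C + 2 * B :=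
  Summit.AtomisticToContinuum.FouriersLaw.Theorems.AbelThermodynamicLimit.SeriesLawAtEveryLaplaceFrequency.stub_abelDeficitOfSignedTail

/-- **Stub — `stub_uniformSignedTail` (ST — THE RESIDUAL of (R), rev 14; XL; lead-held).** For `pinnedChain ω₂ lam β γ` (all `> 0`) and `T > 0`:
`∀ ε > 0 ∃ τ > 0 ∃ N₀ ∀ N ≥ N₀ ∀ t ≥ τ, |∫_{(t,∞)} c_N(s) ds| ≤ ε·N` — per unit length, the SIGNED Green–Kubo tails of the open chain's total-current
autocorrelation beyond an `N`-independent time are uniformly small (equivalently: the running integrals `(1/N)∫_0^t c_N` are uniformly `ε`-close to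
their limit `T²D_N(N−1)/N` for `t ≥ τ`, `N ≥ N₀`).  Weaker than the absolute tail (birth's bet), stronger than (R) by exactly a Tauberian condition
(uniform stabilisation instead of Abel means).  Why it might fail: signed slow-mode mass at times `N^a ≲ t ≲ N^{1+b}` (census D8/D9); false at the
harmonic corner (ballistic: `T²D_N ≍ N`). -/
theorem stub_uniformSignedTail :
    ∀ ω₂ lam β γ : ℝ, 0 < ω₂ → 0 < lam → 0 < β → 0 < γ → ∀ T : ℝ, 0 < T → ∀ ε : ℝ, 0 < ε → ∃ τ : ℝ, 0 < τ ∧ ∃ N₀ : ℕ, ∀ N : ℕ, N₀ ≤ N → ∀ t : ℝ, τ ≤ t → let J : Literature.MathematicalPhysics.KineticTheory.HeatConduction.PhaseSpace N → ℝ := fun z => ∑ i : Fin N, (Literature.MathematicalPhysics.KineticTheory.HeatConduction.pinnedChain ω₂ lam β γ).bondCurrent N i z; |∫ s in Set.Ioi t, ∫ z, J z * (∫ y, J y ∂((Literature.MathematicalPhysics.KineticTheory.HeatConduction.pinnedChain ω₂ lam β γ).transitionKernel N T T s.toNNReal z)) ∂((Literature.MathematicalPhysics.KineticTheory.HeatConduction.pinnedChain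 ω₂ lam β γ).gibbsMeasure N T)| ≤ ε * N := by
  sorry

/-- The absolute tail (13416's birth bet, `stub_uniformAbsTail`-statement) implies the signed uniform tail ST (`|∫_t^∞ c| ≤ ∫_t^∞|c| ≤ ∫_τ^∞|c|`
for `t ≥ τ`, using the landed fixed-`N` integrability `stub_autocorrIntegrableOn`). [folklore] -/
theorem uniformSignedTail_of_uniformAbsTail :
    (∀ ω₂ lam β γ : ℝ, 0 < ω₂ → 0 < lam → 0 < β → 0 < γ → ∀ T : ℝ, 0 < T → ∀ ε : ℝ, 0 < ε → ∃ τ : ℝ, 0 < τ ∧ ∃ N₀ : ℕ, ∀ N : ℕ, N₀ ≤ N → let J : Literature.MathematicalPhysics.KineticTheory.HeatConduction.PhaseSpace N → ℝ := fun z => ∑ i : Fin N, (Literature.MathematicalPhysics.KineticTheory.HeatConduction.pinnedChain ω₂ lam β γ).bondCurrent N i z; (∫ t in Set.Ioi τ, |∫ z, J z * (∫ y, J y ∂((Literature.MathematicalPhysics.KineticTheory.HeatConduction.pinnedChain ω₂ lam β γ).transitionKernel N T T t.toNNReal z)) ∂((Literature.MathematicalPhysics.KineticTheory.HeatConduction.pinnedChain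 ω₂ lam β γ).gibbsMeasure N T)|) ≤ ε * N) →
    ∀ ω₂ lam β γ : ℝ, 0 < ω₂ → 0 < lam → 0 < β → 0 < γ → ∀ T : ℝ, 0 < T → ∀ ε : ℝ, 0 < ε → ∃ τ : ℝ, 0 < τ ∧ ∃ N₀ : ℕ, ∀ N : ℕ, N₀ ≤ N → ∀ t : ℝ, τ ≤ t → let J : Literature.MathematicalPhysics.KineticTheory.HeatConduction.PhaseSpace N → ℝ := fun z => ∑ i : Fin N, (Literature.MathematicalPhysics.KineticTheory.HeatConduction.pinnedChain ω₂ lam β γ).bondCurrent N i z; |∫ s in Set.Ioi t, ∫ z, J z * (∫ y, J y ∂((Literature.MathematicalPhysics.KineticTheory.HeatConduction.pinnedChain ω₂ lam β γ).transitionKernel N T T s.toNNReal z)) ∂((Literature.MathematicalPhysics.KineticTheory.HeatConduction.pinnedChain ω₂ lam β γ).gibbsMeasure N T)| ≤ ε * N :=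
  Summit.AtomisticToContinuum.FouriersLaw.Theorems.AbelThermodynamicLimit.SeriesLawAtEveryLaplaceFrequency.uniformSignedTail_of_uniformAbsTail

/-- **GLUE (rev 14; LANDED p148211 `…SignedTail.lean`, rev 16 references it): EARLY bound → fixed-`N` integrability → the signed-tail Abel-deficit lemma →
ST → (R) BY NAME.**  Given `ε`: `τ, N₂` from ST at `ε/4`, `C, N₁` from the early bound, `C' = max C 1`, `ν₀ = ε/(2(C'τ²+1))`; for `0 < ν < ν₀` and
`N ≥ max N₁ N₂`: `|∫₀^∞(1−e^{−νt})c_N| ≤ ντ²C'N + 2(εN/4) ≤ εN`. [folklore] -/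
theorem uniformAbelianRegularity_of_signedTail :
    (∀ ω₂ lam β γ : ℝ, 0 < ω₂ → 0 < lam → 0 < β → 0 < γ → ∀ T : ℝ, 0 < T → ∃ C : ℝ, ∃ N₀ : ℕ, ∀ N : ℕ, N₀ ≤ N → ∀ t : ℝ, 0 < t → let J : Literature.MathematicalPhysics.KineticTheory.HeatConduction.PhaseSpace N → ℝ := fun z => ∑ i : Fin N, (Literature.MathematicalPhysics.KineticTheory.HeatConduction.pinnedChain ω₂ lam β γ).bondCurrent N i z; |∫ z, J z * (∫ y, J y ∂((Literature.MathematicalPhysics.KineticTheory.HeatConduction.pinnedChain ω₂ lam β γ).transitionKernel N T T t.toNNReal z)) ∂((Literature.MathematicalPhysics.KineticTheory.HeatConduction.pinnedChain ω₂ lam β γ).gibbsMeasure N T)| ≤ C * N) →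
    (∀ ω₂ lam β γ : ℝ, 0 < ω₂ → 0 < lam → 0 < β → 0 < γ → ∀ T : ℝ, 0 < T → ∀ N : ℕ, let J : Literature.MathematicalPhysics.KineticTheory.HeatConduction.PhaseSpace N → ℝ := fun z => ∑ i : Fin N, (Literature.MathematicalPhysics.KineticTheory.HeatConduction.pinnedChain ω₂ lam β γ).bondCurrent N i z; MeasureTheory.IntegrableOn (fun t : ℝ => ∫ z, J z * (∫ y, J y ∂((Literature.MathematicalPhysics.KineticTheory.HeatConduction.pinnedChain ω₂ lam β γ).transitionKernel N T T t.toNNReal z)) ∂((Literature.MathematicalPhysics.KineticTheory.HeatConduction.pinnedChain ω₂ lam β γ).gibbsMeasure N T)) (Set.Ioi 0)) →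
    (∀ (c : ℝ → ℝ) (ν τ C B : ℝ), 0 < ν → 0 < τ → 0 ≤ C → 0 ≤ B → MeasureTheory.IntegrableOn c (Set.Ioi 0) → (∀ t : ℝ, 0 < t → |c t| ≤ C) → (∀ t : ℝ, τ ≤ t → |∫ s in Set.Ioi t, c s| ≤ B) → |∫ t in Set.Ioi (0:ℝ), (1 - Real.exp (-(ν * t))) * c t| ≤ ν * τ ^ 2 * C + 2 * B) →
    (∀ ω₂ lam β γ : ℝ, 0 < ω₂ → 0 < lam → 0 < β → 0 < γ → ∀ T : ℝ, 0 < T → ∀ ε : ℝ, 0 < ε → ∃ τ : ℝ, 0 < τ ∧ ∃ N₀ : ℕ, ∀ N : ℕ, N₀ ≤ N → ∀ t : ℝ, τ ≤ t → let J : Literature.MathematicalPhysics.KineticTheory.HeatConduction.PhaseSpace N → ℝ := fun z => ∑ i : Fin N, (Literature.MathematicalPhysics.KineticTheory.HeatConduction.pinnedChain ω₂ lam β γ).bondCurrent N i z; |∫ s in Set.Ioi t, ∫ z, J z * (∫ y, J y ∂((Literature.MathematicalPhysics.KineticTheory.HeatConduction.pinnedChain ω₂ lam β γ).transitionKernel N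 T T s.toNNReal z)) ∂((Literature.MathematicalPhysics.KineticTheory.HeatConduction.pinnedChain ω₂ lam β γ).gibbsMeasure N T)| ≤ ε * N) →
    _root_.Summit.AtomisticToContinuum.FouriersLaw.Theses.StaticAbelianSqueeze.UniformAbelianRegularity :=
  Summit.AtomisticToContinuum.FouriersLaw.Theorems.AbelThermodynamicLimit.SeriesLawAtEveryLaplaceFrequency.uniformAbelianRegularity_of_signedTail

/-! #### Birth's glue (absolute-tail route) — LANDED as `Theorems/LatticeLandauDampingAbelThermodynamicLimitBirthCut.lean` (p146397): `abel_deficit_le`,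
`uniformAbelianRegularity_of_equalTimeBound_of_uniformL1Tail` (= birth's `UniformAbelianRegularity_of`), `uniformL1Tail_of_uniformAbsTail`, and the glue stubs
`stub_uniformAbelianRegularityOfUniformAbsTail` / `stub_cruxOfUniformAbsTailOfLowerBound` / `stub_latticeCruxOfRegularityOfLowerBound`. Restated here by reference,
in hypothesis form; since rev 14 the skeleton's own derivation of (R) uses the SIGNED route above. -/

/-- **The Abel-deficit estimate, abstract form** — LANDED (`…BirthCut.lean`, p146397). -/
theorem abel_deficit_le {c : ℝ → ℝ} {ν τ C B : ℝ} (hν : 0 < ν) (hτ : 0 < τ) (hC : 0 ≤ C)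
    (hint : IntegrableOn c (Ioi 0))
    (hbound : ∀ t : ℝ, 0 < t → |c t| ≤ C)
    (htail : (∫ t in Ioi τ, |c t|) ≤ B) :
    |∫ t in Ioi (0:ℝ), (1 - Real.exp (-(ν * t))) * c t| ≤ ν * τ ^ 2 * C + B :=
  Summit.AtomisticToContinuum.FouriersLaw.Theorems.AbelThermodynamicLimit.SeriesLawAtEveryLaplaceFrequency.abel_deficit_le hν hτ hC hint hbound htail

/-! ## The composition -/

/-- **The implication, sorry-free** (axioms `propext`, `Classical.choice`, `Quot.sound`):
`stub_equalTimeBound`-statement → `stub_uniformL1Tail`-statement → `StaticAbelianSqueeze.UniformAbelianRegularity` BY NAME.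
Given `ε`: `τ, N₂` from the tail stub at `ε/2`, `C, N₁` from the early stub, `C' = max C 1`, `ν₀ = ε/(2(C'τ²+1))`;
for `0 < ν < ν₀` and `N ≥ max N₁ N₂`, `abel_deficit_le` gives `|∫₀^∞(1−e^{−νt})c_N| ≤ ντ²C'N + εN/2 ≤ εN`. -/
theorem UniformAbelianRegularity_of :
    (∀ ω₂ lam β γ : ℝ, 0 < ω₂ → 0 < lam → 0 < β → 0 < γ → ∀ T : ℝ, 0 < T → ∃ C : ℝ, ∃ N₀ : ℕ, ∀ N : ℕ, N₀ ≤ N → ∀ t : ℝ, 0 < t → let J : Literature.MathematicalPhysics.KineticTheory.HeatConduction.PhaseSpace N → ℝ := fun z => ∑ i : Fin N, (Literature.MathematicalPhysics.KineticTheory.HeatConduction.pinnedChain ω₂ lam β γ).bondCurrent N i z; |∫ z, J z * (∫ y, J y ∂((Literature.MathematicalPhysics.KineticTheory.HeatConduction.pinnedChain ω₂ lam β γ).transitionKernel N T T t.toNNReal z)) ∂((Literature.MathematicalPhysics.KineticTheory.HeatConduction.pinnedChain ω₂ lam β γ).gibbsMeasure N T)| ≤ C * N) →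
    (∀ ω₂ lam β γ : ℝ, 0 < ω₂ → 0 < lam → 0 < β → 0 < γ → ∀ T : ℝ, 0 < T → ∀ ε : ℝ, 0 < ε → ∃ τ : ℝ, 0 < τ ∧ ∃ N₀ : ℕ, ∀ N : ℕ, N₀ ≤ N → let J : Literature.MathematicalPhysics.KineticTheory.HeatConduction.PhaseSpace N → ℝ := fun z => ∑ i : Fin N, (Literature.MathematicalPhysics.KineticTheory.HeatConduction.pinnedChain ω₂ lam β γ).bondCurrent N i z; MeasureTheory.IntegrableOn (fun t : ℝ => ∫ z, J z * (∫ y, J y ∂((Literature.MathematicalPhysics.KineticTheory.HeatConduction.pinnedChain ω₂ lam β γ).transitionKernel N T T t.toNNReal z)) ∂((Literature.MathematicalPhysics.KineticTheory.HeatConduction.pinnedChain ω₂ lam β γ).gibbsMeasure N T)) (Set.Ioi 0) ∧ (∫ t in Set.Ioi τ, |∫ z, J z * (∫ y, J y ∂((Literature.MathematicalPhysics.KineticTheory.HeatConduction.pinnedChain ω₂ lam β γ).transitionKernel N T T t.toNNReal z)) ∂((Literature.MathematicalPhysics.KineticTheory.HeatConduction.pinnedChain ω₂ lam β γ).gibbsMeasure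 N T)|) ≤ ε * N) →
    _root_.Summit.AtomisticToContinuum.FouriersLaw.Theses.StaticAbelianSqueeze.UniformAbelianRegularity :=
  Summit.AtomisticToContinuum.FouriersLaw.Theorems.AbelThermodynamicLimit.SeriesLawAtEveryLaplaceFrequency.uniformAbelianRegularity_of_equalTimeBound_of_uniformL1Tail

/-- **(R) — `stub_uniformAbelianRegularity`: UNIFORM ABELIAN REGULARITY, verbatim BY NAME the crux of route `StaticAbelianSqueeze`**
(item stmt-AtomisticToContinuum-13416).  Rev 10/11: registered as an atom (sorry).  Rev 12/13: a theorem modulo the birth-cut stubs (absolute tail).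
Rev 14: a THEOREM MODULO the worker's `stub_abelDeficitOfSignedTail` and the SIGNED residual `stub_uniformSignedTail` (the early bound and the fixed-`N`
integrability being landed). -/
theorem stub_uniformAbelianRegularity :
    Summit.AtomisticToContinuum.FouriersLaw.Theses.StaticAbelianSqueeze.UniformAbelianRegularity :=
  uniformAbelianRegularity_of_signedTail stub_equalTimeBound stub_autocorrIntegrableOn stub_abelDeficitOfSignedTail
    stub_uniformSignedTail

/-- **The crux BY NAME from (R) and the seam SI alone** (LANDED reduction `abelThermodynamicLimit_of_uniformAbelianRegularity`,
p127738): sorry-cone exactly {(R), SI}. -/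
theorem AbelThermodynamicLimit_of_uniformAbelianRegularity' :
    Summit.AtomisticToContinuum.FouriersLaw.Theses.LatticeLandauDamping.AbelThermodynamicLimit :=
  Summit.AtomisticToContinuum.FouriersLaw.Theorems.AbelThermodynamicLimit.SeriesLawAtEveryLaplaceFrequency.abelThermodynamicLimit_of_uniformAbelianRegularity
    stub_uniformAbelianRegularity stub_witnessShiftInvariant

/-- **The repair is a WEAKENING of the item** (for the planner's `route edit --restate`): the crux as filed implies the repaired
statement (stronger hypothesis, same conclusion) — nothing landed against the crux is lost by restating. [folklore] -/
theorem abelThermodynamicLimitRepaired_of_crux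
    (h : Summit.AtomisticToContinuum.FouriersLaw.Theses.LatticeLandauDamping.AbelThermodynamicLimit) :
    ∀ ω₂ lam β γ : ℝ, 0 < ω₂ → 0 < lam → 0 < β → 0 < γ →
      (∀ (N : ℕ) (T_L T_R : ℝ), 0 < T_L → 0 < T_R → ∀ μ ν : Measure (PhaseSpace N),
        (pinnedChain ω₂ lam β γ).IsSteadyState N T_L T_R μ →
        (pinnedChain ω₂ lam β γ).IsSteadyState N T_L T_R ν → μ = ν) →
      ∀ T : ℝ, 0 < T →
        (∃ (μT : Measure ChainConfig) (D : InfiniteChainDynamics (pinnedChain ω₂ lam β γ)) (κ : ℝ),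
          (pinnedChain ω₂ lam β γ).IsChainGibbsMeasure T μT ∧ IsShiftInvariant μT ∧ D.PreservesMeasure μT ∧
          (∀ t : ℝ, D.HasAbsConvergentCorrelation μT t) ∧ 0 < κ ∧
          Tendsto (fun ν : ℝ => (T ^ 2)⁻¹ *
            ∫ t in Ioi (0 : ℝ), Real.exp (-(ν * t)) * D.currentCorrelation μT t) (𝓝[>] 0) (𝓝 κ)) →
        ∃ (μT : Measure ChainConfig) (D : InfiniteChainDynamics (pinnedChain ω₂ lam β γ)) (κ : ℝ),
          ((pinnedChain ω₂ lam β γ).IsChainGibbsMeasure T μT ∧ D.PreservesMeasure μT ∧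
            (∀ t : ℝ, D.HasAbsConvergentCorrelation μT t) ∧ 0 < κ ∧
            Tendsto (fun ν : ℝ => (T ^ 2)⁻¹ *
              ∫ t in Ioi (0 : ℝ), Real.exp (-(ν * t)) * D.currentCorrelation μT t) (𝓝[>] 0) (𝓝 κ)) ∧
          ∀ μ : (N : ℕ) → ℝ → ℝ → Measure (PhaseSpace N),
            (∀ (N : ℕ) (T_L T_R : ℝ), 0 < T_L → 0 < T_R →
              (pinnedChain ω₂ lam β γ).IsSteadyState N T_L T_R (μ N T_L T_R)) →
            ∀ Dn : ℕ → ℝ,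
              (∀ N : ℕ, Tendsto (fun δ : ℝ =>
                (pinnedChain ω₂ lam β γ).totalCurrent (μ N (T + δ / 2) (T - δ / 2)) / δ) (𝓝[≠] 0) (𝓝 (Dn N))) →
              Tendsto Dn atTop (𝓝 κ) := by
  intro ω₂ lam β γ hω hl hβ hγ hU T hT hex
  obtain ⟨μT, D, κ, hG, _hS, hP, hAC, hκ, hlim⟩ := hex
  exact h ω₂ lam β γ hω hl hβ hγ hU T hT ⟨μT, D, κ, hG, hP, hAC, hκ, hlim⟩

/-! ## Third composition (rev 11, lead c2 after strategist s1): through the two EXISTING items (R) = stmt-13416 and CLB = stmt-11749 — NO SEAM -/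

/-- **Stub CLB — `stub_conductanceLowerBound`: CONDUCTANCE LOWER BOUND, verbatim BY NAME the crux of route `StaticAbelianSqueeze`**
(item stmt-AtomisticToContinuum-11749, shared by JunctionLocality / ParityLiouvilleSeed; XL): under weak-NESS uniqueness, along every
steady family, `T > 0` and response sequence `D`: `∃ c > 0, ∃ N₁, ∀ N ≥ N₁, c ≤ D N` (no insulator). NECESSARY for the crux given any
witness (twin's landed `stub_lowerBoundOfCrux`); with (R) SUFFICIENT without the seam (`stub_cruxOfRegularityOfLowerBound`, p127832).
Not worked in this line; registered so that the seam-free dependency {13416, 11749} is machine-visible. -/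
theorem stub_conductanceLowerBound :
    Summit.AtomisticToContinuum.FouriersLaw.Theses.StaticAbelianSqueeze.ConductanceLowerBound := by
  sorry

/-- **The crux BY NAME from (R) and CLB alone — no seam, the hypothesis witness unused** (twin's LANDED certificate p127832 for the
`rfl`-equal twin decl, transported by `crux_iff_sibling`): sorry-cone exactly {(R), CLB}. -/
theorem AbelThermodynamicLimit_of_regularity_lowerBound :
    Summit.AtomisticToContinuum.FouriersLaw.Theses.LatticeLandauDamping.AbelThermodynamicLimit :=
  crux_iff_sibling.2
    (Summit.AtomisticToContinuum.FouriersLaw.Theorems.AbelThermodynamicLimit.LoomisCompactHorizonWitness.stub_cruxOfRegularityOfLowerBound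
      stub_uniformAbelianRegularity stub_conductanceLowerBound)

/-- **The crux BY NAME from the ONE signed residual `stub_uniformSignedTail` and CLB** (rev 15):
sorry-cone exactly {uniformSignedTail, CLB}. -/
theorem AbelThermodynamicLimit_of_uniformSignedTail_lowerBound :
    Summit.AtomisticToContinuum.FouriersLaw.Theses.LatticeLandauDamping.AbelThermodynamicLimit :=
  crux_iff_sibling.2
    (Summit.AtomisticToContinuum.FouriersLaw.Theorems.AbelThermodynamicLimit.LoomisCompactHorizonWitness.stub_cruxOfRegularityOfLowerBound
      stub_uniformAbelianRegularity stub_conductanceLowerBound)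

/-- **The crux BY NAME over the ROUTE-FAITHFUL cone {uniformSignedTail, WD, NDW, PD}** (rev 17): (R) from the signed residual (landed
`stub_uniformAbelianRegularityOfUniformSignedTail`, through `stub_uniformAbelianRegularity`), the honest witness from the three spectral stubs, and the landed
`stub_repairedCruxOfUniformAbelianRegularity` (p127738); the γ-blind hypothesis witness is discarded. No seam, no CLB. -/
theorem AbelThermodynamicLimit_of_uniformSignedTail_window :
    Summit.AtomisticToContinuum.FouriersLaw.Theses.LatticeLandauDamping.AbelThermodynamicLimit := by
  intro ω₂ lam β γ hω hl hβ hγ hU T hT _hex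
  exact
    Summit.AtomisticToContinuum.FouriersLaw.Theorems.AbelThermodynamicLimit.SeriesLawAtEveryLaplaceFrequency.stub_repairedCruxOfUniformAbelianRegularity
      stub_uniformAbelianRegularity ω₂ lam β γ hω hl hβ hγ hU T hT
      (abelGreenKuboSI_of_window stub_windowDecomposition stub_noDrudeWeight stub_positiveDensity ω₂ lam β γ hω hl hβ hγ T hT)

/-- **Route-level record (rev 17)**: the CONJUNCT `FouriersLaw` over the same cone, through the route's own `closes` and the landed `NessUnique_holds` /
`FiniteResponseOfUnique_holds` — on route `LatticeLandauDamping` this crux costs nothing beyond the signed residual. -/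
theorem fouriersLaw_of_uniformSignedTail_window : _root_.FouriersLaw :=
  Summit.AtomisticToContinuum.FouriersLaw.Theses.LatticeLandauDamping.closes stub_windowDecomposition stub_noDrudeWeight stub_positiveDensity
    Summit.AtomisticToContinuum.FouriersLaw.Theorems.AbelOfSpectralDensity.latticeLandauDamping_abelOfSpectralDensity_proof
    AbelThermodynamicLimit_of_uniformSignedTail_window
    Summit.AtomisticToContinuum.FouriersLaw.Theses.LatticeLandauDamping.NessUnique_holds
    Summit.AtomisticToContinuum.FouriersLaw.Theses.LatticeLandauDamping.FiniteResponseOfUnique_holds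

/-- The same term closes the sibling crux (the two decls are `Iff.rfl`). Not a proof claim either. -/
theorem siblingCrux_of :
    Summit.AtomisticToContinuum.FouriersLaw.Theses.EmbeddedDrudeMourre.AbelThermodynamicLimit :=
  crux_iff_sibling.1 AbelThermodynamicLimit_of

end Summit.AtomisticToContinuum.FouriersLaw.Cruxes.AbelThermodynamicLimit.SeriesLawAtEveryLaplaceFrequency

end
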